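import Summits.AtomisticToContinuum.HydrodynamicLimit.Theses.CollisionIsometryCLT
import Summits.AtomisticToContinuum.HydrodynamicLimit.Theses.StiffCollisionalRelaxation
import Summits.AtomisticToContinuum.HydrodynamicLimit.Theorems.CollisionIsometryCLTCollisionalTransferLocalityDefs
import Summits.AtomisticToContinuum.HydrodynamicLimit.Theorems.CollisionIsometryCLTCollisionalTransferLocalityDefsB
import Summits.AtomisticToContinuum.HydrodynamicLimit.Theorems.CollisionIsometryCLTCollisionalTransferLocalityDefsC
import Summits.AtomisticToContinuum.HydrodynamicLimit.Theorems.CollisionIsometryCLTCollisionalTransferLocalityBalanceIdentity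
import Summits.AtomisticToContinuum.HydrodynamicLimit.Theorems.CollisionIsometryCLTCollisionalTransferLocalityAffineSlaving
import Summits.AtomisticToContinuum.HydrodynamicLimit.Theorems.CollisionIsometryCLTCollisionalTransferLocalitySlavingReductionAt
import Summits.AtomisticToContinuum.HydrodynamicLimit.Theorems.CollisionIsometryCLTCollisionalTransferLocalityFluxForm
import Summits.AtomisticToContinuum.HydrodynamicLimit.Theorems.CollisionIsometryCLTCollisionalTransferLocalityMarkedReduction
import Summits.AtomisticToContinuum.HydrodynamicLimit.Theorems.CollisionIsometryCLTCollisionalTransferLocalityVirialBoundedOfCollisionMomentBound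
import Summits.AtomisticToContinuum.HydrodynamicLimit.Theorems.CollisionIsometryCLTCollisionalTransferLocalityPressureEquation
import Summits.AtomisticToContinuum.HydrodynamicLimit.Theorems.CollisionIsometryCLTCollisionalTransferLocalityDiluteBlocksOfKineticRangeControl
import Summits.AtomisticToContinuum.HydrodynamicLimit.Theorems.CollisionIsometryCLTCollisionalTransferLocalityWeightedKineticRelaxationDilute
import Summits.AtomisticToContinuum.HydrodynamicLimit.Theorems.CollisionIsometryCLTCollisionalTransferLocalityEnergyAllTimes
import Summits.AtomisticToContinuum.HydrodynamicLimit.Theorems.CollisionIsometryCLTCollisionalTransferLocalityCompressibilityLinear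
import Summits.AtomisticToContinuum.HydrodynamicLimit.Theorems.CollisionIsometryCLTCollisionalTransferLocalityJumpIncrements
import Summits.AtomisticToContinuum.HydrodynamicLimit.Theorems.CollisionIsometryCLTCollisionalTransferLocalityGridReduction
import Summits.AtomisticToContinuum.HydrodynamicLimit.Theorems.CollisionIsometryCLTCollisionalTransferLocalityCcEquilibriumRung
import Summits.AtomisticToContinuum.HydrodynamicLimit.Theorems.CollisionIsometryCLTCollisionalTransferLocalityRhsSupConst
import Summits.AtomisticToContinuum.HydrodynamicLimit.Theorems.CollisionIsometryCLTCollisionalTransferLocalityEquilibriumSup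
-- import Summits.AtomisticToContinuum.HydrodynamicLimit.Theorems.CollisionIsometryCLTCollisionalTransferLocalityWindowDomination  -- restored once the farm has BUILT it (accepted p132091; unbuilt at v15/v16 registration)
import Summits.AtomisticToContinuum.HydrodynamicLimit.Theorems.CollisionIsometryCLTCollisionalTransferLocalityEnskogWindowBound
import Summits.AtomisticToContinuum.HydrodynamicLimit.Theorems.CollisionIsometryCLTCollisionalTransferLocalityMollifiedCeilingConst
import Summits.AtomisticToContinuum.HydrodynamicLimit.Theorems.CollisionIsometryCLTCollisionalTransferLocalityVirialTailConst
import Summits.AtomisticToContinuum.HydrodynamicLimit.Theorems.CollisionIsometryCLTCollisionalTransferLocalityBlockDensityLLNConst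
import Summits.AtomisticToContinuum.HydrodynamicLimit.Theorems.CollisionIsometryCLTCollisionalTransferLocalityBlockVelocityLLNConst
import Summits.AtomisticToContinuum.HydrodynamicLimit.Theorems.CollisionIsometryCLTCollisionalTransferLocalityConstLLNOfParts
import Summits.AtomisticToContinuum.HydrodynamicLimit.Theorems.CollisionIsometryCLTCollisionalTransferLocalityRhsSupOfConstLLN
import Summits.AtomisticToContinuum.HydrodynamicLimit.Theorems.CollisionIsometryCLTCollisionalTransferLocalityEquilibriumSupOfRhsSup
import Summits.AtomisticToContinuum.HydrodynamicLimit.Theorems.CollisionIsometryCLTCollisionalTransferLocalityChannelAdditivity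
import Summits.AtomisticToContinuum.HydrodynamicLimit.Theorems.CollisionIsometryCLTCollisionalTransferLocalityDefsD
import Summits.AtomisticToContinuum.HydrodynamicLimit.Theorems.CollisionIsometryCLTCollisionalTransferLocalityDefsE
import Summits.AtomisticToContinuum.HydrodynamicLimit.Theorems.CollisionIsometryCLTCollisionalTransferLocalityEnvelopeA
import Summits.AtomisticToContinuum.HydrodynamicLimit.Theorems.CollisionIsometryCLTCollisionalTransferLocalityMarkDominationA
import Summits.AtomisticToContinuum.HydrodynamicLimit.Theorems.CollisionIsometryCLTCollisionalTransferLocalityStressLawSupOfFixedA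
import Summits.AtomisticToContinuum.HydrodynamicLimit.Theorems.CollisionIsometryCLTCollisionalTransferLocalityMarkSumA
import Summits.AtomisticToContinuum.HydrodynamicLimit.Theorems.CollisionIsometryCLTCollisionalTransferLocalityMollCeilingOfBlockCeiling
import Summits.AtomisticToContinuum.HydrodynamicLimit.Theorems.CollisionIsometryCLTCollisionalTransferLocalityMarkSumAInert
import Summits.AtomisticToContinuum.HydrodynamicLimit.Theorems.CollisionIsometryCLTCollisionalTransferLocalityConeValue
import Summits.AtomisticToContinuum.HydrodynamicLimit.Theorems.CollisionIsometryCLTCollisionalTransferLocalityStressLawFixedAOfEvenStress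
import Summits.AtomisticToContinuum.HydrodynamicLimit.Theorems.CollisionIsometryCLTCollisionalTransferLocalityKfunAConst
import Summits.AtomisticToContinuum.HydrodynamicLimit.Theorems.CollisionIsometryCLTCollisionalTransferLocalityConeLLNConst
import Summits.AtomisticToContinuum.HydrodynamicLimit.Theorems.CollisionIsometryCLTCollisionalTransferLocalityRhsAConeConst
import Summits.AtomisticToContinuum.HydrodynamicLimit.Theorems.CollisionIsometryCLTCollisionalTransferLocalityRhsAConst
-- import Summits.AtomisticToContinuum.HydrodynamicLimit.Theorems.CollisionIsometryCLTCollisionalTransferLocalityDefsF  -- LANDED p147626 (TwoScaleValueRegularity); restored once built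
import Summits.AtomisticToContinuum.HydrodynamicLimit.Theorems.CollisionIsometryCLTCollisionalTransferLocalityKfunAConeConst
import Summits.AtomisticToContinuum.HydrodynamicLimit.Theorems.CollisionIsometryCLTCollisionalTransferLocalityTwoScaleValueARung0
import Summits.AtomisticToContinuum.HydrodynamicLimit.Theorems.CollisionIsometryCLTCollisionalTransferLocalityEnergyFluxLawOfCone
import Summits.AtomisticToContinuum.HydrodynamicLimit.Theorems.CollisionIsometryCLTCollisionalTransferLocalityValueChiConeConst
import Summits.AtomisticToContinuum.HydrodynamicLimit.Theorems.CollisionIsometryCLTCollisionalTransferLocalityValueChiMesoConst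
import Summits.AtomisticToContinuum.HydrodynamicLimit.Theses.JParityClosure
import Literature.MathematicalPhysics.KineticTheory.KineticEntropyBalanceFunctional
import Literature.Analysis.FunctionSpaces.TorusSpaceTime
-- (v11.1 registration note) `import …CollisionIsometryCLTCollisionalTransferLocalityRhsSupConst` is restored as soon as the farm has BUILT
-- that landed module (p127021, accepted 21:32Z); until then [R0] is carried as the registered, already-landed stub `Holds.rhs_sup_tendsto_zero_const`.
import Summits.AtomisticToContinuum.HydrodynamicLimit.Theorems.JParityClosureEvenStressEnskogRung0Closure
import Summits.AtomisticToContinuum.HydrodynamicLimit.Theorems.JParityClosureEvenStressEnskogValueFree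
import Literature.MathematicalPhysics.KineticTheory.EvenCollisionTubeFunctional
import Literature.MathematicalPhysics.KineticTheory.EvenStatTruncationBound
import Summits.AtomisticToContinuum.HydrodynamicLimit.Theorems.JParityClosureEvenStressEnskogRungZeroPinHelpers
import Literature.MathematicalPhysics.StatisticalMechanics.HardSphereContactTheoremProofs
import Summits.AtomisticToContinuum.HydrodynamicLimit.Theses.InformationPercolationEngine
import Summits.AtomisticToContinuum.HydrodynamicLimit.Theses.GermanoSplitLES
import HarnessLib

/-!
# SKELETON (lead's working copy, generation 1 / seat c11, v20) of line `hemisphere-affine-slaving`,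
crux `CollisionalTransferLocality` (stmt-AtomisticToContinuum-9518)

Lead: prover-line-stmt-AtomisticToContinuum-9518-c11-0 (2026-08-17, continuing seats c5 (v10), c6 (v11 plan), c7 (v11.1), c8 (v12–v14), c9 (v15–v17.2), c10 (v18–v19.4)).

## v20 (seat c11, 2026-08-17T14:30Z): THE ENERGY CHANNEL AT MACROSCALE — [Kq] ⟸ [KqR] ∧ [TSχ] via the glue [GKq]; rung-0 stubs [Vχ0C], [Vχ0M]
The registered mesoscale energy law [Kq] `stub_collisionalEnergyFluxLaw` is no longer a research stub: it is DERIVED (glue [GKq]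
`stub_collisionalEnergyFluxLaw_of_cone`, provable, wave 1) from [KqR] `stub_energyFluxLawCone` — the collisional energy-flux law at the FIXED
macroscopic cone radius `r` (`N → ∞` before `r → 0`), the energy sibling of `JParityClosure.EvenStressEnskog` (13079) and the one statement of the
Boltzmann–Enskog class no sibling item carries — and [TSχ] `stub_twoScaleValueChi` (two-scale regularity of the energy value functional, one-body;
twin of c10's [TS]). So ALL two-body content of the crux sits at macroscale (13079 by name + [KqR]) and ALL one-body content is two-scale regularity
([TS], [TSχ]) — which RoutePatchC11 (this seat) argues a closed-loop relative-entropy dock absorbs (the mesoscale↔macroscale commutator of the value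
functionals is second order in the hydrodynamic distance), so that neither needs to be an item. Compositions 1–2 keep their names and conclusions
(`CollisionalTransferLocality_of` now takes `hKqR hTSχ` in place of `hKq`; the v19.4 forms survive as `…_of_Kq`). NEW PROVABLE stubs (wave 1):
[GKq]; [Vχ0C] `stub_valueChi_cone_const`, [Vχ0M] `stub_valueChi_meso_const` (equilibrium rungs of the two sides of [TSχ]); composition 6a/6b
(sorry-free modulo them): `twoScaleValueChi_rung0`, `energyFluxLawCone_rung0` — the equilibrium rungs of [TSχ] and [KqR] (normalisation
certificates). Registered sorries of v20: [TS], [TSχ], [KqR], [S'] (RESEARCH) + [GKq], [Vχ0C], [Vχ0M] (PROVABLE, wave 1) = 7.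
## v20.1 (seat c11): WAVE 1 LANDED 3/3 — [GKq] p164424, [Vχ0C] p166460, [Vχ0M] p166653 CLOSED BY NAME; compositions 6a/6b are sorry-free;
the equilibrium-rung window glue re-landed (…EquilibriumRungWindowGlue p167842; …EquilibriumRungAssembly in flight). Registered sorries of v20.1: [TS], [TSχ], [KqR], [S'] = 4, ALL RESEARCH.

## v18–v19.4 (seat c10): HISTORY COMPRESSED (file must stay ≤ 200 kB; full text in seat c10's published version of this skeleton,
crux-dir git history 2026-08-17T08:10Z, and `Cruxes/…/NOTES.md` + `RoutePatchC10.md`) — v18: [Kσ] reshaped into the engine-natural fixed-time law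
[KσA] for even rank-2 marks with an arbitrary smooth matrix weight (…DefsE p141085) + glue [EnvA] p142275, [DomA] p142443, [SupA] p142817, [DψA]
p142441; v19: [KσA] DOCKED on the sibling crux `JParityClosure.EvenStressEnskog` (13079) BY NAME — [DockA] p145343 with [CeilR] p143878, [DψA']
p143643, [ConeVal] p144303, certificate `collisionalStressLaw_of_evenStress_of_twoScale` (…MomentumEngineOfEvenStress p147603); the one-body
residue [TS] `stub_twoScaleValueA` (= `TwoScaleValueRegularity`, …DefsF p147626); v19.2–19.4: the equilibrium rung of [TS] (`twoScaleValueA_rung0`,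
…TwoScaleValueARung0Assembly p147818, from [R0A] p147558, [K0A] p146306, [C0L] p145695, [R0C] p147290, [K0C] p146422, [TS0] p146096); assembly
certificates …ItemsAssemblyC10 p148188. Registered sorries of v19.4: [TS], [Kq], [S'].

## v9–v17.2 (seats c4–c9): HISTORY COMPRESSED (the file must stay ≤ 200 kB): see seat c9's published version of this skeleton
(`Lines/hemisphere_affine_slaving.lean` @ crux-dir commit e9fb5fa657de, 2026-08-17T03:01Z) and `Cruxes/…/NOTES.md` for the full record —
v9 (c4): [C] p117619, [E] p117570, [Z] p117576 landed; v10 (c5): [A'-chaos]+[B-dyn] merged into [M]°, `stub_markedReduction` p120490;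
v11–v14 (c6–c8): the EQUILIBRIUM RUNG of the crux, unconditional (`equilibriumRungFlow_unconditional`, p136415; ten stubs p133771 p132091 p132356
p132076 p132116 p135857 p135595 p134699 p134580 p134600); v15–v17.2 (c9): [M]° split by channel, [G2] `stub_channelAdditivity` p139073, engine stubs
[Kσ]/[Kq] in fileable shape (…DefsD), channel split p139580, LawsAssembly p140435.

-/


namespace Summit.AtomisticToContinuum.HydrodynamicLimit.Theorems.HemisphereAffineSlaving

open scoped BigOperators Topology Classical ENNReal InnerProductSpace
open Filter Set Function MeasureTheory

noncomputable section

open Literature.MathematicalPhysics.KineticTheory (T3 V3)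
open Literature.Analysis.FunctionSpaces



/-! ## Registered stubs (`Holds.stub_*`; open ones have body `sorry`) -/

namespace Holds

/-- STUB [R0] `rhs_sup_tendsto_zero_const` — LANDED (p127021, seat c6, module `…RhsSupConst`, accepted 2026-08-16T21:32Z) and
to be CLOSED BY NAME (`:= …HemisphereAffineSlaving.rhs_sup_tendsto_zero_const`) as soon as the farm has BUILT that module — at v12
registration (2026-08-16T23:50Z) `lean check` still answers `remote:stale:unbuilt:…RhsSupConst`, so the registered signature is carried
verbatim with a `sorry` body that credits nothing and asks nothing: the statement IS accepted tree content (p127021). The Rhs side of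
the equilibrium rung, `sup_τ |Rhs(τ)| → 0` in probability under the homogeneous law, from `MesoscopicLLN` (9524) by name. [v13: CLOSED BY NAME — the farm has built `…RhsSupConst`.]
-/
theorem rhs_sup_tendsto_zero_const : Summit.AtomisticToContinuum.HydrodynamicLimit.Theses.StiffCollisionalRelaxation.MesoscopicLLN → ∀ θ : ℝ, 0 < θ → ∃ σ₀ : ℝ, 0 < σ₀ ∧ ∀ σ : ℝ, 0 < σ → σ < σ₀ → ∀ (Φ : Flows σ) (t : ℝ), 0 < t → ∀ (γ C : ℝ) (φ : ℕ → T3 → ℝ), 0 < γ → γ ≤ 1 / 15 → AdmissibleKernel γ C φ → ∀ (ψ : ℝ → T3 → V3) (χ : ℝ → T3 → ℝ), Literature.Analysis.FunctionSpaces.Torus.IsSmoothSpaceTimeOn (Icc 0 t) ψ → Literature.Analysis.FunctionSpaces.Torus.IsSmoothSpaceTimeOn (Icc 0 t) χ → ∀ δ : ℝ, 0 < δ → Tendsto (fun N : ℕ => Literature.MathematicalPhysics.KineticTheory.localGibbsLaw σ (fun _ => 1) (fun _ => 0) (fun _ => θ) N (Φ N) {z | ∃ τ ∈ Icc 0 t,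 δ < |Rhs σ Φ φ ψ χ N z τ|}) atTop (𝓝 0) :=
  Summit.AtomisticToContinuum.HydrodynamicLimit.Theorems.HemisphereAffineSlaving.rhs_sup_tendsto_zero_const


/-! ### v19.2 (seat c10): THE EQUILIBRIUM RUNG OF [TS] — five provable stubs (wave 3) -/

/-- [R0A] PROVABLE (wave 3): THE VALUE `RhsA` AT GLOBAL EQUILIBRIUM, mesoscale kernel. Under the homogeneous local Gibbs law (`a₀ ≡ 1`,
`u₀ ≡ 0`, `θ₀ ≡ θ`; flow-invariant) at small `σ`, for every flow family, `t > 0`, admissible kernel family, smooth matrix weight `A` on `[0, t]` and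
FIXED `τ ≤ t`: `RhsA_N(τ) → θ (Z(σ³) − 1) ∫₀^τ∫ tr A` in probability. Ingredients (all landed): the constant-profile mesoscopic LLN
(`stub_blockDensityLLNConst` p135857, `stub_blockVelocityLLNConst` p135595, `stub_constLLN_of_parts` p134699: `∫((ρ̄−1)² + |m̄|² + (Ē − 3θ/2)²) → 0`
at each fixed time, flow invariance `localGibbsLaw_preimage_flow`-type as used in …RhsSupOfConstLLN), the dilute ceiling at equilibrium
(`ceilingAllTimes_const` p118206 / `stub_mollifiedCeilingConst`), the pointwise estimate of …RhsPointwise with `div ψ ↦ tr A`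
(`|tr A · p_c(ρ̄, θ̄) − tr A · θ(Z(σ³) − 1)| ≤ C(|Ē − 3θ/2| + σ³|m̄|² + θ|Z(ρ̄σ³) − Z(σ³)|) + …`, continuity of `Z` at `σ³`
`…CompressibilityContinuous`), time integration in probability (…TimeIntegralInProbability). Template: `stub_rhsSup_of_constLLN` (…RhsSupOfConstLLN)
— here fixed `τ` and a NON-ZERO limit (no `∫ div ψ = 0`). -/
theorem stub_rhsA_const : ∀ θ : ℝ, 0 < θ → ∃ σ₀ : ℝ, 0 < σ₀ ∧ ∀ σ : ℝ, 0 < σ → σ < σ₀ → ∀ (Φ : Flows σ) (t : ℝ), 0 < t → ∀ (γ C : ℝ) (φ : ℕ → T3 → ℝ), 0 < γ → γ ≤ 1 / 15 → AdmissibleKernel γ C φ → ∀ (A : ℝ → T3 → Fin 3 → Fin 3 → ℝ), SmoothMatrixOn (Icc 0 t) A → ∀ τ ∈ Icc 0 t, ∀ δ : ℝ, 0 < δ → Tendsto (fun N : ℕ => Literature.MathematicalPhysics.KineticTheory.localGibbsLaw σ (fun _ => 1) (fun _ => 0) (fun _ => θ) N (Φ N) {z | δ < |RhsA σ Φ φ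 A N z τ - θ * (Literature.MathematicalPhysics.KineticTheory.hsCompressibility (σ ^ 3) - 1) * ∫ s in Icc 0 τ, ∫ x, trW A s x|}) atTop (𝓝 0) :=
  Summit.AtomisticToContinuum.HydrodynamicLimit.Theorems.HemisphereAffineSlaving.stub_rhsA_const  -- LANDED p147558

/-- [K0A] PROVABLE (wave 3): THE KINETIC CORRECTION `KfunA` VANISHES AT GLOBAL EQUILIBRIUM, mesoscale kernel. Same frame as [R0A]; `KfunA_N(τ) → 0` in
probability: the AM–GM envelope `|kinWA · p_c| ≤ C_A[12Kη₁ε + 18εK²σ³η₁Ē + (12Kη₁ + 9)ε⁻¹(ΣD̄² + |q̄|²)]` (pattern `abs_integrand_dilute_le` /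
`abs_Kfun_dilute_le` of …WeightedKineticRelaxationDilute with `gradPsi ↦ A`, `gradChi ↦ 0`; or `EnvelopeA.abs_kinWA_mul_pcoll_le`), the kinetic
closure at equilibrium `fmrAt_const` (p140447, …FmrRung0: `FMRAt σ 1 θ 0`, i.e. `∫₀ᵗ∫(ΣD̄² + |q̄|²) → 0` in probability for admissible kernels),
the energy cap [E] and the dilute ceiling at equilibrium. Template: `stub_weightedKineticRelaxationDilute` (p117619). -/
theorem stub_kfunA_const : ∀ θ : ℝ, 0 < θ → ∃ σ₀ : ℝ, 0 < σ₀ ∧ ∀ σ : ℝ, 0 < σ → σ < σ₀ → ∀ (Φ : Flows σ) (t : ℝ), 0 < t → ∀ (γ C : ℝ) (φ : ℕ → T3 → ℝ), 0 < γ → γ ≤ 1 / 15 → AdmissibleKernel γ C φ → ∀ (A : ℝ → T3 → Fin 3 → Fin 3 → ℝ), SmoothMatrixOn (Icc 0 t) A → ∀ τ ∈ Icc 0 t, ∀ δ : ℝ, 0 < δ → Tendsto (fun N : ℕ => Literature.MathematicalPhysics.KineticTheory.localGibbsLaw σ (fun _ => 1) (fun _ => 0) (fun _ => θ) N (Φ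 N) {z | δ < |KfunA σ Φ φ A N z τ|}) atTop (𝓝 0) :=
  Summit.AtomisticToContinuum.HydrodynamicLimit.Theorems.HemisphereAffineSlaving.stub_kfunA_const  -- LANDED p146306

/-- [C0L] PROVABLE (statics, wave 3): THE CONSTANT-PROFILE LLN FOR CONE-KERNEL BLOCK FIELDS. For small `σ`, every `θ > 0`, flow family and FIXED
radius `0 < r < 1/4`: `∫((ρ_r − 1)² + |m_r|² + (e_r − 3θ/2)²) dx → 0` in probability under the homogeneous local Gibbs law (at time `0`; consumers
transport it along the flow by invariance), where `ρ_r, m_r, e_r` are the block fields `rhoB/mB/EB` of the cone kernel `fun _ y => coneKernel r y 0`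
(= `mollDensity/mollMomentum/mollKineticEnergy`, `ConeValue.rhoB_cone` …). Density: `Literature…HardSphereUniformDensityLLN`
(`tendsto_posGibbs_exists_density_dev`, `tendsto_integral_integral_sq_empDensity_sub_one`) transported to `localGibbsLaw` as in
…BlockDensityLLNConstStatics; velocities: Gaussian statics as in …BlockVelocityLLNConst (the kernel there is only used through `0 ≤ φ ≤ Φ_b`,
`∫φ = 1`). -/
theorem stub_coneLLNConst : ∃ σ₀ : ℝ, 0 < σ₀ ∧ ∀ σ : ℝ, 0 < σ → σ < σ₀ → ∀ θ : ℝ, 0 < θ → ∀ (Φ : Flows σ) (r : ℝ), 0 < r → r < 1 / 4 → ∀ δ : ℝ, 0 < δ → Tendsto (fun N : ℕ => Literature.MathematicalPhysics.KineticTheory.localGibbsLaw σ (fun _ => 1) (fun _ => 0) (fun _ => θ) N (Φ N) {z | δ < ∫ x, ((rhoB (fun (_ : ℕ) (y : T3) => Literature.MathematicalPhysics.KineticTheory.coneKernel r y 0) N z x - 1) ^ 2 + ‖mB (fun (_ : ℕ) (y : T3) => Literature.MathematicalPhysics.KineticTheory.coneKernel r y 0) N z x‖ ^ 2 + (EB (fun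 (_ : ℕ) (y : T3) => Literature.MathematicalPhysics.KineticTheory.coneKernel r y 0) N z x - 3 / 2 * θ) ^ 2)}) atTop (𝓝 0) :=
  Summit.AtomisticToContinuum.HydrodynamicLimit.Theorems.HemisphereAffineSlaving.stub_coneLLNConst  -- LANDED p145695

/-- [R0C] PROVABLE (wave 3): THE VALUE `RhsA` AT GLOBAL EQUILIBRIUM, CONE kernel of fixed radius. [C0L] ⟹ for small `σ`, every `θ > 0`, flow family,
`t > 0`, `0 < r < 1/4`, smooth `A`, fixed `τ ≤ t`: `RhsA[b_r](τ) → θ(Z(σ³) − 1)∫₀^τ∫ tr A` in probability. Same proof as [R0A] with the cone kernel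
(continuous, nonnegative, mass one for `r < 1/2`, bounded by `3/(πr³)`) and the mollified ceiling `stub_mollifiedCeilingConst` (p132076:
`mollDensity r ≤ 2` on `[0, t]` w.h.p.) as the dilute input. -/
theorem stub_rhsA_cone_const : (∃ σ₀ : ℝ, 0 < σ₀ ∧ ∀ σ : ℝ, 0 < σ → σ < σ₀ → ∀ θ : ℝ, 0 < θ → ∀ (Φ : Flows σ) (r : ℝ), 0 < r → r < 1 / 4 → ∀ δ : ℝ, 0 < δ → Tendsto (fun N : ℕ => Literature.MathematicalPhysics.KineticTheory.localGibbsLaw σ (fun _ => 1) (fun _ => 0) (fun _ => θ) N (Φ N) {z | δ < ∫ x, ((rhoB (fun (_ : ℕ) (y : T3) => Literature.MathematicalPhysics.KineticTheory.coneKernel r y 0) N z x - 1) ^ 2 + ‖mB (fun (_ : ℕ) (y : T3) => Literature.MathematicalPhysics.KineticTheory.coneKernel r y 0) N z x‖ ^ 2 + (EB (fun (_ : ℕ) (y : T3) => Literature.MathematicalPhysics.KineticTheory.coneKernel r y 0) N z x - 3 / 2 * θ) ^ 2)}) atTop (𝓝 0)) → ∀ θ : ℝ, 0 < θ → ∃ σ₀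 : ℝ, 0 < σ₀ ∧ ∀ σ : ℝ, 0 < σ → σ < σ₀ → ∀ (Φ : Flows σ) (t : ℝ), 0 < t → ∀ (r : ℝ), 0 < r → r < 1 / 4 → ∀ (A : ℝ → T3 → Fin 3 → Fin 3 → ℝ), SmoothMatrixOn (Icc 0 t) A → ∀ τ ∈ Icc 0 t, ∀ δ : ℝ, 0 < δ → Tendsto (fun N : ℕ => Literature.MathematicalPhysics.KineticTheory.localGibbsLaw σ (fun _ => 1) (fun _ => 0) (fun _ => θ) N (Φ N) {z | δ < |RhsA σ Φ (fun (_ : ℕ) (y : T3) => Literature.MathematicalPhysics.KineticTheory.coneKernel r y 0) A N z τ - θ * (Literature.MathematicalPhysics.KineticTheory.hsCompressibility (σ ^ 3) - 1) * ∫ s in Icc 0 τ, ∫ x, trW A s x|}) atTop (𝓝 0) :=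
  Summit.AtomisticToContinuum.HydrodynamicLimit.Theorems.HemisphereAffineSlaving.stub_rhsA_cone_const  -- LANDED p147290

/-- [K0C] PROVABLE (statics + envelope, wave 3): `KfunA` VANISHES AT GLOBAL EQUILIBRIUM, CONE kernel of fixed radius. For small `σ`, `θ > 0`, flow
family, `t > 0`, `0 < r < 1/4`, smooth `A`, fixed `τ ≤ t`: `KfunA[b_r](τ) → 0` in probability. `|kinWA · p_c| ≤ (2/5)·9 C_A |D̄_r|_max · |Z(ρ_rσ³) − 1|
≤ C C_A K σ³ ρ_r Σ|D̄_r,ab|` on the mollified-ceiling event, and the traceless cone second moment `D̄_r` has conditional mean `O(θ/(N r³))` and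
conditional variance `O(θ²/(N r³))` given the positions (velocities i.i.d. Gaussian under the local Gibbs law, `GaussMarks` moments), so
`E ∫₀^τ∫ Σ D̄_r² dx ds → 0` (Fubini + flow invariance) and Markov; energy cap [E] for the `Ē`-weighted terms. -/
theorem stub_kfunA_cone_const : ∀ θ : ℝ, 0 < θ → ∃ σ₀ : ℝ, 0 < σ₀ ∧ ∀ σ : ℝ, 0 < σ → σ < σ₀ → ∀ (Φ : Flows σ) (t : ℝ), 0 < t → ∀ (r : ℝ), 0 < r → r < 1 / 4 → ∀ (A : ℝ → T3 → Fin 3 → Fin 3 → ℝ), SmoothMatrixOn (Icc 0 t) A → ∀ τ ∈ Icc 0 t, ∀ δ : ℝ, 0 < δ → Tendsto (fun N : ℕ => Literature.MathematicalPhysics.KineticTheory.localGibbsLaw σ (fun _ => 1) (fun _ => 0) (fun _ => θ) N (Φ N) {z | δ < |KfunA σ Φ (fun (_ : ℕ) (y : T3) => Literature.MathematicalPhysics.KineticTheory.coneKernel r y 0) A N z τ|}) atTop (𝓝 0) :=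
  Summit.AtomisticToContinuum.HydrodynamicLimit.Theorems.HemisphereAffineSlaving.stub_kfunA_cone_const  -- LANDED p146422

/-- [TS0] PROVABLE (pure bookkeeping, wave 3): THE EQUILIBRIUM RUNG OF [TS] from [R0A], [K0A], [R0C] (conclusion), [K0C]: triangle inequality through the
common deterministic limit `θ(Z(σ³) − 1)∫₀^τ∫ tr A` at levels `η/4`, `Tendsto → ∃ N₀` at probability `δ/4` each, `r₀ := 1/4`, `η₁ := 1` (the
dilute hypothesis is not needed at equilibrium and is simply carried). Conclusion = [TS] `stub_twoScaleValueA` at the constant profiles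
`(fun _ => 1, fun _ => θ, fun _ => 0)`. -/
theorem stub_twoScaleValueA_rung0 : (∀ θ : ℝ, 0 < θ → ∃ σ₀ : ℝ, 0 < σ₀ ∧ ∀ σ : ℝ, 0 < σ → σ < σ₀ → ∀ (Φ : Flows σ) (t : ℝ), 0 < t → ∀ (γ C : ℝ) (φ : ℕ → T3 → ℝ), 0 < γ → γ ≤ 1 / 15 → AdmissibleKernel γ C φ → ∀ (A : ℝ → T3 → Fin 3 → Fin 3 → ℝ), SmoothMatrixOn (Icc 0 t) A → ∀ τ ∈ Icc 0 t, ∀ δ : ℝ, 0 < δ → Tendsto (fun N : ℕ => Literature.MathematicalPhysics.KineticTheory.localGibbsLaw σ (fun _ => 1) (fun _ => 0) (fun _ => θ) N (Φ N) {z | δ < |RhsA σ Φ φ A N z τ - θ * (Literature.MathematicalPhysics.KineticTheory.hsCompressibility (σ ^ 3) - 1) * ∫ s in Icc 0 τ, ∫ x, trW A s x|}) atTop (𝓝 0)) → (∀ θ : ℝ, 0 < θ → ∃ σ₀ : ℝ, 0 < σ₀ ∧ ∀ σ : ℝ, 0 < σ → σ < σ₀ → ∀ (Φ : Flows σ) (t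 : ℝ), 0 < t → ∀ (γ C : ℝ) (φ : ℕ → T3 → ℝ), 0 < γ → γ ≤ 1 / 15 → AdmissibleKernel γ C φ → ∀ (A : ℝ → T3 → Fin 3 → Fin 3 → ℝ), SmoothMatrixOn (Icc 0 t) A → ∀ τ ∈ Icc 0 t, ∀ δ : ℝ, 0 < δ → Tendsto (fun N : ℕ => Literature.MathematicalPhysics.KineticTheory.localGibbsLaw σ (fun _ => 1) (fun _ => 0) (fun _ => θ) N (Φ N) {z | δ < |KfunA σ Φ φ A N z τ|}) atTop (𝓝 0)) → (∀ θ : ℝ, 0 < θ → ∃ σ₀ : ℝ, 0 < σ₀ ∧ ∀ σ : ℝ, 0 < σ → σ < σ₀ → ∀ (Φ : Flows σ) (t : ℝ), 0 < t → ∀ (r : ℝ), 0 < r → r < 1 / 4 → ∀ (A : ℝ → T3 → Fin 3 → Fin 3 → ℝ), SmoothMatrixOn (Icc 0 t) A → ∀ τ ∈ Icc 0 t, ∀ δ : ℝ, 0 < δ → Tendsto (fun N : ℕ => Literature.MathematicalPhysics.KineticTheory.localGibbsLaw σ (fun _ => 1) (fun _ => 0) (fun _ => θ) N (Φ N) {z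 | δ < |RhsA σ Φ (fun (_ : ℕ) (y : T3) => Literature.MathematicalPhysics.KineticTheory.coneKernel r y 0) A N z τ - θ * (Literature.MathematicalPhysics.KineticTheory.hsCompressibility (σ ^ 3) - 1) * ∫ s in Icc 0 τ, ∫ x, trW A s x|}) atTop (𝓝 0)) → (∀ θ : ℝ, 0 < θ → ∃ σ₀ : ℝ, 0 < σ₀ ∧ ∀ σ : ℝ, 0 < σ → σ < σ₀ → ∀ (Φ : Flows σ) (t : ℝ), 0 < t → ∀ (r : ℝ), 0 < r → r < 1 / 4 → ∀ (A : ℝ → T3 → Fin 3 → Fin 3 → ℝ), SmoothMatrixOn (Icc 0 t) A → ∀ τ ∈ Icc 0 t, ∀ δ : ℝ, 0 < δ → Tendsto (fun N : ℕ => Literature.MathematicalPhysics.KineticTheory.localGibbsLaw σ (fun _ => 1) (fun _ => 0) (fun _ => θ) N (Φ N) {z | δ < |KfunA σ Φ (fun (_ : ℕ) (y : T3) => Literature.MathematicalPhysics.KineticTheory.coneKernel r y 0) A N z τ|}) atTop (𝓝 0)) → ∀ θ : ℝ, 0 < θ → ∃ σ₀ : ℝ, 0 < σ₀ ∧ ∃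 η₁ : ℝ, 0 < η₁ ∧ ∀ σ : ℝ, 0 < σ → σ < σ₀ → ∀ (Φ : Flows σ) (t : ℝ), 0 < t → ∀ (γ C : ℝ) (φ : ℕ → T3 → ℝ), 0 < γ → γ ≤ 1 / 15 → AdmissibleKernel γ C φ → DiluteAt σ (fun _ => 1) (fun _ => θ) (fun _ => 0) Φ t φ η₁ → ∀ (A : ℝ → T3 → Fin 3 → Fin 3 → ℝ), SmoothMatrixOn (Icc 0 t) A → ∀ τ ∈ Icc 0 t, ∀ η δ : ℝ, 0 < η → 0 < δ → ∃ r₀ : ℝ, 0 < r₀ ∧ ∀ r : ℝ, 0 < r → r < r₀ → ∃ N₀ : ℕ, ∀ N : ℕ, N₀ ≤ N → Literature.MathematicalPhysics.KineticTheory.localGibbsLaw σ (fun _ => 1) (fun _ => 0) (fun _ => θ) N (Φ N) {z | η < |(RhsA σ Φ (fun (_ : ℕ) (y : T3) => Literature.MathematicalPhysics.KineticTheory.coneKernel r y 0) A N z τ + KfunA σ Φ (fun (_ : ℕ) (y : T3) => Literature.MathematicalPhysics.KineticTheory.coneKernel r y 0) A N z τ) - (RhsA σ Φ φ A N z τ +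 KfunA σ Φ φ A N z τ)|} ≤ ENNReal.ofReal δ :=
  Summit.AtomisticToContinuum.HydrodynamicLimit.Theorems.HemisphereAffineSlaving.stub_twoScaleValueA_rung0  -- LANDED p146096

/-! ### v18 (seat c10): THE MOMENTUM ENGINE IN ENGINE-NATURAL FORM — [KσA] fixed time, general matrix weight; [Kσ] becomes glue -/

/-- [KσA] (statement kept for the record; in v19 NO LONGER A REGISTERED STUB — it is DERIVED from the sibling crux `EvenStressEnskog`
(13079) BY NAME, the two-scale stub [TS] and landed glue, `stub_stressLawFixedA_of_evenStress` below). THE FIXED-TIME MOMENTUM LAW FOR EVEN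
RANK-2 MARKS WITH A GENERAL MATRIX WEIGHT: for all nice profiles there are `σ₀ > 0` and a dilute level `η₁ > 0` such that for `0 < σ < σ₀`,
every flow family, horizon `t > 0` with [V], every admissible kernel family with `DiluteAt … η₁`, and every matrix weight `A` space–time smooth on
`[0, t]`: AT EACH FIXED `τ ∈ [0, t]`, `M_N^A(τ) − (RhsA_N(τ) + KfunA_N(τ)) → 0` in local-Gibbs probability (`StressLawFixedAAt`). -/
def StressLawFixedA : Prop :=
  ∀ (a₀ θ₀ : T3 → ℝ) (u₀ : T3 → V3), NiceProfiles a₀ θ₀ u₀ → ∃ σ₀ : ℝ, 0 < σ₀ ∧ ∃ η₁ : ℝ, 0 < η₁ ∧ ∀ σ : ℝ, 0 < σ → σ < σ₀ → ∀ (Φ : Flows σ) (t : ℝ), 0 < t → VirialBounded σ a₀ θ₀ u₀ Φ t → ∀ (γ C : ℝ) (φ : ℕ → T3 → ℝ), 0 < γ → γ ≤ 1 / 15 → AdmissibleKernel γ C φ → DiluteAt σ a₀ θ₀ u₀ Φ t φ η₁ → ∀ (A : ℝ → T3 → Fin 3 → Fin 3 → ℝ), SmoothMatrixOn (Icc 0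 t) A → StressLawFixedAAt σ a₀ θ₀ u₀ Φ φ t A

/-- [TS] RESEARCH (LEAD-HELD; the ONE-BODY residue of the momentum engine after the dock on 13079): TWO-SCALE REGULARITY OF THE VALUE.
For all nice profiles there are `σ₀ > 0`, `η₁ > 0` such that for `0 < σ < σ₀`, every flow family, `t > 0`, admissible kernel family `φ_N` (mesoscale
`(N+1)^{-γ}`) with `DiluteAt … η₁`, smooth matrix weight `A` on `[0, t]` and `τ ∈ [0, t]`: for every `η, δ > 0` there is `r₀ > 0` such that for
`0 < r < r₀` and all large `N`, with probability `≥ 1 − δ`,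
  `|(RhsA + KfunA)[b_r](τ) − (RhsA + KfunA)[φ_N](τ)| ≤ η`,
where `[b_r]` means the SAME value functional `∫₀^τ∫ [tr A · p_c(ρ̄, θ̄) + (2/5)(Z(ρ̄σ³) − 1) D̄:A]` evaluated on the block fields of the FIXED
macroscopic cone kernel `b_r = coneKernel r · 0` (the `r`-mollified fields `ρ_r, m_r, θ_r, D_r` of `EvenStressEnskog`) instead of the mesoscale kernel
`φ_N`. A statement about ONE-BODY empirical fields only (no collision statistics): the block fields do not oscillate at scales between
`(N+1)^{-γ}` and `r` inside the nonlinear value (`N → ∞` before `r → 0`). At constant profiles it is the constant-profile mesoscopic LLN (c8's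
`constLLN_of` for `φ_N`; the fixed-kernel LLN for `b_r`). Out of equilibrium it is hydrodynamic-regularity content at time `s` — pre-shock it is what
`GermanoSplitLES.KineticRangeControl` (9201)-type items express; `∀ t` it is as exposed as [S']. Why it might fail: persistent mesoscale density
oscillations (spinodal-like patterns) along the flow would make `⟨p_c(ρ̄_N)⟩_r ≠ p_c(⟨ρ̄_N⟩_r)`. -/
theorem stub_twoScaleValueA : ∀ (a₀ θ₀ : T3 → ℝ) (u₀ : T3 → V3), NiceProfiles a₀ θ₀ u₀ → ∃ σ₀ : ℝ, 0 < σ₀ ∧ ∃ η₁ : ℝ, 0 < η₁ ∧ ∀ σ : ℝ, 0 < σ → σ < σ₀ → ∀ (Φ : Flows σ) (t : ℝ), 0 < t → ∀ (γ C : ℝ) (φ : ℕ → T3 → ℝ), 0 < γ → γ ≤ 1 / 15 → AdmissibleKernel γ C φ → DiluteAt σ a₀ θ₀ u₀ Φ t φ η₁ → ∀ (A : ℝ → T3 → Fin 3 → Fin 3 → ℝ), SmoothMatrixOn (Icc 0 t) A → ∀ τ ∈ Icc 0 t, ∀ η δ : ℝ, 0 < η → 0 < δ → ∃ r₀ : ℝ,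 0 < r₀ ∧ ∀ r : ℝ, 0 < r → r < r₀ → ∃ N₀ : ℕ, ∀ N : ℕ, N₀ ≤ N → Literature.MathematicalPhysics.KineticTheory.localGibbsLaw σ a₀ u₀ θ₀ N (Φ N) {z | η < |(RhsA σ Φ (fun (_ : ℕ) (y : T3) => Literature.MathematicalPhysics.KineticTheory.coneKernel r y 0) A N z τ + KfunA σ Φ (fun (_ : ℕ) (y : T3) => Literature.MathematicalPhysics.KineticTheory.coneKernel r y 0) A N z τ) - (RhsA σ Φ φ A N z τ + KfunA σ Φ φ A N z τ)|} ≤ ENNReal.ofReal δ := by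
  sorry

/-- [DockA] PROVABLE (assembly, cycle 3 of seat c10): THE MOMENTUM ENGINE FROM THE SIBLING CRUX. `EvenStressEnskog` (13079, by name) ∧ [TS] ⟹ [KσA].
Given the cutoff radius `η₀` of 13079, answer `η₁ := min η₁^{TS} (η₀/8)`, `σ₀ := min σ₀^{13079} σ₀^{TS} (1/2) …`; at `(σ, Φ, t, kernel, A, τ, δ)`:
`τ = 0` is trivial (`MfunA … 0 = 0 = RhsA … 0 = KfunA … 0`); for `τ > 0`, with the window cutoff `g_{η₀}(a) = max 0 (min 1 (2 − 2a/η₀))`, the clamped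
continuous weights `χ_ab(s, x) = A(projIcc 0 t s, x)_ab` and a continuous band function `Yt = contactValue` on `(0, η_A)` (`hsEosLowDensity_proof`):
on the good set ∩ the dilute event, [CeilR] `stub_mollDensity_le_of_blockCeiling` makes the cutoff inert (`2σ³ρ_r ≤ η₀` for `r ≥ (N+1)^{-γ}`, `N` large),
[DψA'] `stub_markSumA_eq_evenCollisionSums_of_inert` writes `M_N^A(τ) = ½Σ_ab K_ab(τ)` (no collision at the instant `0` off the null contact sets,
`localGibbsLaw_contactSet`), nine instances of 13079 replace `K_ab(τ)` by `σ³∫₀^τ e_ab`, the landed `ParityBandClosurePressureValue.sum_enskog_integral_eq`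
+ [ConeVal] `stub_coneValue_eq` identify `½Σ_ab σ³∫₀^τ e_ab` with `(RhsA + KfunA)[b_r](τ)` (cutoff `= 1`), and [TS] passes to `[φ_N]`; thresholds
`η/3`, union bound, `r < min r₀`, `N ≥ max N₀`. -/
theorem stub_stressLawFixedA_of_evenStressEnskog : Summit.AtomisticToContinuum.HydrodynamicLimit.Theses.JParityClosure.EvenStressEnskog → (∀ (a₀ θ₀ : T3 → ℝ) (u₀ : T3 → V3), NiceProfiles a₀ θ₀ u₀ → ∃ σ₀ : ℝ, 0 < σ₀ ∧ ∃ η₁ : ℝ, 0 < η₁ ∧ ∀ σ : ℝ, 0 < σ → σ < σ₀ → ∀ (Φ : Flows σ) (t : ℝ), 0 < t → ∀ (γ C : ℝ) (φ : ℕ → T3 → ℝ), 0 < γ → γ ≤ 1 / 15 → AdmissibleKernel γ C φ → DiluteAt σ a₀ θ₀ u₀ Φ t φ η₁ → ∀ (A : ℝ → T3 → Fin 3 → Fin 3 → ℝ), SmoothMatrixOn (Icc 0 t) A → ∀ τ ∈ Icc 0 t, ∀ η δ : ℝ, 0 < η → 0 < δ → ∃ r₀ : ℝ, 0 < r₀ ∧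 ∀ r : ℝ, 0 < r → r < r₀ → ∃ N₀ : ℕ, ∀ N : ℕ, N₀ ≤ N → Literature.MathematicalPhysics.KineticTheory.localGibbsLaw σ a₀ u₀ θ₀ N (Φ N) {z | η < |(RhsA σ Φ (fun (_ : ℕ) (y : T3) => Literature.MathematicalPhysics.KineticTheory.coneKernel r y 0) A N z τ + KfunA σ Φ (fun (_ : ℕ) (y : T3) => Literature.MathematicalPhysics.KineticTheory.coneKernel r y 0) A N z τ) - (RhsA σ Φ φ A N z τ + KfunA σ Φ φ A N z τ)|} ≤ ENNReal.ofReal δ) → ∀ (a₀ θ₀ : T3 → ℝ) (u₀ : T3 → V3), NiceProfiles a₀ θ₀ u₀ → ∃ σ₀ : ℝ, 0 < σ₀ ∧ ∃ η₁ : ℝ, 0 < η₁ ∧ ∀ σ : ℝ, 0 < σ → σ < σ₀ → ∀ (Φ : Flows σ) (t : ℝ), 0 < t → VirialBounded σ a₀ θ₀ u₀ Φ t → ∀ (γ C : ℝ) (φ : ℕ → T3 → ℝ), 0 < γ → γ ≤ 1 / 15 → AdmissibleKernel γ C φ → DiluteAt σ a₀ θ₀ u₀ Φ t φ η₁ → ∀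 (A : ℝ → T3 → Fin 3 → Fin 3 → ℝ), SmoothMatrixOn (Icc 0 t) A → StressLawFixedAAt σ a₀ θ₀ u₀ Φ φ t A :=
  Summit.AtomisticToContinuum.HydrodynamicLimit.Theorems.HemisphereAffineSlaving.stub_stressLawFixedA_of_evenStressEnskog  -- LANDED p145343

/-- [CeilR] PROVABLE (deterministic geometry, wave 2): A MESOSCALE BLOCK CEILING IS AN `r`-CEILING. There is a universal `c ≥ 0` (`c = 32` works)
such that for an admissible kernel family (`φ_N ≥ 0`, `∫φ_N = 1`, `supp φ_N ⊆ B((N+1)^{-γ})`), `0 < r < 1/4` with `(N+1)^{-γ} ≤ r`, and a configuration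
`w` all of whose `φ_N`-block densities are `≤ M`: every `r`-mollified density is `≤ M(1 + c (N+1)^{-γ}/r)`. Proof: `b_r(·, x)` is `3/(πr⁴)`-Lipschitz
(`euclidDist_triangle`), so `b_r(x_i, x) ≤ ∫ φ_N(x_i − y) b_r(y, x) dy + (3/(πr⁴))(N+1)^{-γ} 𝟙{d(x_i, x) < r}`; summing over `i`,
`ρ_r(x) ≤ ∫ ρ̄(y) b_r(y, x) dy + (3ℓ/(πr⁴)) μ_N(B(x, r)) ≤ M ∫ b_r + (3ℓ/(πr⁴)) M |B(x, r + ℓ)| ≤ M (1 + 32 ℓ/r)` (`∫ b_r = 1` for `r < 1/2`,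
`μ_N(B(x, r)) ≤ ∫_{B(x,r+ℓ)} ρ̄` since `φ_N * 𝟙_{B(r+ℓ)} ≥ 𝟙_{B(r)}`, torus ball volume `≤ (4π/3)(2r)³`). -/
theorem stub_mollDensity_le_of_blockCeiling : ∃ c : ℝ, 0 ≤ c ∧ ∀ (γ C : ℝ) (φ : ℕ → T3 → ℝ), 0 < γ → AdmissibleKernel γ C φ → ∀ (r : ℝ), 0 < r → r < 1 / 4 → ∀ (N : ℕ), ((N : ℝ) + 1) ^ (-γ) ≤ r → ∀ (M : ℝ), 0 ≤ M → ∀ (w : Cfg N), (∀ x : T3, rhoB φ N w x ≤ M) → ∀ x : T3, Literature.MathematicalPhysics.KineticTheory.mollDensity r w x ≤ M * (1 + c * ((N : ℝ) + 1) ^ (-γ) / r) :=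
  Summit.AtomisticToContinuum.HydrodynamicLimit.Theorems.HemisphereAffineSlaving.stub_mollDensity_le_of_blockCeiling  -- LANDED p143878

/-- [DψA'] PROVABLE (deterministic, wave 2): the landed [DψA] `stub_markSumA_eq_evenCollisionSums` (p142441, …MarkSumA) with its ceiling hypothesis
`ρ_r ≤ 2 ∧ 4σ³ ≤ η_c` replaced by what its proof uses, the INERTNESS of the cutoff `2σ³ρ_r ≤ η_c` along the orbit (so that it applies at the
dilute level `η₁/σ³ ≫ 2` of the non-equilibrium dock). Same proof. -/
theorem stub_markSumA_eq_evenCollisionSums_of_inert : ∀ (σ : ℝ), 0 < σ → σ ≤ 1 / 2 → ∀ (ηc r : ℝ), 0 < ηc → 0 < r → ∀ (Φ : Flows σ) (N : ℕ) (z : Cfg N), z ∈ (Φ N).good → ∀ t : ℝ, (∀ s ∈ Icc 0 t, ∀ x : T3, 2 * (σ ^ 3 * Literature.MathematicalPhysics.KineticTheory.mollDensity r ((Φ N).flow s z) x) ≤ ηc) → ∀ (A : ℝ → T3 → Fin 3 → Fin 3 → ℝ) (τ τ' : ℝ), 0 ≤ τ → τ ≤ τ' → τ' ≤ t → MfunA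 σ Φ A N z τ' - MfunA σ Φ A N z τ = 1 / 2 * ∑ a : Fin 3, ∑ b : Fin 3, (Literature.MathematicalPhysics.KineticTheory.collisionSum σ N (Φ N) τ' (fun p : ℝ × T3 => A p.1 p.2 a b) (fun a : ℝ => max 0 (min 1 (2 - 2 * a / ηc))) (Literature.MathematicalPhysics.KineticTheory.evenMark a b) r z - Literature.MathematicalPhysics.KineticTheory.collisionSum σ N (Φ N) τ (fun p : ℝ × T3 => A p.1 p.2 a b) (fun a : ℝ => max 0 (min 1 (2 - 2 * a / ηc))) (Literature.MathematicalPhysics.KineticTheory.evenMark a b) r z) :=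
  Summit.AtomisticToContinuum.HydrodynamicLimit.Theorems.HemisphereAffineSlaving.stub_markSumA_eq_evenCollisionSums_of_inert  -- LANDED p143643

/-- [ConeVal] PROVABLE (deterministic algebra, wave 2): THE MACROSCALE ENSKOG VALUE IS THE LINE'S VALUE ON CONE-KERNEL BLOCK FIELDS. For the data of
`ParityBandClosurePressureValue.sum_enskog_integral_eq` (band function `Yt = contactValue` on `(0, η₁)`, cutoff `g = 0` on `[η₀', ∞)`, `0 < η₀' ≤ η₁`,
`0 < σ`, `0 < r < 1/2`) and the weights `a_kl(s, x) := A(s, x)_kl`, ONE HALF of its right-hand integrand —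
`g(σ³ρ_r)(p_hs(ρ_r, θ_r) − ρ_rθ_r) tr A + (4π/15)(σ³ρ_r)⁺ g Ỹ Σ_jk A⁰_jk (S_jk − m_j m_k/ρ_r)` — equals `g(σ³ρ̄)·[trW A · p_c(ρ̄, θ̄) + kinWA A · p_c(ρ̄, θ̄)]`
for the block fields of the cone kernel `fun _ y => coneKernel r y 0`: `ρ_r = ρ̄` (`euclidDist (y − x) 0 = euclidDist y x`, `sub_zero`), `m_r = m̄`,
`θ_r = θ̄` (same `let`-bodies), `S_jk − m_jm_k/ρ_r = D̄_jk + ρ̄θ̄ δ_jk` with `A⁰` traceless and `D̄` traceless, `(4π/15) a Y(a) = (2/5)(Z(a) − 1)`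
(`hsCompressibility a = 1 + a·f_ex′(a)`, `contactValue a = (3/2π) f_ex′(a)`), `Yt = Y` where `g ≠ 0` and `ρ̄ > 0`, and the guard `ρ̄θ̄ = 0 ⇒ D̄ = 0`
(Cauchy–Schwarz; pattern of `eulerW_mul_pcoll_add_kinW_mul_pcoll`, …ContactVirialGuard / …VirialGuard). -/
theorem stub_coneValue_eq : ∀ (σ r η₀' η₁ : ℝ) (Yt g : ℝ → ℝ), (∀ b ∈ Set.Ioo 0 η₁, Yt b = Literature.MathematicalPhysics.KineticTheory.contactValue b) → (∀ b, η₀' ≤ b → g b = 0) → η₀' ≤ η₁ → 0 < η₀' → 0 < σ → 0 < r → r < 1 / 2 → ∀ (A : ℝ → T3 → Fin 3 → Fin 3 → ℝ) (s : ℝ) (N : ℕ) (w : Cfg N) (x : T3), g (σ ^ 3 * Literature.MathematicalPhysics.KineticTheory.mollDensity r w x) * (Literature.MathematicalPhysics.KineticTheory.hsPressure σ (Literature.MathematicalPhysics.KineticTheory.mollDensity r w x) (Literature.MathematicalPhysics.KineticTheory.mollTemperature r w x) - Literature.MathematicalPhysics.KineticTheory.mollDensity r w x * Literature.MathematicalPhysics.KineticTheory.mollTemperature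 r w x) * (∑ k : Fin 3, A s x k k) + 4 * Real.pi / 15 * (max (σ ^ 3 * Literature.MathematicalPhysics.KineticTheory.mollDensity r w x) 0 * g (σ ^ 3 * Literature.MathematicalPhysics.KineticTheory.mollDensity r w x) * Yt (σ ^ 3 * Literature.MathematicalPhysics.KineticTheory.mollDensity r w x) * ∑ j : Fin 3, ∑ k : Fin 3, (A s x j k - if j = k then (∑ i : Fin 3, A s x i i) / 3 else 0) * ((∫ q, Literature.MathematicalPhysics.KineticTheory.coneKernel r q.1 x * (q.2 j * q.2 k) ∂(Literature.Analysis.FluidPDE.empiricalMeasure w)) - Literature.MathematicalPhysics.KineticTheory.mollMomentum r w x j * Literature.MathematicalPhysics.KineticTheory.mollMomentum r w x k / Literature.MathematicalPhysics.KineticTheory.mollDensity r w x)) = g (σ ^ 3 * rhoB (fun (_ : ℕ) (y : T3) => Literature.MathematicalPhysics.KineticTheory.coneKernel r y 0) N w x) * (trW A s x * pcoll σ (rhoB (fun (_ : ℕ) (y : T3) => Literature.MathematicalPhysics.KineticTheory.coneKernel r y 0) N w x) (thetaB (fun (_ : ℕ) (y : T3) => Literature.MathematicalPhysics.KineticTheory.coneKernel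 r y 0) N w x) + kinWA A (fun (_ : ℕ) (y : T3) => Literature.MathematicalPhysics.KineticTheory.coneKernel r y 0) N s w x * pcoll σ (rhoB (fun (_ : ℕ) (y : T3) => Literature.MathematicalPhysics.KineticTheory.coneKernel r y 0) N w x) (thetaB (fun (_ : ℕ) (y : T3) => Literature.MathematicalPhysics.KineticTheory.coneKernel r y 0) N w x)) :=
  Summit.AtomisticToContinuum.HydrodynamicLimit.Theorems.HemisphereAffineSlaving.stub_coneValue_eq  -- LANDED p144303

/-- [EnvA] PROVABLE (deterministic, wave 1 of seat c10): THE LIPSCHITZ ENVELOPE OF THE VALUE. For `σ > 0`, `K ≥ 0`, a dilute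
level `0 < η₁ ≤ η_Z` with `|Z(η) − 1| ≤ Kη` on `[0, η_Z]`, a component bound `C_A ≥ 0` and an energy level `E₀ ≥ 0` there is
`L ≥ 0` (`L = 12 C_A K η₁ E₀` works) such that for every admissible kernel family, flow family, `N`, GOOD initial datum `z` with
`(N+1)⁻¹ E_kin(z) ≤ E₀`, horizon `t > 0`, matrix weight `A` smooth on `[0, t]` with `|A_ab| ≤ C_A` on `[0, t] × 𝕋³`, along an
orbit with no block denser than `η₁/σ³` on `[0, t]`: for `0 ≤ τ ≤ τ' ≤ t`,
`|RhsA(τ') − RhsA(τ)| + |KfunA(τ') − KfunA(τ)| ≤ L (τ' − τ)`. Pointwise: `p_c = ρ̄θ̄ (Z(ρ̄σ³) − 1)` (`RhsEnvelope.pcoll_eq_pkin_mul`),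
`0 ≤ ρ̄θ̄ ≤ (2/3)Ē` (`RhsEnvelope.pkin_nonneg_le`), `|Z − 1| ≤ Kρ̄σ³ ≤ Kη₁`, `|tr A| ≤ 3C_A`, `|D̄_ab| ≤ (8/3)Ē`
(`∫φ|v − ū|² ≤ 2Ē`), `kinWA · p_c = (2/5)(D̄:A)(Z − 1)` (guard: `…WeightedKineticRelaxationDilute.abs_kinW_mul_pcoll_le` pattern);
`∫ₓ Ē = (N+1)⁻¹E_kin` (`integral_EB`), energy conservation along the orbit (`configEnergy_orbit`); integrability of the slices in
`x` and in `s` as in `ChannelAdditivity.integrable_eulerSlice` / `abs_Kfun_dilute_le` (`measurable_orbit`, continuity of `A` on the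
strip via `SmoothMatrixOn`, clamping `projIcc`). -/
theorem stub_envelopeA : ∀ (σ K ηZ η₁ CA E₀ : ℝ), 0 < σ → 0 ≤ K → 0 < η₁ → η₁ ≤ ηZ → 0 ≤ CA → 0 ≤ E₀ → (∀ η : ℝ, 0 ≤ η → η ≤ ηZ → |Literature.MathematicalPhysics.KineticTheory.hsCompressibility η - 1| ≤ K * η) → ∃ L : ℝ, 0 ≤ L ∧ ∀ (γ C : ℝ) (φ : ℕ → T3 → ℝ), AdmissibleKernel γ C φ → ∀ (Φ : Flows σ) (N : ℕ) (z : Cfg N), z ∈ (Φ N).good → ((N : ℝ) + 1)⁻¹ * Literature.Analysis.FluidPDE.configEnergy z ≤ E₀ → ∀ (t : ℝ) (A : ℝ → T3 → Fin 3 → Fin 3 → ℝ), 0 < t → SmoothMatrixOn (Icc 0 t) A → (∀ s ∈ Icc 0 t, ∀ (x : T3) (a b : Fin 3), |A s x a b| ≤ CA) → (∀ s ∈ Icc 0 t, ∀ x : T3, rhoB φ N ((Φ N).flow s z) x * σ ^ 3 ≤ η₁) → ∀ τ τ' : ℝ, 0 ≤ τ → τ ≤ τ' → τ' ≤ t → |RhsA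 σ Φ φ A N z τ' - RhsA σ Φ φ A N z τ| + |KfunA σ Φ φ A N z τ' - KfunA σ Φ φ A N z τ| ≤ L * (τ' - τ) :=
  Summit.AtomisticToContinuum.HydrodynamicLimit.Theorems.HemisphereAffineSlaving.stub_envelopeA

/-- [DomA] PROVABLE (deterministic, wave 1 of seat c10): MARK DOMINATION BY THE ISOTROPIC INSTANCE. On a good orbit
(`0 < σ ≤ 1/2`), for a matrix weight with `|A_ab| ≤ C_A` on `[0, t] × 𝕋³` and `0 ≤ τ ≤ τ' ≤ t`: the isotropic mark sum
`M_N^𝟙 = MfunA σ Φ isoW` is monotone (`markA_isoW_nonneg`: its kernel is `(ε/2)‖Δv_i‖‖ω‖² ≥ 0`; `collisionPairSum_Ioc_split`,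
pattern of `virialW_mono`) and dominates the increments of `M_N^A`:
`|M_N^A(τ') − M_N^A(τ)| ≤ 9 C_A (M_N^𝟙(τ') − M_N^𝟙(τ))` (per ordered pair `|Σ_ab ω_aω_b A_ab| ≤ C_A (Σ_a|ω_a|)² ≤ 3 C_A ‖ω‖²`;
pattern of `abs_Jfun_sub_Jfun_le`, file …JumpIncrements). -/
theorem stub_markDominationA : ∀ (σ : ℝ), 0 < σ → σ ≤ 1 / 2 → ∀ (Φ : Flows σ) (N : ℕ) (z : Cfg N), z ∈ (Φ N).good → ∀ (t CA : ℝ) (A : ℝ → T3 → Fin 3 → Fin 3 → ℝ), 0 ≤ CA → (∀ s ∈ Icc 0 t, ∀ (x : T3) (a b : Fin 3), |A s x a b| ≤ CA) → ∀ τ τ' : ℝ, 0 ≤ τ → τ ≤ τ' → τ' ≤ t → MfunA σ Φ isoW N z τ ≤ MfunA σ Φ isoW N z τ' ∧ |MfunA σ Φ A N z τ' - MfunA σ Φ A N z τ| ≤ 9 * CA * (MfunA σ Φ isoW N z τ' - MfunA σ Φ isoW N z τ) :=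
  Summit.AtomisticToContinuum.HydrodynamicLimit.Theorems.HemisphereAffineSlaving.stub_markDominationA  -- LANDED p142443

/-- [SupA] PROVABLE (assembly, wave 1 of seat c10): THE SUP-τ MOMENTUM LAW [Kσ] FROM THE FIXED-TIME LAW. [KσA] ∧ [EnvA] ∧ [DomA] ⟹
`CollisionalStressLaw` (…DefsD; verbatim the registered [Kσ] `stub_collisionalStressLaw`). Given nice profiles take `σ₀, η₁` from
[KσA], `η_Z, K` from the landed [Z] `stub_hsCompressibility_linear` (…CompressibilityLinear), the energy cap `E₀` from the landed [E]
`stub_energyAllTimes` (…EnergyAllTimes); answer `σ₀' := min σ₀ (1/2)`, `η₁' := min η₁ η_Z`. At `(σ, Φ, t, [V], kernel, DiluteAt η₁', ψ)`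
and `δ > 0`: `Mfun σ Φ ψ 0 = MfunA σ Φ (∇ψ)`, `Kfun … ψ 0 = KfunA … (∇ψ)`, `Rhs … ψ 0 … τ = RhsA … (∇ψ) … τ` for `τ ≤ t`
(…DefsE: `Mfun_zero_eq_MfunA`, `Kfun_zero_eq_KfunA`, `Rhs_zero_eq_RhsA`); a gradient bound `C_ψ` on `[0, t]` (`exists_grad_bound` with
`χ := 0`); [KσA] at `A := gradPsi ψ` (`smoothMatrixOn_gradPsi`) and at `A := isoW` (`smoothMatrixOn_isoW`) on the grid `kt/n`,
`k ≤ n` (finitely many fixed-time events); on the good set ∩ {energy ≤ E₀ on [0,t]} ∩ {dilute on [0,t]}: [EnvA] (with `C_A := C_ψ`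
and with `C_A := 1`) gives the moduli `L_ψ t/n`, `L_𝟙 t/n`, the isotropic fixed-time events give window increments
`ΔM^𝟙_k ≤ L_𝟙 t/n + 2δ'`, [DomA] gives `|ΔM^ψ| ≤ 9C_ψ ΔM^𝟙` and monotonicity, and `exists_grid_index_of_dominated_increments`
(…GridReduction) bounds `sup_τ |M^ψ − (RhsA + KfunA)| ≤ δ' + 9C_ψ(L_𝟙 t/n + 2δ') + L_ψ t/n`; choose `n` then `δ'`; union bound over
the good-set complement (null, `measure_good_compl`-type), the energy and dilute events (→ 0) and the `2(n+1)` fixed-time events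
(pattern of `stub_equilibriumSup`, file …EquilibriumSup). -/
theorem stub_collisionalStressLaw_of_fixedA : (∀ (a₀ θ₀ : T3 → ℝ) (u₀ : T3 → V3), NiceProfiles a₀ θ₀ u₀ → ∃ σ₀ : ℝ, 0 < σ₀ ∧ ∃ η₁ : ℝ, 0 < η₁ ∧ ∀ σ : ℝ, 0 < σ → σ < σ₀ → ∀ (Φ : Flows σ) (t : ℝ), 0 < t → VirialBounded σ a₀ θ₀ u₀ Φ t → ∀ (γ C : ℝ) (φ : ℕ → T3 → ℝ), 0 < γ → γ ≤ 1 / 15 → AdmissibleKernel γ C φ → DiluteAt σ a₀ θ₀ u₀ Φ t φ η₁ → ∀ (A : ℝ → T3 → Fin 3 → Fin 3 → ℝ), SmoothMatrixOn (Icc 0 t) A → StressLawFixedAAt σ a₀ θ₀ u₀ Φ φ t A) → (∀ (σ K ηZ η₁ CA E₀ : ℝ), 0 < σ → 0 ≤ K → 0 < η₁ → η₁ ≤ ηZ → 0 ≤ CA → 0 ≤ E₀ → (∀ η : ℝ, 0 ≤ η → η ≤ ηZ → |Literature.MathematicalPhysics.KineticTheory.hsCompressibility η - 1| ≤ K * η)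 → ∃ L : ℝ, 0 ≤ L ∧ ∀ (γ C : ℝ) (φ : ℕ → T3 → ℝ), AdmissibleKernel γ C φ → ∀ (Φ : Flows σ) (N : ℕ) (z : Cfg N), z ∈ (Φ N).good → ((N : ℝ) + 1)⁻¹ * Literature.Analysis.FluidPDE.configEnergy z ≤ E₀ → ∀ (t : ℝ) (A : ℝ → T3 → Fin 3 → Fin 3 → ℝ), 0 < t → SmoothMatrixOn (Icc 0 t) A → (∀ s ∈ Icc 0 t, ∀ (x : T3) (a b : Fin 3), |A s x a b| ≤ CA) → (∀ s ∈ Icc 0 t, ∀ x : T3, rhoB φ N ((Φ N).flow s z) x * σ ^ 3 ≤ η₁) → ∀ τ τ' : ℝ, 0 ≤ τ → τ ≤ τ' → τ' ≤ t → |RhsA σ Φ φ A N z τ' - RhsA σ Φ φ A N z τ| + |KfunA σ Φ φ A N z τ' - KfunA σ Φ φ A N z τ| ≤ L * (τ' - τ)) → (∀ (σ : ℝ), 0 < σ → σ ≤ 1 / 2 → ∀ (Φ : Flows σ) (N : ℕ) (z : Cfg N), z ∈ (Φ N).good → ∀ (t CA : ℝ) (A : ℝ → T3 → Fin 3 → Fin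 3 → ℝ), 0 ≤ CA → (∀ s ∈ Icc 0 t, ∀ (x : T3) (a b : Fin 3), |A s x a b| ≤ CA) → ∀ τ τ' : ℝ, 0 ≤ τ → τ ≤ τ' → τ' ≤ t → MfunA σ Φ isoW N z τ ≤ MfunA σ Φ isoW N z τ' ∧ |MfunA σ Φ A N z τ' - MfunA σ Φ A N z τ| ≤ 9 * CA * (MfunA σ Φ isoW N z τ' - MfunA σ Φ isoW N z τ)) → CollisionalStressLaw :=
  Summit.AtomisticToContinuum.HydrodynamicLimit.Theorems.HemisphereAffineSlaving.stub_collisionalStressLaw_of_fixedA  -- LANDED p142817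

/-- [DψA] PROVABLE HELPER (deterministic, wave 1 of seat c10; registered helper stub, not consumed by composition 1): THE MARK SUM
WITH WEIGHT `A` IS ONE HALF OF THE EVEN COLLISION SUMS OF `EvenStressEnskog` — the `A`-weighted twin of the landed [Dψ]
`stub_momentumMarkSum_eq_evenCollisionSums` (p138751, file …MomentumMarkSum: the case `A = ∇ψ`). On ONE good orbit, with the window
cutoff `g(a) = max 0 (min 1 (2 − 2a/η_c))` (`= 1` on `[0, η_c/2]`), under the mollified ceiling `ρ_r ≤ 2` on `[0, t]` and `4σ³ ≤ η_c`,
for `0 ≤ τ ≤ τ' ≤ t`: `M_N^A(τ') − M_N^A(τ) = ½ Σ_ab (K_ab(τ') − K_ab(τ))`, `K_ab(τ) = collisionSum σ N (Φ N) τ (A··ab) g Ξ^{ab} r z`.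
Same proof as [Dψ] with `gradPsi ψ` replaced by `A` (no `∇0 = 0` step): per ordered outgoing contact pair
`Ξ^{ab}(n̂, v_i⁻, v_j⁻) = ‖Δv_i‖ ω_a ω_b`, `g = 1` by the ceiling, finite sums commute. It is the pathwise half of the dock of [KσA]
on 13079 and of the equilibrium rung of [KσA] on `evenStressEnskog_rung0`. -/
theorem stub_markSumA_eq_evenCollisionSums : ∀ (σ : ℝ), 0 < σ → σ ≤ 1 / 2 → ∀ (ηc r : ℝ), 0 < ηc → 0 < r → ∀ (Φ : Flows σ) (N : ℕ) (z : Cfg N), z ∈ (Φ N).good → ∀ t : ℝ, (∀ s ∈ Icc 0 t, ∀ x : T3, Literature.MathematicalPhysics.KineticTheory.mollDensity r ((Φ N).flow s z) x ≤ 2) → 4 * σ ^ 3 ≤ ηc → ∀ (A : ℝ → T3 → Fin 3 → Fin 3 → ℝ) (τ τ' : ℝ), 0 ≤ τ → τ ≤ τ' → τ' ≤ t → MfunA σ Φ A N z τ' - MfunA σ Φ A N z τ = 1 / 2 * ∑ a : Fin 3, ∑ b : Fin 3, (Literature.MathematicalPhysics.KineticTheory.collisionSum σ N (Φ N) τ'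 (fun p : ℝ × T3 => A p.1 p.2 a b) (fun a : ℝ => max 0 (min 1 (2 - 2 * a / ηc))) (Literature.MathematicalPhysics.KineticTheory.evenMark a b) r z - Literature.MathematicalPhysics.KineticTheory.collisionSum σ N (Φ N) τ (fun p : ℝ × T3 => A p.1 p.2 a b) (fun a : ℝ => max 0 (min 1 (2 - 2 * a / ηc))) (Literature.MathematicalPhysics.KineticTheory.evenMark a b) r z) :=
  Summit.AtomisticToContinuum.HydrodynamicLimit.Theorems.HemisphereAffineSlaving.stub_markSumA_eq_evenCollisionSums  -- LANDED p142441

/-! ### v17 (seat c9): THE TWO ENGINE STUBS IN FILEABLE SHAPE — [Kσ] `stub_collisionalStressLaw`, [Kq] `stub_collisionalEnergyFluxLaw` -/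

/-- STUB [Kσ] `stub_collisionalStressLaw` (THE MESOSCALE COLLISIONAL-STRESS LAW — NEW in v17, the momentum-channel engine statement
in the shape of a fileable route item; lead-held, research-level; implied by v16's [M-ψ]° (`collisionalStressLaw_of_markedVirialMomentum`)
so v17 asks no more than v16). For all nice profiles there are `σ₀ > 0` and a dilute level `η₁ > 0` such that for `0 < σ < σ₀`, every
flow family, every horizon `t > 0` with [V] `VirialBounded` (tightness of the weighted collision virial — item 15144 by name), every
admissible kernel family with the dilute event `DiluteAt … η₁` (w.h.p. no block denser than `η₁/σ³` before `t`) and every space–time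
smooth vector test `ψ` on `[0, t]`: uniformly in `τ ≤ t`, in local-Gibbs probability,
`M_N^ψ(τ) − ∫₀^τ∫ [div ψ + (2/5) D̄:∇ψ/(ρ̄θ̄)] p_c(ρ̄, θ̄) dx ds → 0`,
where `M_N^ψ(τ) = (N+1)⁻¹ Σ_{ordered contacts (i,j), s_c ≤ τ} (ε_N/2) ‖Δv_i‖ Σ_ab ω_a ω_b ∂_bψ_a(s_c, x_i)` (`Mfun σ Φ ψ 0`: the EVEN
RANK-2 MARK `((v_j⁻ − v_i⁻)·ω)₊ ω⊗ω` of the collision, tested against `∇ψ` at the collision point), `p_c = hsPressure σ ρ̄ θ̄ − ρ̄θ̄ =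
ρ̄θ̄(Z(ρ̄σ³) − 1)` at the block's OWN fields (`Rhs σ Φ φ ψ 0`) and `(2/5)(Z − 1) D̄:∇ψ` the kinetic correction (`Kfun σ Φ φ ψ 0`,
removed downstream by the kinetic closure 9522). PHYSICAL CONTENT: the collisional stress of the deterministic hard-sphere gas at fixed
reduced density, line-averaged over mesoscopic blocks, is ISOTROPIC and the LOCAL thermodynamic function `p_c(ρ̄, θ̄)` of the block fields
(the marked Campbell / Boltzmann–Enskog law for the stress marks at mesoscale `(N+1)^{-γ}`; sibling of `JParityClosure.EvenStressEnskog`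
13079, which is the same law at a FIXED macroscopic radius `r` — neither implies the other without a two-scale regularity statement at
time `s`, which is mesoscale-LLN content of hydrodynamic-limit strength). The statics (contact theorem, `Z`) are INSIDE its proof, not
in its hypotheses. Its equilibrium rung is a theorem of the tree (`evenStressEnskog_rung0` + `equilibriumRungFlow_unconditional`). Why it
might fail: pre-collisional correlations at fixed `σ³ > 0` (Boltzmann–Enskog hypothesis class, `BoltzmannHypothesisBarrierNarrow`);
sub-mesoscopic clustering / rattler cages inflating the contact intensity at fixed block fields. -/
theorem stub_collisionalStressLaw_of_evenStress (h79 : Summit.AtomisticToContinuum.HydrodynamicLimit.Theses.JParityClosure.EvenStressEnskog) : ∀ (a₀ θ₀ : T3 → ℝ) (u₀ : T3 → V3), NiceProfiles a₀ θ₀ u₀ → ∃ σ₀ : ℝ, 0 < σ₀ ∧ ∃ η₁ : ℝ, 0 < η₁ ∧ ∀ σ : ℝ, 0 < σ → σ < σ₀ → ∀ (Φ : Flows σ) (t : ℝ), 0 < t → VirialBounded σ a₀ θ₀ u₀ Φ t → ∀ (γ C : ℝ) (φ : ℕ → T3 → ℝ), 0 < γ → γ ≤ 1 / 15 → AdmissibleKernel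 γ C φ → DiluteAt σ a₀ θ₀ u₀ Φ t φ η₁ → ∀ (ψ : ℝ → T3 → V3), Literature.Analysis.FunctionSpaces.Torus.IsSmoothSpaceTimeOn (Icc 0 t) ψ → ∀ δ : ℝ, 0 < δ → Tendsto (fun N : ℕ => Literature.MathematicalPhysics.KineticTheory.localGibbsLaw σ a₀ u₀ θ₀ N (Φ N) {z | ∃ τ ∈ Icc 0 t, δ < |Mfun σ Φ ψ (fun (_ : ℝ) (_ : T3) => (0 : ℝ)) N z τ - (Rhs σ Φ φ ψ (fun (_ : ℝ) (_ : T3) => (0 : ℝ)) N z τ + Kfun σ Φ φ ψ (fun (_ : ℝ) (_ : T3) => (0 : ℝ)) N z τ)|}) atTop (𝓝 0) :=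
  -- v19: [Kσ] ⟸ [SupA] ([DockA] 13079 [TS]) [EnvA] [DomA] (`CollisionalStressLaw` of …DefsD unfolds to this signature verbatim)
  stub_collisionalStressLaw_of_fixedA (stub_stressLawFixedA_of_evenStressEnskog h79 stub_twoScaleValueA) stub_envelopeA stub_markDominationA

/-! ### v20 (seat c11, 2026-08-17): THE ENERGY CHANNEL AT MACROSCALE — [Kq] ⟸ [KqR] ∧ [TSχ] (research) via the glue [GKq] (provable)
Exactly parallel to the momentum channel of v19 ([Kσ] ⟸ 13079 ∧ [TS] via [DockA] + [SupA]): ALL TWO-BODY content of the crux now sits at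
the FIXED macroscopic cone radius `r` (`N → ∞` before `r → 0`, the scale of the JParityClosure items 13079/17722/13080), namely 13079 BY NAME
(momentum) and [KqR] (energy: the one statement of the Boltzmann–Enskog class no sibling item carries — the marks `((w−v)·n̂)₊ (n̂·V) n̂`
carry the centre-of-mass velocity `V`); ALL ONE-BODY content is two-scale regularity of the value functionals ([TS] momentum, [TSχ] energy),
which RoutePatchC11 argues a closed-loop relative-entropy dock absorbs (the mesoscale↔macroscale commutator of the value is SECOND ORDER in the
hydrodynamic distance). -/

/-- [KqR] RESEARCH (lead-held; fileable as the energy sibling of `JParityClosure.EvenStressEnskog`): THE COLLISIONAL ENERGY-FLUX LAW AT THE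
MACROSCOPIC CONE RADIUS. For all nice profiles there are `σ₀ > 0`, `η₁ > 0` such that for `0 < σ < σ₀`, every flow family, `t > 0` with [V],
every admissible kernel family with the mesoscale dilute event `DiluteAt … η₁` (an a-priori ceiling; by [CeilR] it is an `r`-ceiling), and every
space–time smooth scalar test `χ` on `[0, t]`: for all `η, δ > 0` there is `r₀ > 0` such that for `0 < r < r₀` and all large `N`, with probability
`≥ 1 − δ`, UNIFORMLY IN `τ ≤ t`,
  `|M_N^χ(τ) − (Rhs + Kfun)[b_r](0, χ)(τ)| ≤ η`,
where `M_N^χ(τ) = (N+1)⁻¹ Σ_{ordered contacts ≤ τ} (ε_N/2)‖Δv_i‖ (V·ω)(ω·∇χ(s, x_i))` (`Mfun σ Φ 0 χ`) and `(Rhs + Kfun)[b_r](0, χ)(τ) =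
∫₀^τ∫ [∇χ·ū_r + (2/5)(D_r ū_r)·∇χ/(ρ_rθ_r) + (3/5) q_r·∇χ/(ρ_rθ_r)] p_c(ρ_r, θ_r) dx ds` is the line's energy value functional evaluated on the block
fields of the FIXED cone kernel `b_r = coneKernel r · 0` (the `r`-mollified fields of 13079). PHYSICAL CONTENT: the collisional energy flux is
`p_c ū` plus Enskog's kinetic corrections, and there is NO collisional heat flux at leading order — the `(ε/2)‖Δv‖`-weighted empirical law of the
contact marks `(ω, v, w)`, tested against the cubic, `V`-carrying, J-even mark `((w−v)·ω)₊ (V·ω)(ω·a)`, takes its Enskog value (contact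
intensity `ρ_r Y(σ³ρ_r)`, isotropic normals, centre-of-mass velocity with conditional mean `ū_r` given the collision geometry). Equilibrium rung:
composition 6b below (from [Vχ0C], [Vχ0M] and the crux's equilibrium rung). Why it might fail: as 13079 (pre-collisional correlations at fixed
`σ³ > 0`, Boltzmann–Enskog class; `BoltzmannHypothesisBarrierNarrow`), plus a `V`-odd component of the contact pair correlation in the local rest
frame (a collisional heat flux at Euler order). -/
theorem stub_energyFluxLawCone : ∀ (a₀ θ₀ : T3 → ℝ) (u₀ : T3 → V3), NiceProfiles a₀ θ₀ u₀ → ∃ σ₀ : ℝ, 0 < σ₀ ∧ ∃ η₁ : ℝ, 0 < η₁ ∧ ∀ σ : ℝ, 0 < σ → σ < σ₀ → ∀ (Φ : Flows σ) (t : ℝ), 0 < t → VirialBounded σ a₀ θ₀ u₀ Φ t → ∀ (γ C : ℝ) (φ : ℕ → T3 → ℝ), 0 < γ → γ ≤ 1 / 15 → AdmissibleKernel γ C φ → DiluteAt σ a₀ θ₀ u₀ Φ t φ η₁ → ∀ (χ : ℝ → T3 → ℝ), Literature.Analysis.FunctionSpaces.Torus.IsSmoothSpaceTimeOn (Icc 0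 t) χ → ∀ η δ : ℝ, 0 < η → 0 < δ → ∃ r₀ : ℝ, 0 < r₀ ∧ ∀ r : ℝ, 0 < r → r < r₀ → ∃ N₀ : ℕ, ∀ N : ℕ, N₀ ≤ N → Literature.MathematicalPhysics.KineticTheory.localGibbsLaw σ a₀ u₀ θ₀ N (Φ N) {z | ∃ τ ∈ Icc 0 t, η < |Mfun σ Φ (fun (_ : ℝ) (_ : T3) => (0 : V3)) χ N z τ - (Rhs σ Φ (fun (_ : ℕ) (y : T3) => Literature.MathematicalPhysics.KineticTheory.coneKernel r y 0) (fun (_ : ℝ) (_ : T3) => (0 : V3)) χ N z τ + Kfun σ Φ (fun (_ : ℕ) (y : T3) => Literature.MathematicalPhysics.KineticTheory.coneKernel r y 0) (fun (_ : ℝ) (_ : T3) => (0 : V3)) χ N z τ)|} ≤ ENNReal.ofReal δ := by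
  sorry

/-- [TSχ] RESEARCH (lead-held; the ONE-BODY residue of the energy channel, twin of [TS]): TWO-SCALE REGULARITY OF THE ENERGY VALUE. For all
nice profiles there are `σ₀ > 0`, `η₁ > 0` such that for `0 < σ < σ₀`, every flow family, `t > 0`, admissible kernel family `φ_N` with
`DiluteAt … η₁`, and smooth scalar test `χ` on `[0, t]`: for all `η, δ > 0` there is `r₀ > 0` such that for `0 < r < r₀` and all large `N`, with
probability `≥ 1 − δ`, uniformly in `τ ≤ t`, `|(Rhs + Kfun)[b_r](0, χ)(τ) − (Rhs + Kfun)[φ_N](0, χ)(τ)| ≤ η`. A statement about one-body empirical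
fields only: the block fields do not oscillate at scales between `(N+1)^{-γ}` and `r` inside the nonlinear energy value (`N → ∞` before
`r → 0`). At constant profiles it is composition 6a below. Out of equilibrium it is hydrodynamic-regularity content at time `s`; RoutePatchC11:
in a closed-loop dock it is implied at time `s` by the `L¹`-closeness of the block fields to the (continuous) Euler field on `[0, s]`, with a
commutator error that is second order — so it need not be an item. Why it might fail (as an unconditional statement): persistent mesoscale
oscillations of `(ρ̄, ū)` along the flow. -/
theorem stub_twoScaleValueChi : ∀ (a₀ θ₀ : T3 → ℝ) (u₀ : T3 → V3), NiceProfiles a₀ θ₀ u₀ → ∃ σ₀ : ℝ, 0 < σ₀ ∧ ∃ η₁ : ℝ, 0 < η₁ ∧ ∀ σ : ℝ, 0 < σ → σ < σ₀ → ∀ (Φ : Flows σ) (t : ℝ), 0 < t → ∀ (γ C : ℝ) (φ : ℕ → T3 → ℝ), 0 < γ → γ ≤ 1 / 15 → AdmissibleKernel γ C φ → DiluteAt σ a₀ θ₀ u₀ Φ t φ η₁ → ∀ (χ : ℝ → T3 → ℝ), Literature.Analysis.FunctionSpaces.Torus.IsSmoothSpaceTimeOn (Icc 0 t) χ → ∀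 η δ : ℝ, 0 < η → 0 < δ → ∃ r₀ : ℝ, 0 < r₀ ∧ ∀ r : ℝ, 0 < r → r < r₀ → ∃ N₀ : ℕ, ∀ N : ℕ, N₀ ≤ N → Literature.MathematicalPhysics.KineticTheory.localGibbsLaw σ a₀ u₀ θ₀ N (Φ N) {z | ∃ τ ∈ Icc 0 t, η < |(Rhs σ Φ (fun (_ : ℕ) (y : T3) => Literature.MathematicalPhysics.KineticTheory.coneKernel r y 0) (fun (_ : ℝ) (_ : T3) => (0 : V3)) χ N z τ + Kfun σ Φ (fun (_ : ℕ) (y : T3) => Literature.MathematicalPhysics.KineticTheory.coneKernel r y 0) (fun (_ : ℝ) (_ : T3) => (0 : V3)) χ N z τ) - (Rhs σ Φ φ (fun (_ : ℝ) (_ : T3) => (0 : V3)) χ N z τ + Kfun σ Φ φ (fun (_ : ℝ) (_ : T3) => (0 : V3)) χ N z τ)|} ≤ ENNReal.ofReal δ := by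
  sorry

/-- [GKq] PROVABLE glue (wave 1 of seat c11): [KqR] ∧ [TSχ] ⟹ [Kq] (the registered mesoscale energy law, verbatim). Thresholds
`σ₀ := min σ₀^{KqR} σ₀^{TSχ}`, `η₁ := min η₁^{KqR} η₁^{TSχ}` (`DiluteAt` is monotone in the level, `DiluteAt.mono`); at
`(σ, Φ, t, kernel, χ, δ)`: for every `e > 0` take `r < min r₀^{KqR}(δ/2, e/2) r₀^{TSχ}(δ/2, e/2)`, then for `N ≥ max N₀`,
`{∃ τ, δ < |M − V_N|} ⊆ {∃ τ, δ/2 < |M − V_r|} ∪ {∃ τ, δ/2 < |V_r − V_N|}` (same `τ`), so the probability is `≤ e/2 + e/2`; an `e`–`N₀` bound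
at every level gives `Tendsto … (𝓝 0)` (`ENNReal.tendsto_atTop_zero`). Pure measure plumbing, no analysis. -/
theorem stub_collisionalEnergyFluxLaw_of_cone : (∀ (a₀ θ₀ : T3 → ℝ) (u₀ : T3 → V3), NiceProfiles a₀ θ₀ u₀ → ∃ σ₀ : ℝ, 0 < σ₀ ∧ ∃ η₁ : ℝ, 0 < η₁ ∧ ∀ σ : ℝ, 0 < σ → σ < σ₀ → ∀ (Φ : Flows σ) (t : ℝ), 0 < t → VirialBounded σ a₀ θ₀ u₀ Φ t → ∀ (γ C : ℝ) (φ : ℕ → T3 → ℝ), 0 < γ → γ ≤ 1 / 15 → AdmissibleKernel γ C φ → DiluteAt σ a₀ θ₀ u₀ Φ t φ η₁ → ∀ (χ : ℝ → T3 → ℝ), Literature.Analysis.FunctionSpaces.Torus.IsSmoothSpaceTimeOn (Icc 0 t) χ → ∀ η δ : ℝ, 0 < η → 0 < δ → ∃ r₀ : ℝ, 0 < r₀ ∧ ∀ r : ℝ, 0 < r → r < r₀ → ∃ N₀ : ℕ, ∀ N : ℕ, N₀ ≤ N → Literature.MathematicalPhysics.KineticTheory.localGibbsLaw σ a₀ u₀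 θ₀ N (Φ N) {z | ∃ τ ∈ Icc 0 t, η < |Mfun σ Φ (fun (_ : ℝ) (_ : T3) => (0 : V3)) χ N z τ - (Rhs σ Φ (fun (_ : ℕ) (y : T3) => Literature.MathematicalPhysics.KineticTheory.coneKernel r y 0) (fun (_ : ℝ) (_ : T3) => (0 : V3)) χ N z τ + Kfun σ Φ (fun (_ : ℕ) (y : T3) => Literature.MathematicalPhysics.KineticTheory.coneKernel r y 0) (fun (_ : ℝ) (_ : T3) => (0 : V3)) χ N z τ)|} ≤ ENNReal.ofReal δ) → (∀ (a₀ θ₀ : T3 → ℝ) (u₀ : T3 → V3), NiceProfiles a₀ θ₀ u₀ → ∃ σ₀ : ℝ, 0 < σ₀ ∧ ∃ η₁ : ℝ, 0 < η₁ ∧ ∀ σ : ℝ, 0 < σ → σ < σ₀ → ∀ (Φ : Flows σ) (t : ℝ), 0 < t → ∀ (γ C : ℝ) (φ : ℕ → T3 → ℝ), 0 < γ → γ ≤ 1 / 15 → AdmissibleKernel γ C φ → DiluteAt σ a₀ θ₀ u₀ Φ t φ η₁ → ∀ (χ : ℝ → T3 → ℝ), Literature.Analysis.FunctionSpaces.Torus.IsSmoothSpaceTimeOn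 (Icc 0 t) χ → ∀ η δ : ℝ, 0 < η → 0 < δ → ∃ r₀ : ℝ, 0 < r₀ ∧ ∀ r : ℝ, 0 < r → r < r₀ → ∃ N₀ : ℕ, ∀ N : ℕ, N₀ ≤ N → Literature.MathematicalPhysics.KineticTheory.localGibbsLaw σ a₀ u₀ θ₀ N (Φ N) {z | ∃ τ ∈ Icc 0 t, η < |(Rhs σ Φ (fun (_ : ℕ) (y : T3) => Literature.MathematicalPhysics.KineticTheory.coneKernel r y 0) (fun (_ : ℝ) (_ : T3) => (0 : V3)) χ N z τ + Kfun σ Φ (fun (_ : ℕ) (y : T3) => Literature.MathematicalPhysics.KineticTheory.coneKernel r y 0) (fun (_ : ℝ) (_ : T3) => (0 : V3)) χ N z τ) - (Rhs σ Φ φ (fun (_ : ℝ) (_ : T3) => (0 : V3)) χ N z τ + Kfun σ Φ φ (fun (_ : ℝ) (_ : T3) => (0 : V3)) χ N z τ)|} ≤ ENNReal.ofReal δ) → ∀ (a₀ θ₀ : T3 → ℝ) (u₀ : T3 → V3), NiceProfiles a₀ θ₀ u₀ → ∃ σ₀ : ℝ, 0 < σ₀ ∧ ∃ η₁ : ℝ,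 0 < η₁ ∧ ∀ σ : ℝ, 0 < σ → σ < σ₀ → ∀ (Φ : Flows σ) (t : ℝ), 0 < t → VirialBounded σ a₀ θ₀ u₀ Φ t → ∀ (γ C : ℝ) (φ : ℕ → T3 → ℝ), 0 < γ → γ ≤ 1 / 15 → AdmissibleKernel γ C φ → DiluteAt σ a₀ θ₀ u₀ Φ t φ η₁ → ∀ (χ : ℝ → T3 → ℝ), Literature.Analysis.FunctionSpaces.Torus.IsSmoothSpaceTimeOn (Icc 0 t) χ → ∀ δ : ℝ, 0 < δ → Tendsto (fun N : ℕ => Literature.MathematicalPhysics.KineticTheory.localGibbsLaw σ a₀ u₀ θ₀ N (Φ N) {z | ∃ τ ∈ Icc 0 t, δ < |Mfun σ Φ (fun (_ : ℝ) (_ : T3) => (0 : V3)) χ N z τ - (Rhs σ Φ φ (fun (_ : ℝ) (_ : T3) => (0 : V3)) χ N z τ + Kfun σ Φ φ (fun (_ : ℝ) (_ : T3) => (0 : V3)) χ N z τ)|}) atTop (𝓝 0) :=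
  Summit.AtomisticToContinuum.HydrodynamicLimit.Theorems.HemisphereAffineSlaving.stub_collisionalEnergyFluxLaw_of_cone  -- LANDED p164424

/-- STUB [Kq] `stub_collisionalEnergyFluxLaw` (THE MESOSCALE COLLISIONAL-ENERGY-FLUX LAW; registered v17–v19.4 as a research stub; in v20 it is
DERIVED — no `sorry` of its own — from [KqR] ∧ [TSχ] by the glue [GKq]; statement verbatim, still the `hKq`-shaped input of compositions 1–2 via
`stub_collisionalEnergyFluxLaw : Prop`). Same prefix as [Kσ], then for every space–time smooth SCALAR test `χ` on `[0, t]`: uniformly in `τ ≤ t`,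
in local-Gibbs probability, `M_N^χ(τ) − ∫₀^τ∫ [∇χ·ū + (2/5)(D̄ū)·∇χ/(ρ̄θ̄) + (3/5) q̄·∇χ/(ρ̄θ̄)] p_c(ρ̄, θ̄) dx ds → 0`. -/
theorem stub_collisionalEnergyFluxLaw : ∀ (a₀ θ₀ : T3 → ℝ) (u₀ : T3 → V3), NiceProfiles a₀ θ₀ u₀ → ∃ σ₀ : ℝ, 0 < σ₀ ∧ ∃ η₁ : ℝ, 0 < η₁ ∧ ∀ σ : ℝ, 0 < σ → σ < σ₀ → ∀ (Φ : Flows σ) (t : ℝ), 0 < t → VirialBounded σ a₀ θ₀ u₀ Φ t → ∀ (γ C : ℝ) (φ : ℕ → T3 → ℝ), 0 < γ → γ ≤ 1 / 15 → AdmissibleKernel γ C φ → DiluteAt σ a₀ θ₀ u₀ Φ t φ η₁ → ∀ (χ : ℝ → T3 → ℝ), Literature.Analysis.FunctionSpaces.Torus.IsSmoothSpaceTimeOn (Icc 0 t) χ → ∀ δ : ℝ, 0 < δ → Tendsto (fun N : ℕ => Literature.MathematicalPhysics.KineticTheory.localGibbsLaw σ a₀ u₀ θ₀ N (Φ N) {z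 | ∃ τ ∈ Icc 0 t, δ < |Mfun σ Φ (fun (_ : ℝ) (_ : T3) => (0 : V3)) χ N z τ - (Rhs σ Φ φ (fun (_ : ℝ) (_ : T3) => (0 : V3)) χ N z τ + Kfun σ Φ φ (fun (_ : ℝ) (_ : T3) => (0 : V3)) χ N z τ)|}) atTop (𝓝 0) :=
  stub_collisionalEnergyFluxLaw_of_cone stub_energyFluxLawCone stub_twoScaleValueChi

/-- [Vχ0C] PROVABLE (wave 1 of seat c11; equilibrium rung of the cone side of [TSχ]/[KqR]): under the homogeneous law `(1, 0, θ)`, for small `σ`,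
every flow family, `t > 0`, cone radius `0 < r < 1/4` and smooth scalar test `χ` on `[0, t]`: `sup_{τ ≤ t} |(Rhs + Kfun)[b_r](0, χ)(τ)| → 0` in
probability. Route (mirror of c10's [R0C] `stub_rhsA_cone_const` p147290 / [K0C] `stub_kfunA_cone_const` p146422, whose dominators and
stationarity lemmas `KfunAConeConst.*`, `rhsA_tendsto_of_constLLN` are landed): `sup_τ |∫₀^τ f| ≤ ∫₀ᵗ |f|`; the Rhs integrand is
`(∇χ·ū_r) p_c(ρ_r, θ_r) = (∇χ·m_r) θ_r (Z(σ³ρ_r) − 1)` with `|Z − 1| ≤ Kσ³ρ_r` ([Z]) — small with `m_r → 0` (cone LLN `stub_coneLLNConst`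
p145695, stationarity of the homogeneous law `KfunAConeConst.measure_le_of_stationary`, cone ceiling `stub_mollifiedCeilingConst` p132076, energy cap
[E]); the Kfun integrand `(Z − 1)[(2/5) D_r ū_r·∇χ + (3/5) q_r·∇χ]` is handled by the landed stress/heat dominators (`KfunAConeConst.abs_kin_le`,
`measurable_heatDom`, `tendsto_lintegral_kinetic`). -/
theorem stub_valueChi_cone_const : ∀ θ : ℝ, 0 < θ → ∃ σ₀ : ℝ, 0 < σ₀ ∧ ∀ σ : ℝ, 0 < σ → σ < σ₀ → ∀ (Φ : Flows σ) (t : ℝ), 0 < t → ∀ (r : ℝ), 0 < r → r < 1 / 4 → ∀ (χ : ℝ → T3 → ℝ), Literature.Analysis.FunctionSpaces.Torus.IsSmoothSpaceTimeOn (Icc 0 t) χ → ∀ δ : ℝ, 0 < δ → Tendsto (fun N : ℕ => Literature.MathematicalPhysics.KineticTheory.localGibbsLaw σ (fun _ => 1) (fun _ => 0) (fun _ => θ) N (Φ N) {z | ∃ τ ∈ Icc 0 t, δ < |(Rhs σ Φ (fun (_ : ℕ) (y : T3) => Literature.MathematicalPhysics.KineticTheory.coneKernel r y 0) (fun (_ :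 ℝ) (_ : T3) => (0 : V3)) χ N z τ + Kfun σ Φ (fun (_ : ℕ) (y : T3) => Literature.MathematicalPhysics.KineticTheory.coneKernel r y 0) (fun (_ : ℝ) (_ : T3) => (0 : V3)) χ N z τ)|}) atTop (𝓝 0) :=
  Summit.AtomisticToContinuum.HydrodynamicLimit.Theorems.HemisphereAffineSlaving.stub_valueChi_cone_const  -- LANDED p166460

/-- [Vχ0M] PROVABLE (wave 1 of seat c11; equilibrium rung of the mesoscale side of [TSχ]): under the homogeneous law `(1, 0, θ)`, for small `σ`,
every flow family, `t > 0`, admissible kernel family and smooth scalar test `χ` on `[0, t]`: `sup_{τ ≤ t} |(Rhs + Kfun)[φ_N](0, χ)(τ)| → 0` in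
probability. Route: `sup_τ |Rhs| → 0` is [R0]-unconditional (`Holds.stub_rhsSup_of_constLLN` p134580 fed with the constant-profile LLN of
`stub_blockDensityLLNConst` p135857 + `stub_blockVelocityLLNConst` p135595 + `stub_constLLN_of_parts` p134699 — composition 4's `constLLN_of`,
re-derived locally); `sup_τ |Kfun| → 0` is `RelaxC` from [C]° `stub_weightedKineticRelaxationDilute` p117619 fed with [E] `stub_energyAllTimes`,
the equilibrium ceiling `ceilingAllTimes_const` (…CeilingAllTimesRung0) at the level `η_Z` of [Z], and 9522 at equilibrium `fmr_rung0`
(…FmrRung0 p140447); `σ₀ := min …`, union bound at `δ/2`. -/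
theorem stub_valueChi_meso_const : ∀ θ : ℝ, 0 < θ → ∃ σ₀ : ℝ, 0 < σ₀ ∧ ∀ σ : ℝ, 0 < σ → σ < σ₀ → ∀ (Φ : Flows σ) (t : ℝ), 0 < t → ∀ (γ C : ℝ) (φ : ℕ → T3 → ℝ), 0 < γ → γ ≤ 1 / 15 → AdmissibleKernel γ C φ → ∀ (χ : ℝ → T3 → ℝ), Literature.Analysis.FunctionSpaces.Torus.IsSmoothSpaceTimeOn (Icc 0 t) χ → ∀ δ : ℝ, 0 < δ → Tendsto (fun N : ℕ => Literature.MathematicalPhysics.KineticTheory.localGibbsLaw σ (fun _ => 1) (fun _ => 0) (fun _ => θ) N (Φ N) {z | ∃ τ ∈ Icc 0 t, δ < |(Rhs σ Φ φ (fun (_ : ℝ) (_ : T3) => (0 : V3)) χ N z τ + Kfun σ Φ φ (fun (_ : ℝ) (_ : T3) => (0 : V3)) χ N z τ)|}) atTop (𝓝 0) :=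
  Summit.AtomisticToContinuum.HydrodynamicLimit.Theorems.HemisphereAffineSlaving.stub_valueChi_meso_const  -- LANDED p166653

/-- STUB [G2] `stub_channelAdditivity` (channel additivity of the crux's conclusion) — LANDED p139073 (module `…ChannelAdditivity`); CLOSED BY NAME, registered signature verbatim; full docstring in the module. -/
theorem stub_channelAdditivity : ∀ (σ : ℝ), 0 < σ → σ ≤ 1 / 2 → ∀ (ηZ K : ℝ), 0 < ηZ → 0 ≤ K → (∀ η : ℝ, 0 ≤ η → η ≤ ηZ → |Literature.MathematicalPhysics.KineticTheory.hsCompressibility η - 1| ≤ K * η) → ∀ η₁ : ℝ, 0 < η₁ → η₁ ≤ ηZ → ∀ (a₀ θ₀ : T3 → ℝ) (u₀ : T3 → V3) (Φ : Flows σ) (φ : ℕ → T3 → ℝ) (t : ℝ), 0 < t → (∀ N, Continuous (φ N)) → (∀ N y, 0 ≤ φ N y) → DiluteAt σ a₀ θ₀ u₀ Φ t φ η₁ → ∀ (ψ : ℝ → T3 → V3) (χ : ℝ → T3 → ℝ), Literature.Analysis.FunctionSpaces.Torus.IsSmoothSpaceTimeOn (Icc 0 t) ψ → Literature.Analysis.FunctionSpaces.Torus.IsSmoothSpaceTimeOn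 (Icc 0 t) χ → (∀ δ : ℝ, 0 < δ → Tendsto (fun N : ℕ => Literature.MathematicalPhysics.KineticTheory.localGibbsLaw σ a₀ u₀ θ₀ N (Φ N) {z | ∃ τ ∈ Icc 0 t, δ < |Cc σ Φ ψ (fun (_ : ℝ) (_ : T3) => (0 : ℝ)) N z τ - Rhs σ Φ φ ψ (fun (_ : ℝ) (_ : T3) => (0 : ℝ)) N z τ|}) atTop (𝓝 0)) → (∀ δ : ℝ, 0 < δ → Tendsto (fun N : ℕ => Literature.MathematicalPhysics.KineticTheory.localGibbsLaw σ a₀ u₀ θ₀ N (Φ N) {z | ∃ τ ∈ Icc 0 t, δ < |Cc σ Φ (fun (_ : ℝ) (_ : T3) => (0 : V3)) χ N z τ - Rhs σ Φ φ (fun (_ : ℝ) (_ : T3) => (0 : V3)) χ N z τ|}) atTop (𝓝 0)) → ∀ δ : ℝ, 0 < δ → Tendsto (fun N : ℕ => Literature.MathematicalPhysics.KineticTheory.localGibbsLaw σ a₀ u₀ θ₀ N (Φ N) {z | ∃ τ ∈ Icc 0 t, δ < |Cc σ Φ ψ χ N z τ - Rhs σ Φ φ ψ χ N z τ|}) atTop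 (𝓝 0) :=
  Summit.AtomisticToContinuum.HydrodynamicLimit.Theorems.HemisphereAffineSlaving.stub_channelAdditivity


/-- STUB `stub_markedReduction` (THE MARKED REDUCTION — NEW in v10; PROVED and LANDED p120490, module `…MarkedReduction`, wave-1 worker W1; CLOSED BY NAME, registered signature verbatim; replaces the composition step
`slavingReductionAt` + `fluxMomentChaos_of_parts` of v9). At fixed `(σ, profiles, Φ)` with `0 < σ ≤ 1/2`, a kernel family,
a horizon `t > 0` and smooth tests on `[0, t]`: [S1] `BalanceFor σ Φ` (`Cc = J_N` on the good set) ∧ [V] `VirialBounded` ∧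
[M] at the collisional pressure (`M_N − (Rhs + K) → 0` uniformly in `τ ≤ t` in probability) ∧ [C] `RelaxC` (`K → 0`)
⟹ the crux's conclusion at this `(kernel, t, ψ, χ)`. Proof route: on the good set `Cc − Rhs = (J − M) + (M − (Rhs + K)) + K`
with `|J_N − M_N| ≤ 27 C₂ ε_N V_N(τ) ≤ 27 C₂ ε_N V_N(t)` (landed `abs_Jfun_sub_Mfun_le`, `virialW_mono`,
`exists_second_deriv_bound`), `ε_N → 0` (`tendsto_hsDiameter`) against a tightness level of `V_N(t)`, the null complement of
the good set (`localGibbsLaw_compl_good'`) and a union bound at levels `δ/3` — verbatim the two landed proofs, merged. -/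
theorem stub_markedReduction : ∀ (σ : ℝ), 0 < σ → σ ≤ 1 / 2 → ∀ (a₀ θ₀ : T3 → ℝ) (u₀ : T3 → V3) (Φ : Flows σ), BalanceFor σ Φ → ∀ (φ : ℕ → T3 → ℝ) {t : ℝ}, 0 < t → ∀ {ψ : ℝ → T3 → V3} {χ : ℝ → T3 → ℝ}, Literature.Analysis.FunctionSpaces.Torus.IsSmoothSpaceTimeOn (Icc 0 t) ψ → Literature.Analysis.FunctionSpaces.Torus.IsSmoothSpaceTimeOn (Icc 0 t) χ → VirialBounded σ a₀ θ₀ u₀ Φ t → (∀ δ : ℝ, 0 < δ → Tendsto (fun N : ℕ => Literature.MathematicalPhysics.KineticTheory.localGibbsLaw σ a₀ u₀ θ₀ N (Φ N) {z | ∃ τ ∈ Icc 0 t, δ < |Mfun σ Φ ψ χ N z τ - (Rhs σ Φ φ ψ χ N z τ + Kfun σ Φ φ ψ χ N z τ)|}) atTop (𝓝 0)) → RelaxC σ a₀ θ₀ u₀ Φ φ t ψ χ → ∀ δ : ℝ, 0 < δ → Tendsto (fun N : ℕ => Literature.MathematicalPhysics.KineticTheory.localGibbsLaw σ a₀ u₀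 θ₀ N (Φ N) {z | ∃ τ ∈ Icc 0 t, δ < |Cc σ Φ ψ χ N z τ - Rhs σ Φ φ ψ χ N z τ|}) atTop (𝓝 0) :=
  Summit.AtomisticToContinuum.HydrodynamicLimit.Theorems.HemisphereAffineSlaving.stub_markedReduction

/-- STUB [B-stat] (STATIC THIN-SHELL PRESSURE EQUATION AT LOW DENSITY; PROVED — the sibling line's landed
`stub_pressureEquation` p100223, a corollary of the tree's `HardSphereContactTheorem_holds`; registered signature verbatim,
closed by name): there is `η₀ > 0` such that under the homogeneous local Gibbs law at reduced density `σ³ < η₀` the expected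
number of ordered pairs per particle in the blown-up shell `(σ, σ(1+h)]`, divided by `h`, tends to `6(Z(σ³) − 1)`. -/
theorem stub_pressureEquation : ∃ η₀ : ℝ, 0 < η₀ ∧ ∀ σ : ℝ, 0 < σ → σ ^ 3 < η₀ → ∀ θ : ℝ, 0 < θ → ∀ e : ℝ, 0 < e → ∃ h₀ : ℝ, 0 < h₀ ∧ ∀ h : ℝ, 0 < h → h < h₀ → ∃ N₀ : ℕ, ∀ N : ℕ, N₀ ≤ N → ∀ Φ : Literature.Analysis.FluidPDE.HardSphereFlow (Literature.Analysis.FluidPDE.Torus.geometry (Fin 3)) (Literature.MathematicalPhysics.KineticTheory.hsDiameter σ N) (N + 1), |h⁻¹ * (∫ z, ((N : ℝ) + 1)⁻¹ * ∑ i : Fin (N + 1), ∑ j : Fin (N + 1), (if j ≠ i ∧ σ < (((N : ℝ) + 1) ^ ((1 : ℝ) / 3)) * Literature.Analysis.FluidPDE.Torus.euclidDist (z i).1 (z j).1 ∧ (((N : ℝ) + 1) ^ ((1 : ℝ) / 3)) * Literature.Analysis.FluidPDE.Torus.euclidDist (z i).1 (z j).1 ≤ σ * (1 + h) then (1 : ℝ)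 else 0) ∂(Literature.MathematicalPhysics.KineticTheory.localGibbsLaw σ (fun _ => 1) (fun _ => 0) (fun _ => θ) N Φ)) - 6 * (Literature.MathematicalPhysics.KineticTheory.hsCompressibility (σ ^ 3) - 1)| ≤ e :=
  Summit.AtomisticToContinuum.HydrodynamicLimit.Theorems.ConditionalCovarianceLiouvilleRigidity.stub_pressureEquation

/-- STUB [C]° `stub_weightedKineticRelaxationDilute` (floor-free `(Z−1)`-weighted weak kinetic relaxation: energy cap + dilute event + kinetic closure ⇒ `RelaxC`) — LANDED p117619 (module `…WeightedKineticRelaxationDilute`); CLOSED BY NAME; full docstring in the module. -/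
theorem stub_weightedKineticRelaxationDilute : ∀ (ηZ K : ℝ), 0 < ηZ → 0 ≤ K → (∀ η : ℝ, 0 ≤ η → η ≤ ηZ → |Literature.MathematicalPhysics.KineticTheory.hsCompressibility η - 1| ≤ K * η) → ∀ η₁ : ℝ, 0 < η₁ → η₁ ≤ ηZ → ∀ σ : ℝ, 0 < σ → ∀ (a₀ θ₀ : T3 → ℝ) (u₀ : T3 → V3) (Φ : Flows σ) (t E₀ : ℝ), 0 < t → Tendsto (fun N : ℕ => Literature.MathematicalPhysics.KineticTheory.localGibbsLaw σ a₀ u₀ θ₀ N (Φ N) {z | ∃ s ∈ Icc 0 t, E₀ < ((N : ℝ) + 1)⁻¹ * Literature.Analysis.FluidPDE.configEnergy ((Φ N).flow s z)}) atTop (𝓝 0) → ∀ (γ C : ℝ) (φ : ℕ → T3 → ℝ), 0 < γ → γ ≤ 1 / 15 → AdmissibleKernel γ C φ → DiluteAt σ a₀ θ₀ u₀ Φ t φ η₁ → (∀ δ : ℝ, 0 < δ → Tendsto (fun N : ℕ => Literature.MathematicalPhysics.KineticTheory.localGibbsLaw σ a₀ u₀ θ₀ N (Φ N) {z | δ < ∫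 s in Icc 0 t, ∫ x, ((∑ j, ∑ k, Dst φ N ((Φ N).flow s z) x j k ^ 2) + ‖qfl φ N ((Φ N).flow s z) x‖ ^ 2)}) atTop (𝓝 0)) → ∀ (ψ : ℝ → T3 → V3) (χ : ℝ → T3 → ℝ), Literature.Analysis.FunctionSpaces.Torus.IsSmoothSpaceTimeOn (Icc 0 t) ψ → Literature.Analysis.FunctionSpaces.Torus.IsSmoothSpaceTimeOn (Icc 0 t) χ → RelaxC σ a₀ θ₀ u₀ Φ φ t ψ χ :=
  Summit.AtomisticToContinuum.HydrodynamicLimit.Theorems.HemisphereAffineSlaving.stub_weightedKineticRelaxationDilute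

/-- STUB [E] `stub_energyAllTimes` (ALL-TIMES ENERGY CAP; NEW in v8 — LANDED p117570, module `…EnergyAllTimes`, wave-1 worker
W-E; CLOSED BY NAME, signature verbatim): for nice profiles, `0 < σ ≤ 1/2` and every
flow family there is ONE level `E₀ ≥ 0` such that for EVERY horizon `t` the event "the normalised kinetic energy
`(N+1)⁻¹ E(Φ_s z)` exceeds `E₀` at some `s ∈ [0, t]`" has local-Gibbs probability `→ 0`. Proof route: the time-zero
exponential moment bound `VisitLedgerUpscattering.stub_initialMoment` (`(N+1)⁻¹Σ e^{λ|vᵢ|²} ≤ C₀` w.h.p., hence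
`(N+1)⁻¹ E(z) ≤ C₀/(2λ)` by `λx ≤ e^{λx}`), conservation of energy along the orbits of the good set
(`HardSphereFlow.configEnergy_flow`) and the fact that the law is carried by the good set (`localGibbsLaw_eq`,
`localGibbsMeasure_absolutelyContinuous`, `HardSphereFlow.measure_compl_good`). -/
theorem stub_energyAllTimes : ∀ (a₀ θ₀ : T3 → ℝ) (u₀ : T3 → V3), NiceProfiles a₀ θ₀ u₀ → ∀ σ : ℝ, 0 < σ → σ ≤ 1 / 2 → ∀ Φ : Flows σ, ∃ E₀ : ℝ, 0 ≤ E₀ ∧ ∀ t : ℝ, Tendsto (fun N : ℕ => Literature.MathematicalPhysics.KineticTheory.localGibbsLaw σ a₀ u₀ θ₀ N (Φ N) {z | ∃ s ∈ Icc 0 t, E₀ < ((N : ℝ) + 1)⁻¹ * Literature.Analysis.FluidPDE.configEnergy ((Φ N).flow s z)}) atTop (𝓝 0) :=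
  Summit.AtomisticToContinuum.HydrodynamicLimit.Theorems.HemisphereAffineSlaving.stub_energyAllTimes

/-- STUB [Z] `stub_hsCompressibility_linear` (THE COMPRESSIBILITY EXCESS VANISHES LINEARLY AT LOW DENSITY; NEW in v8 — LANDED
p117576, module `…CompressibilityLinear`, wave-1 worker W-Z; CLOSED BY NAME, signature verbatim): there are `η_Z > 0` and `K ≥ 0` with `|Z(η) − 1| ≤ K η` for `0 ≤ η ≤ η_Z`. Proof route: `Z(η) = 1 + η f_ex′(η)`
(`hsCompressibility`); below the cluster radius `σ₁` of `HardSphereContactTheoremProofs` (`exists_smallDensity`,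
`σ₁ := min σ₀ (1/4)`) the tree proves `HasDerivAt f_ex (Lam η) η` at `η = σ³`, `0 < σ < σ₁`
(`hasDerivAt_hsExcessFreeEnergy`), `Lam t = (v₁/2) contactG (t^{1/3})`, `v₁ = 4π/3` (`v₁_eq`) and `|contactG σ| ≤ 9`
(`abs_contactG_le`), so `K = 6π` works on `(0, (σ₁/2)³]`; at `η = 0` both sides vanish. -/
theorem stub_hsCompressibility_linear : ∃ ηZ : ℝ, 0 < ηZ ∧ ∃ K : ℝ, 0 ≤ K ∧ ∀ η : ℝ, 0 ≤ η → η ≤ ηZ → |Literature.MathematicalPhysics.KineticTheory.hsCompressibility η - 1| ≤ K * η :=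
  Summit.AtomisticToContinuum.HydrodynamicLimit.Theorems.HemisphereAffineSlaving.stub_hsCompressibility_linear

/-- STUB [S'] `stub_ceilingAllTimes` (THE `∀ t` DILUTE BLOCK CEILING — the one a-priori statement the FILED `∀ t > 0` form
needs from ANY line after v8; open). For every level `η₁ > 0` and all nice profiles there is `σ₀ > 0` such that for
`0 < σ < σ₀`, EVERY flow family, EVERY `t > 0` and every admissible kernel family, w.h.p. no block is denser than `η₁/σ³` at
any time `s ≤ t` (`DiluteAt`). Pre-shock it IS the registered crux 9201 (`stub_diluteBlocks_of_kineticRangeControl`); its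
equilibrium rung is the tree's `AdiabatCeiling.ceilingFixed_homogeneous_of_hUp` + `ceiling_statics_hUp` (flow invariance of
the homogeneous law + Ruelle–Chernoff statics); it is NOT held by the negative lemmas on the old supply (persistent vacuum /
hot spot are LOW-density events). Exposure: an implosion of the limiting Euler flow that drives a mesoscopic block to
packing `η₁` before the hard-sphere pressure stiffens — a hydrodynamic limit THROUGH a collapse, which nobody can construct. -/
theorem stub_ceilingAllTimes : ∀ η₁ : ℝ, 0 < η₁ → ∀ (a₀ θ₀ : T3 → ℝ) (u₀ : T3 → V3), NiceProfiles a₀ θ₀ u₀ → ∃ σ₀ : ℝ, 0 < σ₀ ∧ ∀ σ : ℝ, 0 < σ → σ < σ₀ → ∀ (Φ : Flows σ) (t : ℝ), 0 < t → ∀ (γ C : ℝ) (φ : ℕ → T3 → ℝ), 0 < γ → γ ≤ 1 / 15 → AdmissibleKernel γ C φ → DiluteAt σ a₀ θ₀ u₀ Φ t φ η₁ := by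
  sorry

/-! ### v11/v12: the equilibrium rung (stub [ER']; [VL] demoted to the hypothesis `VirialLLNConst` in v12) -/

/-- STUB [ER'] `stub_equilibriumSup` (the `sup_τ` step of the equilibrium rung) — LANDED p133771 (module `…EquilibriumSup`); CLOSED BY NAME; full docstring in the module. -/
theorem stub_equilibriumSup : Summit.AtomisticToContinuum.HydrodynamicLimit.Theses.StiffCollisionalRelaxation.MesoscopicLLN → ∀ θ : ℝ, 0 < θ → ∃ σ₀ : ℝ, 0 < σ₀ ∧ ∀ σ : ℝ, 0 < σ → σ < σ₀ → ∀ (Φ : Flows σ) (t : ℝ), 0 < t → (∀ δ ε : ℝ, 0 < δ → 0 < ε → ∃ n : ℕ, 0 < n ∧ ∀ᶠ N : ℕ in atTop, Literature.MathematicalPhysics.KineticTheory.localGibbsLaw σ (fun _ => 1) (fun _ => 0) (fun _ => θ) N (Φ N) {z | ∃ k : ℕ, k < n ∧ δ < virialW σ Φ N z ((k + 1) * (t / n)) - virialW σ Φ N z (k * (t / n))} ≤ ENNReal.ofReal ε) → ∀ (γ C : ℝ) (φ : ℕ → T3 → ℝ), 0 < γ → γ ≤ 1 / 15 → AdmissibleKernel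 γ C φ → ∀ (ψ : ℝ → T3 → V3) (χ : ℝ → T3 → ℝ), Literature.Analysis.FunctionSpaces.Torus.IsSmoothSpaceTimeOn (Icc 0 t) ψ → Literature.Analysis.FunctionSpaces.Torus.IsSmoothSpaceTimeOn (Icc 0 t) χ → ∀ δ : ℝ, 0 < δ → Tendsto (fun N : ℕ => Literature.MathematicalPhysics.KineticTheory.localGibbsLaw σ (fun _ => 1) (fun _ => 0) (fun _ => θ) N (Φ N) {z | ∃ τ ∈ Icc 0 t, δ < |Cc σ Φ ψ χ N z τ - Rhs σ Φ φ ψ χ N z τ|}) atTop (𝓝 0) :=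
  Summit.AtomisticToContinuum.HydrodynamicLimit.Theorems.HemisphereAffineSlaving.stub_equilibriumSup

/-! ### v11.1: window-burst control at equilibrium from the sibling crux `EvenStressEnskog` at constant profiles -/

/-! STUB [PW-a] `stub_windowDomination` — LANDED p132091 (module `…WindowDomination`, never built by the check farm, hence INLINED below with its proof verbatim); full docstring in that module / seat c8's published skeleton. -/
/-! #### [PW-a] INLINED PROOF (v19.4): the accepted file …WindowDomination (p132091) is never BUILT by the check farm (`stale:323:unbuilt` since
2026-08-17T00:45Z although its source elaborates), so its proof is inlined here verbatim (section `InlinedWindowDomination`; helper names get the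
`Holds.` prefix of this namespace and clash with nothing) — the registered stub is thereby CLOSED in the skeleton, no `sorry`. -/
section InlinedWindowDomination

open Literature.Analysis.FluidPDE
open Literature.MathematicalPhysics.KineticTheory (hsDiameter hsDiameter_pos evenMark mollDensity mollDensity_nonneg_of_pos)
open Summit.AtomisticToContinuum.HydrodynamicLimit.Theorems.EvenStressEnskog (evenMark_diag_nonneg)

section OnePair

/-- The window cutoff `g(a) = max 0 (min 1 (2 − 2a/η_c))` equals `1` for `2a ≤ η_c` (`0 < η_c`). -/
theorem windowCutoff_eq_one {ηc a : ℝ} (hηc : 0 < ηc) (ha : 2 * a ≤ ηc) :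
    max 0 (min 1 (2 - 2 * a / ηc)) = 1 := by
  have h1 : 2 * a / ηc ≤ 1 := (div_le_one hηc).2 ha
  rw [min_eq_left (by linarith), max_eq_right zero_le_one]

/-- **The trace of the even marks at an outgoing contact pair is the flux weight.** For an ordered pair `(i, j)`
at contact (`‖x_i − x_j‖ = ε_N`) of an OUTGOING configuration, with `n̂ = ε_N⁻¹ n` and the pre-collisional
velocities `(v_i⁻, v_j⁻) = reflectVel n (v_i, v_j)`: `Σ_k Ξ^{kk}(n̂, v_i⁻, v_j⁻) = ‖Δv_i‖`
(`⟪v_j⁻ − v_i⁻, n̂⟫ = ⟪v_i − v_j, n̂⟫ = ‖Δv_i‖ ≥ 0` and `Σ_k n̂_k² = ‖n̂‖² = 1`). -/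
theorem sum_evenMark_diag_pre_eq_norm_dV {σ : ℝ} (hσ : 0 < σ) {N : ℕ} {w : Cfg N} {i j : Fin (N + 1)}
    (hcontact : ‖sepV N w i j‖ = hsDiameter σ N) (hout : 0 < ⟪sepV N w i j, (w i).2 - (w j).2⟫_ℝ) :
    ∑ k : Fin 3, evenMark k k ((hsDiameter σ N)⁻¹ • sepV N w i j,
        (reflectVel (sepV N w i j) ((w i).2, (w j).2)).1,
        (reflectVel (sepV N w i j) ((w i).2, (w j).2)).2) = ‖dV N w i j‖ := by
  have hε : 0 < hsDiameter σ N := hsDiameter_pos hσ N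
  have hn0 : sepV N w i j ≠ 0 := by
    intro h; rw [h, norm_zero] at hcontact; exact hε.ne hcontact
  have hω : omg N w i j = (hsDiameter σ N)⁻¹ • sepV N w i j := by rw [omg, hcontact]
  have hω1 : ‖omg N w i j‖ = 1 := norm_omg hn0
  set c : ℝ := ⟪(w i).2 - (w j).2, omg N w i j⟫_ℝ with hcdef
  have hc_eq : c = (hsDiameter σ N)⁻¹ * ⟪sepV N w i j, (w i).2 - (w j).2⟫_ℝ := by
    rw [hcdef, hω, inner_smul_right, real_inner_comm]
  have hcpos : 0 < c := by rw [hc_eq]; exact mul_pos (inv_pos.2 hε) hout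
  have hdv : ‖dV N w i j‖ = c := by
    rw [norm_dV_eq hn0, ← hcdef, abs_of_pos hcpos]
  -- the reflection flips the normal component of the relative velocity
  have hrefl : ⟪(reflectVel (sepV N w i j) ((w i).2, (w j).2)).2 -
      (reflectVel (sepV N w i j) ((w i).2, (w j).2)).1, (hsDiameter σ N)⁻¹ • sepV N w i j⟫_ℝ = c := by
    rw [inner_smul_right, ← neg_sub (reflectVel (sepV N w i j) ((w i).2, (w j).2)).1, inner_neg_left,
      real_inner_comm, inner_reflectVel_fst_sub_snd (sepV N w i j) hn0, neg_neg, hc_eq]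
  -- `Σ_k n̂_k² = ‖n̂‖² = 1`
  have hsq : ∑ k : Fin 3, ((hsDiameter σ N)⁻¹ • sepV N w i j) k * ((hsDiameter σ N)⁻¹ • sepV N w i j) k = 1 := by
    rw [← hω]
    have h := EuclideanSpace.norm_sq_eq (omg N w i j)
    rw [hω1, one_pow] at h
    rw [h]
    refine Finset.sum_congr rfl fun k _ => ?_
    rw [Real.norm_eq_abs, sq_abs, sq]
  simp only [evenMark]
  rw [hrefl, max_eq_left hcpos.le, ← Finset.mul_sum, hsq, mul_one, hdv]

/-- **The one-collision comparison.** For an ordered pair `(i, j)` at contact of an outgoing configuration `w`,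
under the ceiling `ρ_r(w, x_i) ≤ 2` (`0 < r`) and `4σ³ ≤ η_c`: the weighted virial kernel is at most `(1 + 2L)` times
`ε_N Σ_k g(σ³ρ_r(x_i)) Ξ^{kk}(n̂, v_i⁻, v_j⁻)` plus the fast tail `𝟙{‖v_i‖ > L ∨ ‖v_j‖ > L} virialK`. -/
theorem virialK_le_windowPair {σ : ℝ} (hσ : 0 < σ) {ηc r L : ℝ} (hηc : 0 < ηc) (hr : 0 < r) (hL : 0 < L)
    (hσc : 4 * σ ^ 3 ≤ ηc) {N : ℕ} {w : Cfg N} {i j : Fin (N + 1)}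
    (hcontact : ‖sepV N w i j‖ = hsDiameter σ N) (hout : 0 < ⟪sepV N w i j, (w i).2 - (w j).2⟫_ℝ)
    (hρ : mollDensity r w (w i).1 ≤ 2) (s : ℝ) :
    virialK σ N s w i j ≤
      (1 + 2 * L) * (hsDiameter σ N * ∑ k : Fin 3,
        (1 : ℝ) * max 0 (min 1 (2 - 2 * (σ ^ 3 * mollDensity r w (w i).1) / ηc)) *
          evenMark k k ((hsDiameter σ N)⁻¹ • sepV N w i j,
            (reflectVel (sepV N w i j) ((w i).2, (w j).2)).1,
            (reflectVel (sepV N w i j) ((w i).2, (w j).2)).2)) +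
      (if L < ‖(w i).2‖ ∨ L < ‖(w j).2‖ then virialK σ N s w i j else 0) := by
  have hε : 0 < hsDiameter σ N := hsDiameter_pos hσ N
  have hρ0 : 0 ≤ mollDensity r w (w i).1 := mollDensity_nonneg_of_pos hr w (w i).1
  have hσ3 : 0 < σ ^ 3 := by positivity
  have hg : max 0 (min 1 (2 - 2 * (σ ^ 3 * mollDensity r w (w i).1) / ηc)) = 1 := by
    refine windowCutoff_eq_one hηc ?_
    have h2 : σ ^ 3 * mollDensity r w (w i).1 ≤ σ ^ 3 * 2 := mul_le_mul_of_nonneg_left hρ hσ3.le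
    linarith
  simp only [hg, one_mul]
  rw [sum_evenMark_diag_pre_eq_norm_dV hσ hcontact hout]
  have hV0 : 0 ≤ virialK σ N s w i j := virialK_nonneg hσ.le N s w i j
  have hflux : 0 ≤ hsDiameter σ N * ‖dV N w i j‖ := by positivity
  by_cases hfast : L < ‖(w i).2‖ ∨ L < ‖(w j).2‖
  · rw [if_pos hfast]
    have h1 : 0 ≤ (1 + 2 * L) * (hsDiameter σ N * ‖dV N w i j‖) := by positivity
    linarith
  · rw [if_neg hfast, add_zero]
    push Not at hfast
    unfold virialK
    calc hsDiameter σ N * ‖dV N w i j‖ * (1 + ‖(w i).2‖ + ‖(w j).2‖)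
        ≤ hsDiameter σ N * ‖dV N w i j‖ * (1 + 2 * L) := by
          refine mul_le_mul_of_nonneg_left ?_ hflux
          linarith [hfast.1, hfast.2]
      _ = (1 + 2 * L) * (hsDiameter σ N * ‖dV N w i j‖) := by ring

end OnePair

/-! ## The registered stub -/

/-- **Registered stub [PW-a] `stub_windowDomination` — nonnegativity and window domination of the weighted collision
virial by the trace even collision sums.** Fix `0 < σ ≤ 1/2`, a cutoff level `η_c > 0`,
`g(a) = max 0 (min 1 (2 − 2a/η_c))`, `χ ≡ 1` and the trace marks `Ξ^{kk} = evenMark k k`. For every `0 < r < 1/4`,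
`L > 0`, flow family, `N`, GOOD initial datum `z` and horizon `t > 0` with the mollified ceiling `ρ_r(Φ_s z, x) ≤ 2` on
`[0, t]` and `4σ³ ≤ η_c`: (i) `0 ≤ K_k(τ) = collisionSum σ N (Φ N) τ 1 g Ξ^{kk} r z`; (ii) for `0 ≤ τ ≤ τ' ≤ t`,
`V_N(τ') − V_N(τ) ≤ (1 + 2L) Σ_k (K_k(τ') − K_k(τ)) + (N+1)⁻¹ Σ_{ordered collisions in (0,t], a speed > L} virialK`
(collision by collision on the good orbit: outgoing post-collisional pairs, `reflectVel` recovers the incoming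
velocities, `Σ_k Ξ^{kk}(n̂, v_i⁻, v_j⁻) = ‖Δv_i‖`, `g(σ³ρ_r) = 1` under the ceiling). [folklore; Chapman–Cowling (1970) Ch. 16] -/
theorem stub_windowDomination : ∀ (σ : ℝ), 0 < σ → σ ≤ 1 / 2 → ∀ (ηc : ℝ), 0 < ηc → ∀ (r L : ℝ), 0 < r → r < 1 / 4 → 0 < L → ∀ (Φ : Flows σ) (N : ℕ) (z : Cfg N), z ∈ (Φ N).good → ∀ t : ℝ, 0 < t → (∀ s ∈ Icc 0 t, ∀ x : T3, Literature.MathematicalPhysics.KineticTheory.mollDensity r ((Φ N).flow s z) x ≤ 2) → 4 * σ ^ 3 ≤ ηc → (∀ (k : Fin 3) (τ : ℝ), 0 ≤ Literature.MathematicalPhysics.KineticTheory.collisionSum σ N (Φ N) τ (fun _ : ℝ × T3 => (1 : ℝ)) (fun a : ℝ => max 0 (min 1 (2 - 2 * a / ηc))) (Literature.MathematicalPhysics.KineticTheory.evenMark k k) r z) ∧ (∀ τ τ' : ℝ, 0 ≤ τ → τ ≤ τ' → τ' ≤ t → virialW σ Φ N z τ' - virialW σ Φ N z τ ≤ (1 +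 2 * L) * ∑ k : Fin 3, (Literature.MathematicalPhysics.KineticTheory.collisionSum σ N (Φ N) τ' (fun _ : ℝ × T3 => (1 : ℝ)) (fun a : ℝ => max 0 (min 1 (2 - 2 * a / ηc))) (Literature.MathematicalPhysics.KineticTheory.evenMark k k) r z - Literature.MathematicalPhysics.KineticTheory.collisionSum σ N (Φ N) τ (fun _ : ℝ × T3 => (1 : ℝ)) (fun a : ℝ => max 0 (min 1 (2 - 2 * a / ηc))) (Literature.MathematicalPhysics.KineticTheory.evenMark k k) r z) + ((N : ℝ) + 1)⁻¹ * (Φ N).collisionPairSum (Ioc 0 t) (fun s w i j => if L < ‖(w i).2‖ ∨ L < ‖(w j).2‖ then virialK σ N s w i j else 0) z) := by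
  intro σ hσ _hσ2 ηc hηc r L hr _hr4 hL Φ N z hz t _ht hceil hσc
  have hε : 0 < hsDiameter σ N := hsDiameter_pos hσ N
  have htraj := (Φ N).isTrajectory z hz
  -- the kernel of `K_k` as a collision pair sum along the flow, and the fast tail kernel
  set gK : Fin 3 → ℝ → Cfg N → Fin (N + 1) → Fin (N + 1) → ℝ := fun k s w i j =>
    (1 : ℝ) * max 0 (min 1 (2 - 2 * (σ ^ 3 * mollDensity r w (w i).1) / ηc)) *
      evenMark k k ((hsDiameter σ N)⁻¹ • sepV N w i j,
        (reflectVel (sepV N w i j) ((w i).2, (w j).2)).1,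
        (reflectVel (sepV N w i j) ((w i).2, (w j).2)).2) with hgK
  set tailK : ℝ → Cfg N → Fin (N + 1) → Fin (N + 1) → ℝ := fun s w i j =>
    if L < ‖(w i).2‖ ∨ L < ‖(w j).2‖ then virialK σ N s w i j else 0 with htailK
  have hgK0 : ∀ k s w i j, 0 ≤ gK k s w i j := fun k s w i j => by
    simp only [hgK]
    exact mul_nonneg (mul_nonneg zero_le_one (le_max_left _ _)) (evenMark_diag_nonneg k _)
  have htailK0 : ∀ s w i j, 0 ≤ tailK s w i j := fun s w i j => by
    simp only [htailK]
    split_ifs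
    · exact virialK_nonneg hσ.le N s w i j
    · exact le_rfl
  -- `K_k(τ) = ε/(N+1) · CPS(Icc 0 τ) gK_k`
  have hK : ∀ (k : Fin 3) (τ : ℝ),
      Literature.MathematicalPhysics.KineticTheory.collisionSum σ N (Φ N) τ (fun _ : ℝ × T3 => (1 : ℝ))
        (fun a : ℝ => max 0 (min 1 (2 - 2 * a / ηc))) (evenMark k k) r z =
      hsDiameter σ N / ((N : ℝ) + 1) * (Φ N).collisionPairSum (Icc 0 τ) (gK k) z := by
    intro k τ
    rw [(Φ N).collisionPairSum_eq_finsum_ite hz]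
    rfl
  -- window differences of `K_k`
  have hKdiff : ∀ (k : Fin 3) {τ τ' : ℝ}, 0 ≤ τ → τ ≤ τ' →
      Literature.MathematicalPhysics.KineticTheory.collisionSum σ N (Φ N) τ' (fun _ : ℝ × T3 => (1 : ℝ))
          (fun a : ℝ => max 0 (min 1 (2 - 2 * a / ηc))) (evenMark k k) r z -
        Literature.MathematicalPhysics.KineticTheory.collisionSum σ N (Φ N) τ (fun _ : ℝ × T3 => (1 : ℝ))
          (fun a : ℝ => max 0 (min 1 (2 - 2 * a / ηc))) (evenMark k k) r z =
      hsDiameter σ N / ((N : ℝ) + 1) * (Φ N).collisionPairSum (Ioc τ τ') (gK k) z := by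
    intro k τ τ' hτ hττ'
    have hdisj : Disjoint (Icc 0 τ) (Ioc τ τ') :=
      Set.disjoint_left.2 fun x hx1 hx2 => (not_lt.2 hx1.2) hx2.1
    rw [hK, hK]
    unfold HardSphereFlow.collisionPairSum
    rw [← Icc_union_Ioc_eq_Icc hτ hττ', collisionPairSum_union (htraj.locFinite 0 τ)
      (htraj.finite_collisionTimes_inter_Ioc τ τ') hdisj]
    ring
  refine ⟨fun k τ => ?_, fun τ τ' hτ hττ' hτ't => ?_⟩
  · -- (i) nonnegativity
    rw [hK]
    refine mul_nonneg (div_nonneg hε.le (by positivity)) ?_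
    unfold HardSphereFlow.collisionPairSum
    exact collisionPairSum_nonneg fun s i j => hgK0 k s _ i j
  · -- (ii) window domination
    have hc0 : (0 : ℝ) ≤ ((N : ℝ) + 1)⁻¹ := by positivity
    have hfin := htraj.finite_collisionTimes_inter_Ioc τ τ'
    -- the tail over `(τ, τ']` is part of the tail over `(0, t]`
    have htail : (Φ N).collisionPairSum (Ioc τ τ') tailK z ≤ (Φ N).collisionPairSum (Ioc 0 t) tailK z := by
      rw [collisionPairSum_Ioc_split Φ hz (hτ.trans hττ') hτ't tailK, collisionPairSum_Ioc_split Φ hz hτ hττ' tailK]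
      have h1 : 0 ≤ (Φ N).collisionPairSum (Ioc 0 τ) tailK z :=
        collisionPairSum_nonneg fun s i j => htailK0 s _ i j
      have h2 : 0 ≤ (Φ N).collisionPairSum (Ioc τ' t) tailK z :=
        collisionPairSum_nonneg fun s i j => htailK0 s _ i j
      linarith
    -- the window comparison, collision by collision
    have hmain : (Φ N).collisionPairSum (Ioc τ τ') (virialK σ N) z ≤
        (1 + 2 * L) * (hsDiameter σ N * ∑ k : Fin 3, (Φ N).collisionPairSum (Ioc τ τ') (gK k) z) +
          (Φ N).collisionPairSum (Ioc τ τ') tailK z := by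
      unfold HardSphereFlow.collisionPairSum
      simp only [collisionPairSum_eq_finset_sum hfin]
      have htime : ∀ tc ∈ hfin.toFinset,
          ∑ p ∈ contactPairs (Torus.geometry (Fin 3)) (hsDiameter σ N) ((Φ N).flow tc z),
              virialK σ N tc ((Φ N).flow tc z) p.1 p.2 ≤
            (1 + 2 * L) * (hsDiameter σ N * ∑ k : Fin 3,
              ∑ p ∈ contactPairs (Torus.geometry (Fin 3)) (hsDiameter σ N) ((Φ N).flow tc z),
                gK k tc ((Φ N).flow tc z) p.1 p.2) +
              ∑ p ∈ contactPairs (Torus.geometry (Fin 3)) (hsDiameter σ N) ((Φ N).flow tc z),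
                tailK tc ((Φ N).flow tc z) p.1 p.2 := by
        intro tc htc
        obtain ⟨-, htcI⟩ := (Set.Finite.mem_toFinset hfin).1 htc
        have hs : tc ∈ Icc 0 t := ⟨hτ.trans htcI.1.le, htcI.2.trans hτ't⟩
        calc ∑ p ∈ contactPairs (Torus.geometry (Fin 3)) (hsDiameter σ N) ((Φ N).flow tc z),
              virialK σ N tc ((Φ N).flow tc z) p.1 p.2
            ≤ ∑ p ∈ contactPairs (Torus.geometry (Fin 3)) (hsDiameter σ N) ((Φ N).flow tc z),
                ((1 + 2 * L) * (hsDiameter σ N * ∑ k : Fin 3, gK k tc ((Φ N).flow tc z) p.1 p.2) +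
                  tailK tc ((Φ N).flow tc z) p.1 p.2) := by
              refine Finset.sum_le_sum fun p hp => ?_
              obtain ⟨hne, hcs⟩ := mem_contactPairs.1 hp
              have hout : 0 < ⟪sepV N ((Φ N).flow tc z) p.1 p.2,
                  ((Φ N).flow tc z p.1).2 - ((Φ N).flow tc z p.2).2⟫_ℝ :=
                htraj.isOutgoing_of_mem_contactSet hne hcs
              have hcontact : ‖sepV N ((Φ N).flow tc z) p.1 p.2‖ = hsDiameter σ N := hcs.2
              exact virialK_le_windowPair hσ hηc hr hL hσc hcontact hout (hceil tc hs _) tc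
          _ = _ := by
              rw [Finset.sum_add_distrib, ← Finset.mul_sum, ← Finset.mul_sum, Finset.sum_comm]
      calc ∑ tc ∈ hfin.toFinset, ∑ p ∈ contactPairs (Torus.geometry (Fin 3)) (hsDiameter σ N) ((Φ N).flow tc z),
            virialK σ N tc ((Φ N).flow tc z) p.1 p.2
          ≤ ∑ tc ∈ hfin.toFinset, ((1 + 2 * L) * (hsDiameter σ N * ∑ k : Fin 3,
              ∑ p ∈ contactPairs (Torus.geometry (Fin 3)) (hsDiameter σ N) ((Φ N).flow tc z),
                gK k tc ((Φ N).flow tc z) p.1 p.2) +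
              ∑ p ∈ contactPairs (Torus.geometry (Fin 3)) (hsDiameter σ N) ((Φ N).flow tc z),
                tailK tc ((Φ N).flow tc z) p.1 p.2) := Finset.sum_le_sum htime
        _ = _ := by
            rw [Finset.sum_add_distrib, ← Finset.mul_sum, ← Finset.mul_sum, Finset.sum_comm]
    -- assemble
    have hsumK : ∑ k : Fin 3,
        (Literature.MathematicalPhysics.KineticTheory.collisionSum σ N (Φ N) τ' (fun _ : ℝ × T3 => (1 : ℝ))
            (fun a : ℝ => max 0 (min 1 (2 - 2 * a / ηc))) (evenMark k k) r z -
          Literature.MathematicalPhysics.KineticTheory.collisionSum σ N (Φ N) τ (fun _ : ℝ × T3 => (1 : ℝ))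
            (fun a : ℝ => max 0 (min 1 (2 - 2 * a / ηc))) (evenMark k k) r z) =
        hsDiameter σ N / ((N : ℝ) + 1) * ∑ k : Fin 3, (Φ N).collisionPairSum (Ioc τ τ') (gK k) z := by
      rw [Finset.mul_sum]
      exact Finset.sum_congr rfl fun k _ => hKdiff k hτ hττ'
    rw [hsumK, virialW, virialW, collisionPairSum_Ioc_split Φ hz hτ hττ' (virialK σ N)]
    have h1 := mul_le_mul_of_nonneg_left hmain hc0
    have h2 := mul_le_mul_of_nonneg_left htail hc0
    have hid : ((N : ℝ) + 1)⁻¹ * ((1 + 2 * L) * (hsDiameter σ N *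
        ∑ k : Fin 3, (Φ N).collisionPairSum (Ioc τ τ') (gK k) z) + (Φ N).collisionPairSum (Ioc τ τ') tailK z) =
        (1 + 2 * L) * (hsDiameter σ N / ((N : ℝ) + 1) * ∑ k : Fin 3, (Φ N).collisionPairSum (Ioc τ τ') (gK k) z) +
          ((N : ℝ) + 1)⁻¹ * (Φ N).collisionPairSum (Ioc τ τ') tailK z := by
      ring
    linarith


end InlinedWindowDomination


/-- STUB [PW-b] `stub_enskogWindowBound` — LANDED p132356 (module `…EnskogWindowBound`); CLOSED BY NAME, registered signature verbatim; full docstring in the module. -/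
theorem stub_enskogWindowBound : ∀ (σ : ℝ), 0 < σ → σ ≤ 1 / 2 → ∀ (ηZ K ηc : ℝ), 0 < ηZ → 0 ≤ K → (∀ η : ℝ, 0 ≤ η → η ≤ ηZ → |Literature.MathematicalPhysics.KineticTheory.hsCompressibility η - 1| ≤ K * η) → 0 < ηc → ηc ≤ ηZ → ∃ C : ℝ, 0 ≤ C ∧ ∀ (r E₀ : ℝ), 0 < r → r < 1 / 4 → 0 ≤ E₀ → ∀ (Φ : Flows σ) (N : ℕ) (z : Cfg N), z ∈ (Φ N).good → ∀ t : ℝ, 0 < t → (∀ s ∈ Icc 0 t, ((N : ℝ) + 1)⁻¹ * Literature.Analysis.FluidPDE.configEnergy ((Φ N).flow s z) ≤ E₀) → (∀ s ∈ Icc 0 t, ∀ x : T3, Literature.MathematicalPhysics.KineticTheory.mollDensity r ((Φ N).flow s z) x ≤ 2) → ∀ (k : Fin 3) (τ τ' : ℝ), 0 ≤ τ → τ ≤ τ' → τ' ≤ t → |σ ^ 3 * (∫ s in Icc 0 τ', Literature.MathematicalPhysics.KineticTheory.enskogRate σ N (fun _ : ℝ × T3 => (1 : ℝ)) (fun a :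 ℝ => max 0 (min 1 (2 - 2 * a / ηc))) (Literature.MathematicalPhysics.KineticTheory.evenMark k k) r s ((Φ N).flow s z)) - σ ^ 3 * (∫ s in Icc 0 τ, Literature.MathematicalPhysics.KineticTheory.enskogRate σ N (fun _ : ℝ × T3 => (1 : ℝ)) (fun a : ℝ => max 0 (min 1 (2 - 2 * a / ηc))) (Literature.MathematicalPhysics.KineticTheory.evenMark k k) r s ((Φ N).flow s z))| ≤ C * E₀ * (τ' - τ) :=
  Summit.AtomisticToContinuum.HydrodynamicLimit.Theorems.HemisphereAffineSlaving.stub_enskogWindowBound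

/-- STUB [MC] `stub_mollifiedCeilingConst` (NEW in v11.1; PROVABLE). At global equilibrium the cone-mollified empirical density
at a FIXED macroscopic radius `0 < r < 1/4` never exceeds `2` anywhere before time `t`, w.h.p.: for `θ > 0` there is
`σ₀ > 0` such that for `0 < σ < σ₀`, every flow family, `t > 0` and `r`, `P(∃ s ≤ t ∃ x, ρ_r(Φ_s z, x) > 2) → 0`. Proof:
static uniform LLN `tendsto_posGibbs_exists_density_dev` (`HardSphereUniformDensityLLN`, `SmallDensity uniformProfile σ`)
transferred to the rung-0 law (`HardSphereUniformGas`: positions `~ posGibbsMeasure`, velocities Gaussian) at each time of a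
finite grid by STATIONARITY (`map_flow_localGibbsLaw_const`), and between grid times the pathwise Lipschitz bound
`|ρ_r(Φ_s' z, x) − ρ_r(Φ_s z, x)| ≤ (3/(πr⁴)) (N+1)⁻¹Σ_i dist ≤ (3/(πr⁴)) |s' − s| √(2E₀)` on the energy-cap event
(`stub_energyAllTimes`; displacement ≤ path length `HardSphereFlow.euclidDist_flow_le_integral_norm_vel`, Cauchy–Schwarz). [v13: LANDED p132076, module `…MollifiedCeilingConst` (wave-1 worker W-MC; helpers `abs_mollDensity_flow_sub_le`, `tendsto_localGibbsLaw_exists_mollDensity_gt`); CLOSED BY NAME, signature verbatim.]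
-/
theorem stub_mollifiedCeilingConst : ∀ θ : ℝ, 0 < θ → ∃ σ₀ : ℝ, 0 < σ₀ ∧ ∀ σ : ℝ, 0 < σ → σ < σ₀ → ∀ (Φ : Flows σ) (t r : ℝ), 0 < t → 0 < r → r < 1 / 4 → Tendsto (fun N : ℕ => Literature.MathematicalPhysics.KineticTheory.localGibbsLaw σ (fun _ => 1) (fun _ => 0) (fun _ => θ) N (Φ N) {z | ∃ s ∈ Icc 0 t, ∃ x : T3, 2 < Literature.MathematicalPhysics.KineticTheory.mollDensity r ((Φ N).flow s z) x}) atTop (𝓝 0) :=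
  Summit.AtomisticToContinuum.HydrodynamicLimit.Theorems.HemisphereAffineSlaving.stub_mollifiedCeilingConst

/-- STUB [TL] `stub_virialTailConst` (fast-particle tail of the collision virial at equilibrium) — LANDED p132116 (module `…VirialTailConst`); CLOSED BY NAME; full docstring in the module. -/
theorem stub_virialTailConst : ∀ θ : ℝ, 0 < θ → ∃ σ₀ : ℝ, 0 < σ₀ ∧ ∀ σ : ℝ, 0 < σ → σ < σ₀ → ∀ (Φ : Flows σ) (t : ℝ), 0 < t → ∀ δ ε : ℝ, 0 < δ → 0 < ε → ∃ L₀ : ℝ, ∀ L : ℝ, L₀ ≤ L → ∀ N : ℕ, Literature.MathematicalPhysics.KineticTheory.localGibbsLaw σ (fun _ => 1) (fun _ => 0) (fun _ => θ) N (Φ N) {z | δ < ((N : ℝ) + 1)⁻¹ * (Φ N).collisionPairSum (Ioc 0 t) (fun s w i j => if L < ‖(w i).2‖ ∨ L < ‖(w j).2‖ then virialK σ N s w i j else 0) z} ≤ ENNReal.ofReal ε :=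
  Summit.AtomisticToContinuum.HydrodynamicLimit.Theorems.HemisphereAffineSlaving.stub_virialTailConst


/-! ### v14: the equilibrium rung UNCONDITIONALLY — the constant-profile mesoscopic LLN from the tree's statics -/

/-- STUB [CL-ρ] `stub_blockDensityLLNConst` (mesoscopic block-density LLN at constant profiles) — LANDED p135857 (module `…BlockDensityLLNConst`); CLOSED BY NAME; full docstring in the module. -/
theorem stub_blockDensityLLNConst : ∃ σ₀ : ℝ, 0 < σ₀ ∧ ∀ σ : ℝ, 0 < σ → σ < σ₀ → ∀ θ : ℝ, 0 < θ → ∀ (Φ : Flows σ) (γ C : ℝ) (φ : ℕ → T3 → ℝ), 0 < γ → γ ≤ 1 / 15 → AdmissibleKernel γ C φ → ∀ δ : ℝ, 0 < δ → Tendsto (fun N : ℕ => Literature.MathematicalPhysics.KineticTheory.localGibbsLaw σ (fun _ => 1) (fun _ => 0) (fun _ => θ) N (Φ N) {z | δ < ∫ x, (rhoB φ N z x - 1) ^ 2}) atTop (𝓝 0) :=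
  Summit.AtomisticToContinuum.HydrodynamicLimit.Theorems.HemisphereAffineSlaving.stub_blockDensityLLNConst

/-- STUB [CL-v] `stub_blockVelocityLLNConst` (mesoscopic block momentum/energy LLN at constant profiles) — LANDED p135595 (module `…BlockVelocityLLNConst`); CLOSED BY NAME; full docstring in the module. -/
theorem stub_blockVelocityLLNConst : ∀ σ : ℝ, 0 < σ → σ ≤ 1 / 2 → ∀ θ : ℝ, 0 < θ → ∀ (Φ : Flows σ) (γ C : ℝ) (φ : ℕ → T3 → ℝ), 0 < γ → γ ≤ 1 / 15 → AdmissibleKernel γ C φ → ∀ δ : ℝ, 0 < δ → Tendsto (fun N : ℕ => Literature.MathematicalPhysics.KineticTheory.localGibbsLaw σ (fun _ => 1) (fun _ => 0) (fun _ => θ) N (Φ N) {z | δ < ∫ x, (‖mB φ N z x‖ ^ 2 + (EB φ N z x - 3 / 2 * θ * rhoB φ N z x) ^ 2)}) atTop (𝓝 0) :=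
  Summit.AtomisticToContinuum.HydrodynamicLimit.Theorems.HemisphereAffineSlaving.stub_blockVelocityLLNConst

/-- STUB [CL-asm] `stub_constLLN_of_parts` (NEW in v14; PROVABLE glue). At fixed `(σ, θ, Φ, φ)` with continuous kernels: the density
LLN `G_N{δ < ∫ₓ(ρ̄ − 1)²} → 0` and the velocity LLN `G_N{δ < ∫ₓ ‖m̄‖² + (Ē − (3θ/2)ρ̄)²} → 0` (for all `δ > 0`) give the item's
form `G_N{δ < ∫ₓ (ρ̄ − 1)² + ‖m̄‖² + (Ē − 3θ/2)²} → 0`: pathwise `(Ē − 3θ/2)² ≤ 2(Ē − (3θ/2)ρ̄)² + (9θ²/2)(ρ̄ − 1)²`, so the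
integrand is `≤ (1 + 9θ²/2)(ρ̄ − 1)² + 2[‖m̄‖² + (Ē − (3θ/2)ρ̄)²]` (all fields continuous in `x` on the compact torus, hence
integrable: `continuous_integrand`-type lemmas of `…MesoscopicLLNConst` / `…BlockFields`), `integral_mono`, union bound at levels
`δ/2`. -/
theorem stub_constLLN_of_parts : ∀ (σ θ : ℝ) (Φ : Flows σ) (φ : ℕ → T3 → ℝ), (∀ N, Continuous (φ N)) → (∀ δ : ℝ, 0 < δ → Tendsto (fun N : ℕ => Literature.MathematicalPhysics.KineticTheory.localGibbsLaw σ (fun _ => 1) (fun _ => 0) (fun _ => θ) N (Φ N) {z | δ < ∫ x, (rhoB φ N z x - 1) ^ 2}) atTop (𝓝 0)) → (∀ δ : ℝ, 0 < δ → Tendsto (fun N : ℕ => Literature.MathematicalPhysics.KineticTheory.localGibbsLaw σ (fun _ => 1) (fun _ => 0) (fun _ => θ) N (Φ N) {z | δ < ∫ x, (‖mB φ N z x‖ ^ 2 + (EB φ N z x - 3 / 2 * θ * rhoB φ N z x) ^ 2)}) atTop (𝓝 0)) → ∀ δ : ℝ, 0 < δ → Tendsto (fun N : ℕ => Literature.MathematicalPhysics.KineticTheory.localGibbsLaw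 σ (fun _ => 1) (fun _ => 0) (fun _ => θ) N (Φ N) {z | δ < ∫ x, ((rhoB φ N z x - 1) ^ 2 + ‖mB φ N z x‖ ^ 2 + (EB φ N z x - 3 / 2 * θ) ^ 2)}) atTop (𝓝 0) :=
  Summit.AtomisticToContinuum.HydrodynamicLimit.Theorems.HemisphereAffineSlaving.stub_constLLN_of_parts

/-- STUB [R0c] `stub_rhsSup_of_constLLN` (NEW in v14; PROVABLE re-threading of the LANDED [R0] p127021). The Rhs side of the
equilibrium rung from the CONSTANT-PROFILE mesoscopic LLN (the conclusion of `mesoscopicLLN_const`, limit `ρ₀ ≡ 1` identified) in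
place of the route item `MesoscopicLLN`: the landed proof of `rhs_sup_tendsto_zero_const` (module `…RhsSupConst`) uses its hypothesis
`hMeso` in exactly one line, `obtain ⟨σL, hσL, HL⟩ := mesoscopicLLN_const hMeso θ hθ` — replace it by the hypothesis. -/
theorem stub_rhsSup_of_constLLN : (∀ θ : ℝ, 0 < θ → ∃ σ₀ : ℝ, 0 < σ₀ ∧ ∀ σ : ℝ, 0 < σ → σ < σ₀ → ∀ Φ : Flows σ, (∀ N, IsProbabilityMeasure (Literature.MathematicalPhysics.KineticTheory.localGibbsLaw σ (fun _ => 1) (fun _ => 0) (fun _ => θ) N (Φ N))) ∧ ∀ (γ C : ℝ) (φ : ℕ → T3 → ℝ), 0 < γ → γ ≤ 1 / 15 → AdmissibleKernel γ C φ → ∀ δ : ℝ, 0 < δ → Tendsto (fun N : ℕ => Literature.MathematicalPhysics.KineticTheory.localGibbsLaw σ (fun _ => 1) (fun _ => 0) (fun _ => θ) N (Φ N) {z | δ < ∫ x, ((rhoB φ N z x - 1) ^ 2 + ‖mB φ N z x‖ ^ 2 + (EB φ N z x - 3 / 2 * θ) ^ 2)}) atTop (𝓝 0)) → ∀ θ :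 ℝ, 0 < θ → ∃ σ₀ : ℝ, 0 < σ₀ ∧ ∀ σ : ℝ, 0 < σ → σ < σ₀ → ∀ (Φ : Flows σ) (t : ℝ), 0 < t → ∀ (γ C : ℝ) (φ : ℕ → T3 → ℝ), 0 < γ → γ ≤ 1 / 15 → AdmissibleKernel γ C φ → ∀ (ψ : ℝ → T3 → V3) (χ : ℝ → T3 → ℝ), Literature.Analysis.FunctionSpaces.Torus.IsSmoothSpaceTimeOn (Icc 0 t) ψ → Literature.Analysis.FunctionSpaces.Torus.IsSmoothSpaceTimeOn (Icc 0 t) χ → ∀ δ : ℝ, 0 < δ → Tendsto (fun N : ℕ => Literature.MathematicalPhysics.KineticTheory.localGibbsLaw σ (fun _ => 1) (fun _ => 0) (fun _ => θ) N (Φ N) {z | ∃ τ ∈ Icc 0 t, δ < |Rhs σ Φ φ ψ χ N z τ|}) atTop (𝓝 0) :=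
  Summit.AtomisticToContinuum.HydrodynamicLimit.Theorems.HemisphereAffineSlaving.stub_rhsSup_of_constLLN

/-- STUB [ERc] `stub_equilibriumSup_of_rhsSup` (NEW in v14; PROVABLE re-threading of the LANDED [ER'] p133771). The `sup_τ`
assembly of the equilibrium rung from the CONCLUSION of [R0] (`sup_τ |Rhs| → 0` at constant profiles, for every θ, small σ, every flow
family, admissible kernel and smooth tests) in place of the route item `MesoscopicLLN`: the landed proof of `stub_equilibriumSup`
(module `…EquilibriumSup`) uses `hMeso` only through `rhs_sup_tendsto_zero_const hMeso` (directly and inside its fixed-time glue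
`ccRhs_fixedTime_tendsto_zero_const`) — replace those by the hypothesis. -/
theorem stub_equilibriumSup_of_rhsSup : (∀ θ : ℝ, 0 < θ → ∃ σ₀ : ℝ, 0 < σ₀ ∧ ∀ σ : ℝ, 0 < σ → σ < σ₀ → ∀ (Φ : Flows σ) (t : ℝ), 0 < t → ∀ (γ C : ℝ) (φ : ℕ → T3 → ℝ), 0 < γ → γ ≤ 1 / 15 → AdmissibleKernel γ C φ → ∀ (ψ : ℝ → T3 → V3) (χ : ℝ → T3 → ℝ), Literature.Analysis.FunctionSpaces.Torus.IsSmoothSpaceTimeOn (Icc 0 t) ψ → Literature.Analysis.FunctionSpaces.Torus.IsSmoothSpaceTimeOn (Icc 0 t) χ → ∀ δ : ℝ, 0 < δ → Tendsto (fun N : ℕ => Literature.MathematicalPhysics.KineticTheory.localGibbsLaw σ (fun _ => 1) (fun _ => 0) (fun _ => θ) N (Φ N) {z | ∃ τ ∈ Icc 0 t, δ < |Rhs σ Φ φ ψ χ N z τ|}) atTop (𝓝 0)) → ∀ θ : ℝ, 0 < θ → ∃ σ₀ : ℝ, 0 < σ₀ ∧ ∀ σ : ℝ, 0 < σ → σ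 < σ₀ → ∀ (Φ : Flows σ) (t : ℝ), 0 < t → (∀ δ ε : ℝ, 0 < δ → 0 < ε → ∃ n : ℕ, 0 < n ∧ ∀ᶠ N : ℕ in atTop, Literature.MathematicalPhysics.KineticTheory.localGibbsLaw σ (fun _ => 1) (fun _ => 0) (fun _ => θ) N (Φ N) {z | ∃ k : ℕ, k < n ∧ δ < virialW σ Φ N z ((k + 1) * (t / n)) - virialW σ Φ N z (k * (t / n))} ≤ ENNReal.ofReal ε) → ∀ (γ C : ℝ) (φ : ℕ → T3 → ℝ), 0 < γ → γ ≤ 1 / 15 → AdmissibleKernel γ C φ → ∀ (ψ : ℝ → T3 → V3) (χ : ℝ → T3 → ℝ), Literature.Analysis.FunctionSpaces.Torus.IsSmoothSpaceTimeOn (Icc 0 t) ψ → Literature.Analysis.FunctionSpaces.Torus.IsSmoothSpaceTimeOn (Icc 0 t) χ → ∀ δ : ℝ, 0 < δ → Tendsto (fun N : ℕ => Literature.MathematicalPhysics.KineticTheory.localGibbsLaw σ (fun _ => 1) (fun _ => 0) (fun _ => θ) N (Φ N) {z | ∃ τ ∈ Icc 0 t, δ < |Cc σ Φ ψ χ N z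 τ - Rhs σ Φ φ ψ χ N z τ|}) atTop (𝓝 0) :=
  Summit.AtomisticToContinuum.HydrodynamicLimit.Theorems.HemisphereAffineSlaving.stub_equilibriumSup_of_rhsSup

end Holds

/-! ## Stub statements by name (the hypotheses of the compositions are these `Prop`s) -/

/-- Statement of registered stub [Kσ] `Holds.stub_collisionalStressLaw`, by name. -/
def stub_collisionalStressLaw : Prop := CollisionalStressLaw
/-- Statement of registered stub [Kq] `Holds.stub_collisionalEnergyFluxLaw`, by name. -/
def stub_collisionalEnergyFluxLaw : Prop := type_of% Holds.stub_collisionalEnergyFluxLaw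
/-- Statement of registered stub [KqR] `Holds.stub_energyFluxLawCone` (v20), by name. -/
def stub_energyFluxLawCone : Prop := type_of% Holds.stub_energyFluxLawCone
/-- Statement of registered stub [TSχ] `Holds.stub_twoScaleValueChi` (v20), by name. -/
def stub_twoScaleValueChi : Prop := type_of% Holds.stub_twoScaleValueChi
/-- Statement of registered stub [S'] `Holds.stub_ceilingAllTimes`, by name. -/
def stub_ceilingAllTimes : Prop := type_of% Holds.stub_ceilingAllTimes
/-- [VL] THE FIXED-TIME VIRIAL LAW OF LARGE NUMBERS AT EQUILIBRIUM (seat c6's fallback input of the equilibrium rung; DEMOTED in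
v12 from a registered stub to a plain hypothesis `Prop`: it needs the same decorrelation plateau as the `EvenStressEnskog` route of
composition 3′, which supersedes it). For every `θ > 0` there is `σ₀ > 0` such that under the homogeneous local Gibbs law at
`0 < σ < σ₀`, for every flow family and `t > 0` there is `Λ` continuous on `[0, t]` with `V_N(τ) → Λ(τ)` in probability at each
fixed `τ ∈ [0, t]`. -/
def VirialLLNConst : Prop :=
  ∀ θ : ℝ, 0 < θ → ∃ σ₀ : ℝ, 0 < σ₀ ∧ ∀ σ : ℝ, 0 < σ → σ < σ₀ → ∀ (Φ : Flows σ) (t : ℝ), 0 < t → ∃ Λ : ℝ → ℝ, ContinuousOn Λ (Icc 0 t) ∧ ∀ τ ∈ Icc 0 t, ∀ δ : ℝ, 0 < δ → Tendsto (fun N : ℕ => Literature.MathematicalPhysics.KineticTheory.localGibbsLaw σ (fun _ => 1) (fun _ => 0) (fun _ => θ) N (Φ N) {z | δ < |virialW σ Φ N z τ - Λ τ|}) atTop (𝓝 0)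


/-! ## Sorry-free glue -/

/-- The zero scalar test is space–time smooth. [folklore] -/
theorem isSmoothSpaceTimeOn_zero_scalar (S : Set ℝ) :
    Literature.Analysis.FunctionSpaces.Torus.IsSmoothSpaceTimeOn S (fun (_ : ℝ) (_ : T3) => (0 : ℝ)) :=
  Literature.Analysis.FunctionSpaces.Torus.isSmoothSpaceTimeOn_const
    (Literature.Analysis.FunctionSpaces.Torus.isSmooth_const (0 : ℝ)) S

/-- The zero vector test is space–time smooth. [folklore] -/
theorem isSmoothSpaceTimeOn_zero_vector (S : Set ℝ) :
    Literature.Analysis.FunctionSpaces.Torus.IsSmoothSpaceTimeOn S (fun (_ : ℝ) (_ : T3) => (0 : V3)) :=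
  Literature.Analysis.FunctionSpaces.Torus.isSmoothSpaceTimeOn_const
    (Literature.Analysis.FunctionSpaces.Torus.isSmooth_const (0 : V3)) S

/-- [B-stat] in the DefsB vocabulary: `stub_pressureEquation` IS `∃ η₀ > 0, StaticShell ZPi η₀` (`ZPi η = 6(Z(η) − 1)`). -/
theorem staticShell_ZPi : ∃ η₀ : ℝ, 0 < η₀ ∧ StaticShell ZPi η₀ := by
  obtain ⟨η₀, hη₀, H⟩ := Holds.stub_pressureEquation
  refine ⟨η₀, hη₀, ?_⟩
  intro σ hσ hσ3 θ hθ e he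
  obtain ⟨h₀, hh₀, Hh⟩ := H σ hσ hσ3 θ hθ e he
  refine ⟨h₀, hh₀, fun h hh hhh => ?_⟩
  obtain ⟨N₀, HN⟩ := Hh h hh hhh
  exact ⟨N₀, fun N hN Φ => by simpa only [ZPi] using HN N hN Φ⟩

/-- The dilute event is monotone in the level: a lower ceiling is a smaller event. [folklore] -/
theorem DiluteAt.mono {σ : ℝ} {a₀ θ₀ : T3 → ℝ} {u₀ : T3 → V3} {Φ : Flows σ} {t : ℝ} {φ : ℕ → T3 → ℝ} {η η' : ℝ}
    (hle : η ≤ η') (h : DiluteAt σ a₀ θ₀ u₀ Φ t φ η) : DiluteAt σ a₀ θ₀ u₀ Φ t φ η' := by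
  refine tendsto_of_tendsto_of_tendsto_of_le_of_le tendsto_const_nhds h (fun N => bot_le)
    (fun N => measure_mono ?_)
  rintro z ⟨s, hs, x, hx⟩
  exact ⟨s, hs, x, hle.trans_lt hx⟩

/-- One step of both compositions (v10): at fixed `(σ, profiles, Φ)` with `0 < σ ≤ 1/2`, a kernel family, a horizon
`t > 0`, smooth tests, [V], [M] at the collisional pressure and [C] at this `(kernel, t, ψ, χ)`, the crux's conclusion at
this `(kernel, t, ψ, χ)` holds — [S1] (landed `stub_balanceIdentity`) and the LANDED reduction `stub_markedReduction` (p120490). -/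
theorem conclusion_step' {σ : ℝ} (hσ : 0 < σ) (hhalf : σ ≤ 1 / 2) (a₀ θ₀ : T3 → ℝ)
    (u₀ : T3 → V3) (Φ : Flows σ) (φ : ℕ → T3 → ℝ) {t : ℝ} (ht : 0 < t)
    {ψ : ℝ → T3 → V3} {χ : ℝ → T3 → ℝ}
    (hψ : Literature.Analysis.FunctionSpaces.Torus.IsSmoothSpaceTimeOn (Icc 0 t) ψ)
    (hχ : Literature.Analysis.FunctionSpaces.Torus.IsSmoothSpaceTimeOn (Icc 0 t) χ)
    (hV : VirialBounded σ a₀ θ₀ u₀ Φ t)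
    (hM : ∀ δ : ℝ, 0 < δ → Tendsto (fun N : ℕ =>
      Literature.MathematicalPhysics.KineticTheory.localGibbsLaw σ a₀ u₀ θ₀ N (Φ N)
        {z | ∃ τ ∈ Icc 0 t, δ < |Mfun σ Φ ψ χ N z τ - (Rhs σ Φ φ ψ χ N z τ + Kfun σ Φ φ ψ χ N z τ)|})
          atTop (𝓝 0))
    (hC : RelaxC σ a₀ θ₀ u₀ Φ φ t ψ χ) :
    ∀ δ : ℝ, 0 < δ → Tendsto (fun N : ℕ =>
      Literature.MathematicalPhysics.KineticTheory.localGibbsLaw σ a₀ u₀ θ₀ N (Φ N)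
        {z | ∃ τ ∈ Icc 0 t, δ < |Cc σ Φ ψ χ N z τ - Rhs σ Φ φ ψ χ N z τ|}) atTop (𝓝 0) :=
  Holds.stub_markedReduction σ hσ hhalf a₀ θ₀ u₀ Φ (stub_balanceIdentity σ hσ hhalf Φ) φ ht hψ hχ hV hM hC

/-- **One step of the v16 compositions, by channel.** At fixed `(σ, profiles, Φ)` with `0 < σ ≤ 1/2`, the linear
`Z`-bound, a dilute level `η₁ ≤ η_Z` with the dilute event, continuous nonnegative kernels, a horizon `t > 0`, smooth tests,
[V], [M] at the collisional pressure in EACH channel (`(ψ, 0)` and `(0, χ)`) and [C] in each channel: the crux's conclusion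
at `(ψ, χ)` — two calls of `conclusion_step'` (landed `stub_markedReduction` + [S1]) and the glue [G2]. -/
theorem conclusion_of_channels {σ : ℝ} (hσ : 0 < σ) (hhalf : σ ≤ 1 / 2) {ηZ K : ℝ} (hηZ : 0 < ηZ) (hK : 0 ≤ K)
    (hZK : ∀ η : ℝ, 0 ≤ η → η ≤ ηZ → |Literature.MathematicalPhysics.KineticTheory.hsCompressibility η - 1| ≤ K * η)
    {η₁ : ℝ} (hη₁0 : 0 < η₁) (hη₁Z : η₁ ≤ ηZ) (a₀ θ₀ : T3 → ℝ) (u₀ : T3 → V3) (Φ : Flows σ)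
    (φ : ℕ → T3 → ℝ) {t : ℝ} (ht : 0 < t) (hφc : ∀ N, Continuous (φ N)) (hφ0 : ∀ N y, 0 ≤ φ N y)
    (hDil : DiluteAt σ a₀ θ₀ u₀ Φ t φ η₁) {ψ : ℝ → T3 → V3} {χ : ℝ → T3 → ℝ}
    (hψ : Literature.Analysis.FunctionSpaces.Torus.IsSmoothSpaceTimeOn (Icc 0 t) ψ)
    (hχ : Literature.Analysis.FunctionSpaces.Torus.IsSmoothSpaceTimeOn (Icc 0 t) χ)
    (hV : VirialBounded σ a₀ θ₀ u₀ Φ t)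
    (hMψ : ∀ δ : ℝ, 0 < δ → Tendsto (fun N : ℕ =>
      Literature.MathematicalPhysics.KineticTheory.localGibbsLaw σ a₀ u₀ θ₀ N (Φ N)
        {z | ∃ τ ∈ Icc 0 t, δ < |Mfun σ Φ ψ (fun (_ : ℝ) (_ : T3) => (0 : ℝ)) N z τ -
          (Rhs σ Φ φ ψ (fun (_ : ℝ) (_ : T3) => (0 : ℝ)) N z τ + Kfun σ Φ φ ψ (fun (_ : ℝ) (_ : T3) => (0 : ℝ)) N z τ)|}) atTop (𝓝 0))
    (hMχ : ∀ δ : ℝ, 0 < δ → Tendsto (fun N : ℕ =>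
      Literature.MathematicalPhysics.KineticTheory.localGibbsLaw σ a₀ u₀ θ₀ N (Φ N)
        {z | ∃ τ ∈ Icc 0 t, δ < |Mfun σ Φ (fun (_ : ℝ) (_ : T3) => (0 : V3)) χ N z τ -
          (Rhs σ Φ φ (fun (_ : ℝ) (_ : T3) => (0 : V3)) χ N z τ + Kfun σ Φ φ (fun (_ : ℝ) (_ : T3) => (0 : V3)) χ N z τ)|}) atTop (𝓝 0))
    (hCψ : RelaxC σ a₀ θ₀ u₀ Φ φ t ψ (fun (_ : ℝ) (_ : T3) => (0 : ℝ))) (hCχ : RelaxC σ a₀ θ₀ u₀ Φ φ t (fun (_ : ℝ) (_ : T3) => (0 : V3)) χ) :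
    ∀ δ : ℝ, 0 < δ → Tendsto (fun N : ℕ =>
      Literature.MathematicalPhysics.KineticTheory.localGibbsLaw σ a₀ u₀ θ₀ N (Φ N)
        {z | ∃ τ ∈ Icc 0 t, δ < |Cc σ Φ ψ χ N z τ - Rhs σ Φ φ ψ χ N z τ|}) atTop (𝓝 0) :=
  (Holds.stub_channelAdditivity σ hσ hhalf ηZ K hηZ hK hZK η₁ hη₁0 hη₁Z a₀ θ₀ u₀ Φ φ t ht hφc hφ0 hDil ψ χ hψ hχ
    (conclusion_step' hσ hhalf a₀ θ₀ u₀ Φ φ ht hψ (isSmoothSpaceTimeOn_zero_scalar _) hV hMψ hCψ)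
    (conclusion_step' hσ hhalf a₀ θ₀ u₀ Φ φ ht (isSmoothSpaceTimeOn_zero_vector _) hχ hV hMχ hCχ))

/-- The dilute level of both compositions: `η₁ := min (η₀/2) η_Z` is positive, below the statics radius `η₀` and below
the linearity radius `η_Z`. [folklore] -/
theorem diluteLevel_props {η₀ ηZ : ℝ} (hη₀ : 0 < η₀) (hηZ : 0 < ηZ) :
    0 < min (η₀ / 2) ηZ ∧ min (η₀ / 2) ηZ < η₀ ∧ min (η₀ / 2) ηZ ≤ ηZ :=
  ⟨lt_min (half_pos hη₀) hηZ, (min_le_left _ _).trans_lt (half_lt_self hη₀), min_le_right _ _⟩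

/-! ## Composition 1 (sorry-free, v17): the FILED `∀ t > 0` crux BY NAME — 9522 + 15144 + [Kσ] + [Kq] + [G2] + [S'] -/

/-- **The skeleton theorem for the filed statement (v20).** From the Stiff route's `∀ t` kinetic hinge 9522 (`FastMomentRelaxation`),
the collision-moment tightness item 15144 (`InformationPercolationEngine.CollisionMomentBound`, which gives [V]) and the sibling crux 13079
(`JParityClosure.EvenStressEnskog`, inside `stub_collisionalStressLaw_of_evenStress` together with the research stub [TS]) BY NAME, the v20 research
stubs [KqR] `stub_energyFluxLawCone` (cone-scale energy law) and [TSχ] `stub_twoScaleValueChi` (two-scale regularity of the energy value) through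
the provable glue [GKq] `Holds.stub_collisionalEnergyFluxLaw_of_cone`, the glue [G2], the landed reduction (`conclusion_of_channels`), the landed
stubs [C]°, [E], [Z], and the one `∀ t` a-priori stub [S'] at the dilute level `η⋆ := min η_Z (min η_ψ η_χ)`. Body verbatim v17–v19.4's, with
[Kq] obtained from the glue. The conclusion at `(σ, profiles, Φ)` is definitionally the crux's `let`-telescope (`conclusionAtFlow_iff`). -/
theorem CollisionalTransferLocality_of
    (hF : Summit.AtomisticToContinuum.HydrodynamicLimit.Theses.StiffCollisionalRelaxation.FastMomentRelaxation)
    (hM : Summit.AtomisticToContinuum.HydrodynamicLimit.Theses.InformationPercolationEngine.CollisionMomentBound)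
    (h79 : Summit.AtomisticToContinuum.HydrodynamicLimit.Theses.JParityClosure.EvenStressEnskog)
    (hKqR : stub_energyFluxLawCone) (hTSχ : stub_twoScaleValueChi) (hS : stub_ceilingAllTimes) :
    Summit.AtomisticToContinuum.HydrodynamicLimit.Theses.StiffCollisionalRelaxation.CollisionalTransferLocality := by
  intro a₀ θ₀ u₀ ha hθ hu ha0 hθ0
  have hP : NiceProfiles a₀ θ₀ u₀ := ⟨ha, hθ, hu, ha0, hθ0⟩
  obtain ⟨ηZ, hηZ, K, hK0, hZK⟩ := Holds.stub_hsCompressibility_linear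
  obtain ⟨σF, hσF, HF⟩ := hF a₀ θ₀ u₀ ha hθ hu ha0 hθ0
  obtain ⟨σV, hσV, HV⟩ := virialBounded_of_collisionMomentBound hM a₀ θ₀ u₀ hP
  obtain ⟨σBψ, hσBψ, ηψ, hηψ, HBψ⟩ := Holds.stub_collisionalStressLaw_of_evenStress h79 a₀ θ₀ u₀ hP
  obtain ⟨σBχ, hσBχ, ηχ, hηχ, HBχ⟩ := (Holds.stub_collisionalEnergyFluxLaw_of_cone hKqR hTSχ) a₀ θ₀ u₀ hP
  set ηs : ℝ := min ηZ (min ηψ ηχ) with hηs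
  have hηs0 : 0 < ηs := lt_min hηZ (lt_min hηψ hηχ)
  have hηsZ : ηs ≤ ηZ := min_le_left _ _
  have hηsψ : ηs ≤ ηψ := (min_le_right _ _).trans (min_le_left _ _)
  have hηsχ : ηs ≤ ηχ := (min_le_right _ _).trans (min_le_right _ _)
  obtain ⟨σS, hσS, HS⟩ := (hS : type_of% Holds.stub_ceilingAllTimes) ηs hηs0 a₀ θ₀ u₀ hP
  have HC := Holds.stub_weightedKineticRelaxationDilute ηZ K hηZ hK0 hZK ηs hηs0 hηsZ
  have HE := Holds.stub_energyAllTimes a₀ θ₀ u₀ hP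
  refine ⟨min (min σF σV) (min (min σBψ σBχ) (min σS (1 / 2))), ?_, ?_⟩
  · exact lt_min (lt_min hσF hσV) (lt_min (lt_min hσBψ hσBχ) (lt_min hσS (by norm_num)))
  intro σ hσ hlt
  have hltF : σ < σF := lt_of_lt_of_le hlt ((min_le_left _ _).trans (min_le_left _ _))
  have hltV : σ < σV := lt_of_lt_of_le hlt ((min_le_left _ _).trans (min_le_right _ _))
  have hltBψ : σ < σBψ := lt_of_lt_of_le hlt
    ((min_le_right _ _).trans ((min_le_left _ _).trans (min_le_left _ _)))
  have hltBχ : σ < σBχ := lt_of_lt_of_le hlt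
    ((min_le_right _ _).trans ((min_le_left _ _).trans (min_le_right _ _)))
  have hltS : σ < σS := lt_of_lt_of_le hlt
    ((min_le_right _ _).trans ((min_le_right _ _).trans (min_le_left _ _)))
  have hhalf : σ ≤ 1 / 2 :=
    (lt_of_lt_of_le hlt ((min_le_right _ _).trans ((min_le_right _ _).trans (min_le_right _ _)))).le
  intro Φ
  obtain ⟨E₀, -, HEt⟩ := HE σ hσ hhalf Φ
  show ConclusionAtFlow σ a₀ θ₀ u₀ Φ
  rw [conclusionAtFlow_iff]
  intro γ C φ hγ hγ' hadm t ht ψ χ hψ hχ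
  have hEner := HEt t
  have hDil : DiluteAt σ a₀ θ₀ u₀ Φ t φ ηs := HS σ hσ hltS Φ t ht γ C φ hγ hγ' hadm
  have hVir : VirialBounded σ a₀ θ₀ u₀ Φ t := HV σ hσ hltV Φ t ht
  have hφc : ∀ N, Continuous (φ N) := fun N => (hadm.1 N).continuous
  have hφ0 : ∀ N y, 0 ≤ φ N y := hadm.2.1
  have hFloc : ∀ δ : ℝ, 0 < δ → Tendsto (fun N : ℕ =>
      Literature.MathematicalPhysics.KineticTheory.localGibbsLaw σ a₀ u₀ θ₀ N (Φ N)
        {z | δ < ∫ s in Icc 0 t, ∫ x, ((∑ j, ∑ k, Dst φ N ((Φ N).flow s z) x j k ^ 2) +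
          ‖qfl φ N ((Φ N).flow s z) x‖ ^ 2)}) atTop (𝓝 0) :=
    fun δ hδ => HF σ hσ hltF Φ γ C φ hγ hγ' hadm t ht δ hδ
  have h0χ := isSmoothSpaceTimeOn_zero_scalar (Icc 0 t)
  have h0ψ := isSmoothSpaceTimeOn_zero_vector (Icc 0 t)
  exact conclusion_of_channels hσ hhalf hηZ hK0 hZK hηs0 hηsZ a₀ θ₀ u₀ Φ φ ht hφc hφ0 hDil hψ hχ hVir
    (HBψ σ hσ hltBψ Φ t ht hVir γ C φ hγ hγ' hadm (hDil.mono hηsψ) ψ hψ)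
    (HBχ σ hσ hltBχ Φ t ht hVir γ C φ hγ hγ' hadm (hDil.mono hηsχ) χ hχ)
    (HC σ hσ a₀ θ₀ u₀ Φ t E₀ ht hEner γ C φ hγ hγ' hadm hDil hFloc ψ _ hψ h0χ)
    (HC σ hσ a₀ θ₀ u₀ Φ t E₀ ht hEner γ C φ hγ hγ' hadm hDil hFloc _ χ h0ψ hχ)

/-- **The v17–v19.4 skeleton theorem, kept as a certificate (`_of_Kq`)**: the same composition from the MESOSCALE energy law [Kq]
`stub_collisionalEnergyFluxLaw` as a hypothesis (in v20 [Kq] is derived from [KqR] ∧ [TSχ]; this form records that nothing else changed). -/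
theorem CollisionalTransferLocality_of_Kq
    (hF : Summit.AtomisticToContinuum.HydrodynamicLimit.Theses.StiffCollisionalRelaxation.FastMomentRelaxation)
    (hM : Summit.AtomisticToContinuum.HydrodynamicLimit.Theses.InformationPercolationEngine.CollisionMomentBound)
    (h79 : Summit.AtomisticToContinuum.HydrodynamicLimit.Theses.JParityClosure.EvenStressEnskog)
    (hKq : stub_collisionalEnergyFluxLaw) (hS : stub_ceilingAllTimes) :
    Summit.AtomisticToContinuum.HydrodynamicLimit.Theses.StiffCollisionalRelaxation.CollisionalTransferLocality := by
  intro a₀ θ₀ u₀ ha hθ hu ha0 hθ0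
  have hP : NiceProfiles a₀ θ₀ u₀ := ⟨ha, hθ, hu, ha0, hθ0⟩
  obtain ⟨ηZ, hηZ, K, hK0, hZK⟩ := Holds.stub_hsCompressibility_linear
  obtain ⟨σF, hσF, HF⟩ := hF a₀ θ₀ u₀ ha hθ hu ha0 hθ0
  obtain ⟨σV, hσV, HV⟩ := virialBounded_of_collisionMomentBound hM a₀ θ₀ u₀ hP
  obtain ⟨σBψ, hσBψ, ηψ, hηψ, HBψ⟩ := Holds.stub_collisionalStressLaw_of_evenStress h79 a₀ θ₀ u₀ hP
  obtain ⟨σBχ, hσBχ, ηχ, hηχ, HBχ⟩ := (hKq : type_of% Holds.stub_collisionalEnergyFluxLaw) a₀ θ₀ u₀ hP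
  set ηs : ℝ := min ηZ (min ηψ ηχ) with hηs
  have hηs0 : 0 < ηs := lt_min hηZ (lt_min hηψ hηχ)
  have hηsZ : ηs ≤ ηZ := min_le_left _ _
  have hηsψ : ηs ≤ ηψ := (min_le_right _ _).trans (min_le_left _ _)
  have hηsχ : ηs ≤ ηχ := (min_le_right _ _).trans (min_le_right _ _)
  obtain ⟨σS, hσS, HS⟩ := (hS : type_of% Holds.stub_ceilingAllTimes) ηs hηs0 a₀ θ₀ u₀ hP
  have HC := Holds.stub_weightedKineticRelaxationDilute ηZ K hηZ hK0 hZK ηs hηs0 hηsZ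
  have HE := Holds.stub_energyAllTimes a₀ θ₀ u₀ hP
  refine ⟨min (min σF σV) (min (min σBψ σBχ) (min σS (1 / 2))), ?_, ?_⟩
  · exact lt_min (lt_min hσF hσV) (lt_min (lt_min hσBψ hσBχ) (lt_min hσS (by norm_num)))
  intro σ hσ hlt
  have hltF : σ < σF := lt_of_lt_of_le hlt ((min_le_left _ _).trans (min_le_left _ _))
  have hltV : σ < σV := lt_of_lt_of_le hlt ((min_le_left _ _).trans (min_le_right _ _))
  have hltBψ : σ < σBψ := lt_of_lt_of_le hlt
    ((min_le_right _ _).trans ((min_le_left _ _).trans (min_le_left _ _)))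
  have hltBχ : σ < σBχ := lt_of_lt_of_le hlt
    ((min_le_right _ _).trans ((min_le_left _ _).trans (min_le_right _ _)))
  have hltS : σ < σS := lt_of_lt_of_le hlt
    ((min_le_right _ _).trans ((min_le_right _ _).trans (min_le_left _ _)))
  have hhalf : σ ≤ 1 / 2 :=
    (lt_of_lt_of_le hlt ((min_le_right _ _).trans ((min_le_right _ _).trans (min_le_right _ _)))).le
  intro Φ
  obtain ⟨E₀, -, HEt⟩ := HE σ hσ hhalf Φ
  show ConclusionAtFlow σ a₀ θ₀ u₀ Φ
  rw [conclusionAtFlow_iff]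
  intro γ C φ hγ hγ' hadm t ht ψ χ hψ hχ
  have hEner := HEt t
  have hDil : DiluteAt σ a₀ θ₀ u₀ Φ t φ ηs := HS σ hσ hltS Φ t ht γ C φ hγ hγ' hadm
  have hVir : VirialBounded σ a₀ θ₀ u₀ Φ t := HV σ hσ hltV Φ t ht
  have hφc : ∀ N, Continuous (φ N) := fun N => (hadm.1 N).continuous
  have hφ0 : ∀ N y, 0 ≤ φ N y := hadm.2.1
  have hFloc : ∀ δ : ℝ, 0 < δ → Tendsto (fun N : ℕ =>
      Literature.MathematicalPhysics.KineticTheory.localGibbsLaw σ a₀ u₀ θ₀ N (Φ N)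
        {z | δ < ∫ s in Icc 0 t, ∫ x, ((∑ j, ∑ k, Dst φ N ((Φ N).flow s z) x j k ^ 2) +
          ‖qfl φ N ((Φ N).flow s z) x‖ ^ 2)}) atTop (𝓝 0) :=
    fun δ hδ => HF σ hσ hltF Φ γ C φ hγ hγ' hadm t ht δ hδ
  have h0χ := isSmoothSpaceTimeOn_zero_scalar (Icc 0 t)
  have h0ψ := isSmoothSpaceTimeOn_zero_vector (Icc 0 t)
  exact conclusion_of_channels hσ hhalf hηZ hK0 hZK hηs0 hηsZ a₀ θ₀ u₀ Φ φ ht hφc hφ0 hDil hψ hχ hVir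
    (HBψ σ hσ hltBψ Φ t ht hVir γ C φ hγ hγ' hadm (hDil.mono hηsψ) ψ hψ)
    (HBχ σ hσ hltBχ Φ t ht hVir γ C φ hγ hγ' hadm (hDil.mono hηsχ) χ hχ)
    (HC σ hσ a₀ θ₀ u₀ Φ t E₀ ht hEner γ C φ hγ hγ' hadm hDil hFloc ψ _ hψ h0χ)
    (HC σ hσ a₀ θ₀ u₀ Φ t E₀ ht hEner γ C φ hγ hγ' hadm hDil hFloc _ χ h0ψ hχ)

/-- **The CIC copy** of the filed crux (the two route decls are `rfl`-equal; the CIC route dropped its own copy of 9522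
in rev 9–12, so the shared Stiff item feeds it). -/
theorem CollisionalTransferLocality_of_cic
    (hF : Summit.AtomisticToContinuum.HydrodynamicLimit.Theses.StiffCollisionalRelaxation.FastMomentRelaxation)
    (hM : Summit.AtomisticToContinuum.HydrodynamicLimit.Theses.InformationPercolationEngine.CollisionMomentBound)
    (h79 : Summit.AtomisticToContinuum.HydrodynamicLimit.Theses.JParityClosure.EvenStressEnskog)
    (hKqR : stub_energyFluxLawCone) (hTSχ : stub_twoScaleValueChi) (hS : stub_ceilingAllTimes) :
    Summit.AtomisticToContinuum.HydrodynamicLimit.Theses.CollisionIsometryCLT.CollisionalTransferLocality :=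
  CollisionalTransferLocality_of hF hM h79 hKqR hTSχ hS

/-! ## Composition 2 (sorry-free): the PRE-SHOCK form from 9522 + 15144 + 9201 by name — no `∀ t` stub at all -/

/-- **The skeleton theorem for the pre-shock restatement (v10).** From the Stiff route's `∀ t` kinetic hinge 9522, the
collision-moment tightness 15144 (⇒ [V]) and the kinetic range control 9201 (⇒ [D], `stub_diluteBlocks_of_kineticRangeControl`)
BY NAME, the engine stubs [Kσ], [Kq] (v17; v16: [M-ψ]°, [M-χ]°; v10–v15: [M]°), the glue [G2], the landed reduction `stub_markedReduction`, the landed stubs [C]°, [E], [Z]: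
`CollisionalTransferLocalityPreShock` with the dilute level `η⋆ := min (min η_Z ηbar) (min η_ψ η_χ)` (`ηbar` from [D], `η_ψ, η_χ` from [Kσ], [Kq]) as the
chamber level and `σ₀ := min (σ_9522, σ_15144, σ_[Kσ], σ_[Kq], σ_[D], 1/2)`. NO `∀ t` stub, NO statics. -/
theorem collisionalTransferLocalityPreShock_of_Kq
    (hF : Summit.AtomisticToContinuum.HydrodynamicLimit.Theses.StiffCollisionalRelaxation.FastMomentRelaxation)
    (hM : Summit.AtomisticToContinuum.HydrodynamicLimit.Theses.InformationPercolationEngine.CollisionMomentBound)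
    (h79 : Summit.AtomisticToContinuum.HydrodynamicLimit.Theses.JParityClosure.EvenStressEnskog)
    (hKq : stub_collisionalEnergyFluxLaw)
    (hK : Summit.AtomisticToContinuum.HydrodynamicLimit.Theses.GermanoSplitLES.KineticRangeControl) :
    CollisionalTransferLocalityPreShock := by
  intro a₀ θ₀ u₀ ha hθ hu ha0 hθ0
  have hP : NiceProfiles a₀ θ₀ u₀ := ⟨ha, hθ, hu, ha0, hθ0⟩
  obtain ⟨ηZ, hηZ, K, hK0, hZK⟩ := Holds.stub_hsCompressibility_linear
  obtain ⟨ηbar, hηbar, HD0⟩ := stub_diluteBlocks_of_kineticRangeControl hK a₀ θ₀ u₀ hP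
  obtain ⟨σBψ, hσBψ, ηψ, hηψ, HBψ⟩ := Holds.stub_collisionalStressLaw_of_evenStress h79 a₀ θ₀ u₀ hP
  obtain ⟨σBχ, hσBχ, ηχ, hηχ, HBχ⟩ := (hKq : type_of% Holds.stub_collisionalEnergyFluxLaw) a₀ θ₀ u₀ hP
  set ηs : ℝ := min (min ηZ ηbar) (min ηψ ηχ) with hηs
  have hηs0 : 0 < ηs := lt_min (lt_min hηZ hηbar) (lt_min hηψ hηχ)
  have hηsZ : ηs ≤ ηZ := (min_le_left _ _).trans (min_le_left _ _)
  have hηs2 : ηs ≤ ηbar := (min_le_left _ _).trans (min_le_right _ _)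
  have hηsψ : ηs ≤ ηψ := (min_le_right _ _).trans (min_le_left _ _)
  have hηsχ : ηs ≤ ηχ := (min_le_right _ _).trans (min_le_right _ _)
  obtain ⟨σF, hσF, HF⟩ := hF a₀ θ₀ u₀ ha hθ hu ha0 hθ0
  obtain ⟨σV, hσV, HV⟩ := virialBounded_of_collisionMomentBound hM a₀ θ₀ u₀ hP
  obtain ⟨σD, hσD, HD⟩ := HD0 ηs hηs0 hηs2
  have HC := Holds.stub_weightedKineticRelaxationDilute ηZ K hηZ hK0 hZK ηs hηs0 hηsZ
  have HE := Holds.stub_energyAllTimes a₀ θ₀ u₀ hP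
  refine ⟨min (min σF σV) (min (min σBψ σBχ) (min σD (1 / 2))), ?_, ηs, hηs0, ?_⟩
  · exact lt_min (lt_min hσF hσV) (lt_min (lt_min hσBψ hσBχ) (lt_min hσD (by norm_num)))
  intro σ hσ hlt T ρ θ u hsol Φ hlln γ C φ hγ hγ' hadm
  have hltF : σ < σF := lt_of_lt_of_le hlt ((min_le_left _ _).trans (min_le_left _ _))
  have hltV : σ < σV := lt_of_lt_of_le hlt ((min_le_left _ _).trans (min_le_right _ _))
  have hltBψ : σ < σBψ := lt_of_lt_of_le hlt
    ((min_le_right _ _).trans ((min_le_left _ _).trans (min_le_left _ _)))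
  have hltBχ : σ < σBχ := lt_of_lt_of_le hlt
    ((min_le_right _ _).trans ((min_le_left _ _).trans (min_le_right _ _)))
  have hltD : σ < σD := lt_of_lt_of_le hlt
    ((min_le_right _ _).trans ((min_le_right _ _).trans (min_le_left _ _)))
  have hhalf : σ ≤ 1 / 2 :=
    (lt_of_lt_of_le hlt ((min_le_right _ _).trans ((min_le_right _ _).trans (min_le_right _ _)))).le
  obtain ⟨E₀, -, HEt⟩ := HE σ hσ hhalf Φ
  intro ρb mb Eb ub θb pc t ht htT hdil ψ χ hψ hχ O Cc' δ hδ
  have hEner := HEt t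
  have hDil : DiluteAt σ a₀ θ₀ u₀ Φ t φ ηs :=
    HD σ hσ hltD T ρ θ u hsol Φ hlln t ht htT hdil γ C φ hγ hγ' hadm
  have hVir : VirialBounded σ a₀ θ₀ u₀ Φ t := HV σ hσ hltV Φ t ht
  have hFloc : ∀ δ : ℝ, 0 < δ → Tendsto (fun N : ℕ =>
      Literature.MathematicalPhysics.KineticTheory.localGibbsLaw σ a₀ u₀ θ₀ N (Φ N)
        {z | δ < ∫ s in Icc 0 t, ∫ x, ((∑ j, ∑ k, Dst φ N ((Φ N).flow s z) x j k ^ 2) +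
          ‖qfl φ N ((Φ N).flow s z) x‖ ^ 2)}) atTop (𝓝 0) :=
    fun δ hδ => HF σ hσ hltF Φ γ C φ hγ hγ' hadm t ht δ hδ
  have hφc : ∀ N, Continuous (φ N) := fun N => (hadm.1 N).continuous
  have hφ0 : ∀ N y, 0 ≤ φ N y := hadm.2.1
  have h0χ := isSmoothSpaceTimeOn_zero_scalar (Icc 0 t)
  have h0ψ := isSmoothSpaceTimeOn_zero_vector (Icc 0 t)
  exact conclusion_of_channels hσ hhalf hηZ hK0 hZK hηs0 hηsZ a₀ θ₀ u₀ Φ φ ht hφc hφ0 hDil hψ hχ hVir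
    (HBψ σ hσ hltBψ Φ t ht hVir γ C φ hγ hγ' hadm (hDil.mono hηsψ) ψ hψ)
    (HBχ σ hσ hltBχ Φ t ht hVir γ C φ hγ hγ' hadm (hDil.mono hηsχ) χ hχ)
    (HC σ hσ a₀ θ₀ u₀ Φ t E₀ ht hEner γ C φ hγ hγ' hadm hDil hFloc ψ _ hψ h0χ)
    (HC σ hσ a₀ θ₀ u₀ Φ t E₀ ht hEner γ C φ hγ hγ' hadm hDil hFloc _ χ h0ψ hχ) δ hδ

/-- **The pre-shock form from the CIC route's own pre-shock hinge** 14902 (`FastMomentRelaxationPreShock`, the time-local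
kinetic closure per `t < T` in its chamber `η₁(14902)`), the shared 15144 (⇒ [V]) and 9201 (⇒ [D]), the engine stubs [Kσ], [Kq],
the glue [G2], the landed reduction, the landed stubs [C]°, [E], [Z]: chamber level `η₁ := min η₁(14902) η⋆`. -/
theorem collisionalTransferLocalityPreShock_of_cic_Kq
    (hF : Summit.AtomisticToContinuum.HydrodynamicLimit.Theses.CollisionIsometryCLT.FastMomentRelaxationPreShock)
    (hM : Summit.AtomisticToContinuum.HydrodynamicLimit.Theses.InformationPercolationEngine.CollisionMomentBound)
    (h79 : Summit.AtomisticToContinuum.HydrodynamicLimit.Theses.JParityClosure.EvenStressEnskog)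
    (hKq : stub_collisionalEnergyFluxLaw)
    (hK : Summit.AtomisticToContinuum.HydrodynamicLimit.Theses.GermanoSplitLES.KineticRangeControl) :
    CollisionalTransferLocalityPreShock := by
  intro a₀ θ₀ u₀ ha hθ hu ha0 hθ0
  have hP : NiceProfiles a₀ θ₀ u₀ := ⟨ha, hθ, hu, ha0, hθ0⟩
  obtain ⟨ηZ, hηZ, K, hK0, hZK⟩ := Holds.stub_hsCompressibility_linear
  obtain ⟨ηbar, hηbar, HD0⟩ := stub_diluteBlocks_of_kineticRangeControl hK a₀ θ₀ u₀ hP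
  obtain ⟨σBψ, hσBψ, ηψ, hηψ, HBψ⟩ := Holds.stub_collisionalStressLaw_of_evenStress h79 a₀ θ₀ u₀ hP
  obtain ⟨σBχ, hσBχ, ηχ, hηχ, HBχ⟩ := (hKq : type_of% Holds.stub_collisionalEnergyFluxLaw) a₀ θ₀ u₀ hP
  set ηs : ℝ := min (min ηZ ηbar) (min ηψ ηχ) with hηs
  have hηs0 : 0 < ηs := lt_min (lt_min hηZ hηbar) (lt_min hηψ hηχ)
  have hηsZ : ηs ≤ ηZ := (min_le_left _ _).trans (min_le_left _ _)
  have hηs2 : ηs ≤ ηbar := (min_le_left _ _).trans (min_le_right _ _)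
  have hηsψ : ηs ≤ ηψ := (min_le_right _ _).trans (min_le_left _ _)
  have hηsχ : ηs ≤ ηχ := (min_le_right _ _).trans (min_le_right _ _)
  obtain ⟨σF, hσF, ηF, hηF, HF⟩ := hF a₀ θ₀ u₀ ha hθ hu ha0 hθ0
  obtain ⟨σV, hσV, HV⟩ := virialBounded_of_collisionMomentBound hM a₀ θ₀ u₀ hP
  obtain ⟨σD, hσD, HD⟩ := HD0 ηs hηs0 hηs2
  have HC := Holds.stub_weightedKineticRelaxationDilute ηZ K hηZ hK0 hZK ηs hηs0 hηsZ
  have HE := Holds.stub_energyAllTimes a₀ θ₀ u₀ hP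
  refine ⟨min (min σF σV) (min (min σBψ σBχ) (min σD (1 / 2))), ?_, min ηF ηs, lt_min hηF hηs0, ?_⟩
  · exact lt_min (lt_min hσF hσV) (lt_min (lt_min hσBψ hσBχ) (lt_min hσD (by norm_num)))
  intro σ hσ hlt T ρ θ u hsol Φ hlln γ C φ hγ hγ' hadm
  have hltF : σ < σF := lt_of_lt_of_le hlt ((min_le_left _ _).trans (min_le_left _ _))
  have hltV : σ < σV := lt_of_lt_of_le hlt ((min_le_left _ _).trans (min_le_right _ _))
  have hltBψ : σ < σBψ := lt_of_lt_of_le hlt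
    ((min_le_right _ _).trans ((min_le_left _ _).trans (min_le_left _ _)))
  have hltBχ : σ < σBχ := lt_of_lt_of_le hlt
    ((min_le_right _ _).trans ((min_le_left _ _).trans (min_le_right _ _)))
  have hltD : σ < σD := lt_of_lt_of_le hlt
    ((min_le_right _ _).trans ((min_le_right _ _).trans (min_le_left _ _)))
  have hhalf : σ ≤ 1 / 2 :=
    (lt_of_lt_of_le hlt ((min_le_right _ _).trans ((min_le_right _ _).trans (min_le_right _ _)))).le
  obtain ⟨E₀, -, HEt⟩ := HE σ hσ hhalf Φ
  intro ρb mb Eb ub θb pc t ht htT hdil ψ χ hψ hχ O Cc' δ hδ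
  have hdilF : ∀ s ∈ Icc 0 t, ∀ x, 2 * ρ s x * σ ^ 3 < ηF :=
    fun s hs x => (hdil s hs x).trans_le (min_le_left _ _)
  have hdil2 : ∀ s ∈ Icc 0 t, ∀ x, 2 * ρ s x * σ ^ 3 < ηs :=
    fun s hs x => (hdil s hs x).trans_le (min_le_right _ _)
  have hEner := HEt t
  have hDil : DiluteAt σ a₀ θ₀ u₀ Φ t φ ηs :=
    HD σ hσ hltD T ρ θ u hsol Φ hlln t ht htT hdil2 γ C φ hγ hγ' hadm
  have hVir : VirialBounded σ a₀ θ₀ u₀ Φ t := HV σ hσ hltV Φ t ht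
  have hFloc : ∀ δ : ℝ, 0 < δ → Tendsto (fun N : ℕ =>
      Literature.MathematicalPhysics.KineticTheory.localGibbsLaw σ a₀ u₀ θ₀ N (Φ N)
        {z | δ < ∫ s in Icc 0 t, ∫ x, ((∑ j, ∑ k, Dst φ N ((Φ N).flow s z) x j k ^ 2) +
          ‖qfl φ N ((Φ N).flow s z) x‖ ^ 2)}) atTop (𝓝 0) :=
    fun δ hδ => HF σ hσ hltF T ρ θ u hsol Φ hlln γ C φ hγ hγ' hadm t ht htT hdilF δ hδ
  have hφc : ∀ N, Continuous (φ N) := fun N => (hadm.1 N).continuous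
  have hφ0 : ∀ N y, 0 ≤ φ N y := hadm.2.1
  have h0χ := isSmoothSpaceTimeOn_zero_scalar (Icc 0 t)
  have h0ψ := isSmoothSpaceTimeOn_zero_vector (Icc 0 t)
  exact conclusion_of_channels hσ hhalf hηZ hK0 hZK hηs0 hηsZ a₀ θ₀ u₀ Φ φ ht hφc hφ0 hDil hψ hχ hVir
    (HBψ σ hσ hltBψ Φ t ht hVir γ C φ hγ hγ' hadm (hDil.mono hηsψ) ψ hψ)
    (HBχ σ hσ hltBχ Φ t ht hVir γ C φ hγ hγ' hadm (hDil.mono hηsχ) χ hχ)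
    (HC σ hσ a₀ θ₀ u₀ Φ t E₀ ht hEner γ C φ hγ hγ' hadm hDil hFloc ψ _ hψ h0χ)
    (HC σ hσ a₀ θ₀ u₀ Φ t E₀ ht hEner γ C φ hγ hγ' hadm hDil hFloc _ χ h0ψ hχ) δ hδ

/-- **The pre-shock form (v20)** from 9522 + 15144 + 13079 + 9201 BY NAME and the registered stubs [TS], [KqR], [TSχ], [GKq] — NO `∀ t` stub. -/
theorem collisionalTransferLocalityPreShock_of
    (hF : Summit.AtomisticToContinuum.HydrodynamicLimit.Theses.StiffCollisionalRelaxation.FastMomentRelaxation)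
    (hM : Summit.AtomisticToContinuum.HydrodynamicLimit.Theses.InformationPercolationEngine.CollisionMomentBound)
    (h79 : Summit.AtomisticToContinuum.HydrodynamicLimit.Theses.JParityClosure.EvenStressEnskog)
    (hKqR : stub_energyFluxLawCone) (hTSχ : stub_twoScaleValueChi)
    (hK : Summit.AtomisticToContinuum.HydrodynamicLimit.Theses.GermanoSplitLES.KineticRangeControl) :
    CollisionalTransferLocalityPreShock :=
  collisionalTransferLocalityPreShock_of_Kq hF hM h79 (Holds.stub_collisionalEnergyFluxLaw_of_cone hKqR hTSχ) hK

/-- **The pre-shock form from the CIC route's own hinge 14902 (v20)** and 15144 + 13079 + 9201 BY NAME, stubs [TS], [KqR], [TSχ], [GKq]. -/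
theorem collisionalTransferLocalityPreShock_of_cic
    (hF : Summit.AtomisticToContinuum.HydrodynamicLimit.Theses.CollisionIsometryCLT.FastMomentRelaxationPreShock)
    (hM : Summit.AtomisticToContinuum.HydrodynamicLimit.Theses.InformationPercolationEngine.CollisionMomentBound)
    (h79 : Summit.AtomisticToContinuum.HydrodynamicLimit.Theses.JParityClosure.EvenStressEnskog)
    (hKqR : stub_energyFluxLawCone) (hTSχ : stub_twoScaleValueChi)
    (hK : Summit.AtomisticToContinuum.HydrodynamicLimit.Theses.GermanoSplitLES.KineticRangeControl) :
    CollisionalTransferLocalityPreShock :=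
  collisionalTransferLocalityPreShock_of_cic_Kq hF hM h79 (Holds.stub_collisionalEnergyFluxLaw_of_cone hKqR hTSχ) hK

/-- The filed `∀ t > 0` crux implies the pre-shock form (pure logic, `η₁ := 1`): the restatement is a WEAKENING, so
nothing landed for the line is invalidated by it. -/
theorem collisionalTransferLocalityPreShock_of_allTimes
    (h : Summit.AtomisticToContinuum.HydrodynamicLimit.Theses.StiffCollisionalRelaxation.CollisionalTransferLocality) :
    CollisionalTransferLocalityPreShock := by
  intro a₀ θ₀ u₀ ha hθ hu ha0 hθ0
  obtain ⟨σ₀, hσ₀, H⟩ := h a₀ θ₀ u₀ ha hθ hu ha0 hθ0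
  refine ⟨σ₀, hσ₀, 1, one_pos, ?_⟩
  intro σ hσ hσ' T ρ θ u _sol Φ _lln γ C φ hγ hγ' hadm ρb mb Eb ub θb pc t ht _htT _hdil ψ χ hψ hχ
  exact H σ hσ hσ' Φ γ C φ hγ hγ' hadm t ht ψ χ hψ hχ

/-! ## Glue for the equilibrium rung (sorry-free, v11.1) -/

/-- [WB]⟸[VL] **Window-burst control from a fixed-time law of large numbers** (pure probability). At any
`(σ, profiles, Φ)` and horizon `t > 0`: if `V_N(τ) → Λ(τ)` in probability at each `τ ∈ [0, t]` with `Λ` continuous on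
`[0, t]`, then for all `δ, ε > 0` there is a grid size `n > 0` such that, eventually in `N`, the probability that some
window increment `V_N((k+1)t/n) − V_N(kt/n)`, `k < n`, exceeds `δ` is at most `ε` (uniform continuity of `Λ`, triangle
inequality at the two grid ends, union bound over the `n + 1` grid times). [folklore] -/
theorem noBursts_of_virialLLN (σ : ℝ) (a₀ θ₀ : T3 → ℝ) (u₀ : T3 → V3) (Φ : Flows σ) {t : ℝ} (ht : 0 < t)
    (hVL : ∃ Λ : ℝ → ℝ, ContinuousOn Λ (Icc 0 t) ∧ ∀ τ ∈ Icc 0 t, ∀ δ : ℝ, 0 < δ → Tendsto (fun N : ℕ =>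
      Literature.MathematicalPhysics.KineticTheory.localGibbsLaw σ a₀ u₀ θ₀ N (Φ N) {z | δ < |virialW σ Φ N z τ - Λ τ|}) atTop (𝓝 0)) :
    ∀ δ ε : ℝ, 0 < δ → 0 < ε → ∃ n : ℕ, 0 < n ∧ ∀ᶠ N : ℕ in atTop,
      Literature.MathematicalPhysics.KineticTheory.localGibbsLaw σ a₀ u₀ θ₀ N (Φ N) {z | ∃ k : ℕ, k < n ∧
        δ < virialW σ Φ N z ((k + 1) * (t / n)) - virialW σ Φ N z (k * (t / n))} ≤ ENNReal.ofReal ε := by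
  intro δ ε hδ hε
  obtain ⟨Λ, hΛc, hΛ⟩ := hVL
  have huc : UniformContinuousOn Λ (Icc 0 t) := isCompact_Icc.uniformContinuousOn_of_continuous hΛc
  rw [Metric.uniformContinuousOn_iff] at huc
  obtain ⟨ρ, hρ, hρΛ⟩ := huc (δ / 3) (by positivity)
  obtain ⟨n, hn⟩ := exists_nat_gt (t / ρ)
  have htρ : 0 < t / ρ := div_pos ht hρ
  have hnR : (0 : ℝ) < n := htρ.trans hn
  have hn0 : 0 < n := by exact_mod_cast hnR
  have hmesh : t / n < ρ := by
    rw [div_lt_iff₀ hnR]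
    calc t = t / ρ * ρ := by field_simp
      _ < n * ρ := by gcongr
      _ = ρ * n := mul_comm _ _
  refine ⟨n, hn0, ?_⟩
  set P : (N : ℕ) → Measure (Cfg N) := fun N => Literature.MathematicalPhysics.KineticTheory.localGibbsLaw σ a₀ u₀ θ₀ N (Φ N) with hP
  have hgrid : ∀ k : ℕ, k ≤ n → (k : ℝ) * (t / n) ∈ Icc 0 t := by
    intro k hk
    refine ⟨by positivity, ?_⟩
    have hk' : (k : ℝ) ≤ n := by exact_mod_cast hk
    calc (k : ℝ) * (t / n) ≤ n * (t / n) := by gcongr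
      _ = t := by field_simp
  set A : (N : ℕ) → Fin (n + 1) → Set (Cfg N) := fun N k =>
    {z | δ / 3 < |virialW σ Φ N z ((k : ℕ) * (t / n)) - Λ ((k : ℕ) * (t / n))|} with hA
  have hev : ∀ k : Fin (n + 1), Tendsto (fun N => P N (A N k)) atTop (𝓝 0) :=
    fun k => hΛ _ (hgrid k (Nat.lt_succ_iff.mp k.2)) (δ / 3) (by positivity)
  have hsum : Tendsto (fun N => ∑ k : Fin (n + 1), P N (A N k)) atTop (𝓝 0) := by
    simpa using tendsto_finsetSum Finset.univ fun k _ => hev k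
  have hε' : (0 : ℝ≥0∞) < ENNReal.ofReal ε := ENNReal.ofReal_pos.2 hε
  filter_upwards [(tendsto_order.1 hsum).2 _ hε'] with N hN
  refine le_trans (measure_mono ?_) ((measure_iUnion_fintype_le (P N) (A N)).trans hN.le)
  rintro z ⟨k, hk, hzk⟩
  simp only [Set.mem_iUnion]
  by_contra hno
  push Not at hno
  have h1 : ¬ (δ / 3 < |virialW σ Φ N z ((k : ℕ) * (t / n)) - Λ ((k : ℕ) * (t / n))|) := by
    simpa [hA] using hno ⟨k, by omega⟩
  have h2 : ¬ (δ / 3 < |virialW σ Φ N z (((k + 1 : ℕ) : ℕ) * (t / n)) - Λ (((k + 1 : ℕ) : ℕ) * (t / n))|) := by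
    simpa [hA] using hno ⟨k + 1, by omega⟩
  push_cast at h1 h2
  rw [not_lt] at h1 h2
  have hΛk : dist (Λ (((k : ℝ) + 1) * (t / n))) (Λ ((k : ℝ) * (t / n))) < δ / 3 := by
    refine hρΛ _ ?_ _ (hgrid k (by omega)) ?_
    · exact_mod_cast hgrid (k + 1) (by omega)
    · rw [Real.dist_eq, show ((k : ℝ) + 1) * (t / n) - k * (t / n) = t / n by ring, abs_of_pos (by positivity)]
      exact hmesh
  rw [Real.dist_eq] at hΛk
  have e1 := (abs_le.mp h1).1
  have e2 := (abs_le.mp h2).2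
  have e3 := (abs_lt.mp hΛk).2
  linarith

/-- A uniform positive radius over finitely many indices: if for each `m : Fin n` (`n > 0`) some `r₀(m) > 0` works for
all `r < r₀(m)`, then one `r₀ > 0` works for all `m` (the minimum). [folklore] -/
theorem exists_uniform_radius {n : ℕ} (hn : 0 < n) {Q : Fin n → ℝ → Prop}
    (h : ∀ m : Fin n, ∃ r₀ : ℝ, 0 < r₀ ∧ ∀ r : ℝ, 0 < r → r < r₀ → Q m r) :
    ∃ r₀ : ℝ, 0 < r₀ ∧ ∀ m : Fin n, ∀ r : ℝ, 0 < r → r < r₀ → Q m r := by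
  classical
  choose rr hrr Hrr using h
  haveI : Nonempty (Fin n) := Fin.pos_iff_nonempty.mp hn
  refine ⟨Finset.univ.inf' Finset.univ_nonempty rr, (Finset.lt_inf'_iff _).2 fun m _ => hrr m,
    fun m r hr hrlt => Hrr m r hr (hrlt.trans_le (Finset.inf'_le _ (Finset.mem_univ m)))⟩

/-- A set integral over the degenerate interval `[0, 0]` vanishes. [folklore] -/
theorem setIntegral_Icc_self_eq_zero (f : ℝ → ℝ) : ∫ s in Icc (0 : ℝ) 0, f s = 0 := by
  rw [Set.Icc_self, Measure.restrict_singleton]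
  simp

/-- [WB]₀ **Window-burst control of the collision virial AT EQUILIBRIUM from the sibling crux `EvenStressEnskog` at constant
profiles** (the assembly of v11.1; the lead's glue). Given the conclusion of
`EvenStressEnskog_rung0_of_plateau_contact` (the even collision statistic of every `Ξ^{kl}`, with any continuous
`χ`, cutoff `g` vanishing above `η₀`, is small in probability at each fixed time for small mollifier radii), the
pathwise window domination [PW-a], the Enskog window bound [PW-b], the mollified ceiling [MC], the fast-particle tail [TL] and the landed energy cap [E]:
for every `θ > 0` there is `σ₀ > 0` such that for `0 < σ < σ₀`, every flow family and `t > 0`, the window increments of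
`V_N` on a fine grid are small w.h.p. Parameter order: `η_c := min η₀ η_Z`; `σ₀ := min` of the four radii, `η_c/4` and
`1/2` (so `4σ³ ≤ η_c`); given `δ, ε`: energy level `E₀`, tail level `L` ([TL] at `(δ/2, ε/4)`), the constant `C` of [PW-b]
(independent of `r`), grid size `n` with `(1 + 2L)·3C E₀ t/n ≤ δ/4`, accuracy `η' := δ/(24(1 + 2L))` and budget
`ε/(12n)` per (grid time, trace mark), THEN the mollifier radius `r < r₀` uniformly over the `n` grid times
(`exists_uniform_radius`), then `N` large; union bound over good-set complement (null), energy, ceiling, tail and the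
`3n` even-statistic events. [folklore] -/
theorem noVirialBurstsConst_of
    (h79 : (∃ η₀ : ℝ, 0 < η₀ ∧ ∀ (a θ : ℝ) (u : V3), 0 < a → 0 < θ → ∃ σ₀ : ℝ, 0 < σ₀ ∧ ∀ σ : ℝ, 0 < σ → σ < σ₀ → ∀ Φ : (N : ℕ) → Literature.Analysis.FluidPDE.HardSphereFlow (Literature.Analysis.FluidPDE.Torus.geometry (Fin 3)) (Literature.MathematicalPhysics.KineticTheory.hsDiameter σ N) (N + 1), ∀ τ : ℝ, 0 < τ → ∀ χ : ℝ × UnitAddTorus (Fin 3) → ℝ, Continuous χ → ∀ g : ℝ → ℝ, Continuous g → (∀ a, η₀ ≤ a → g a = 0) → ∀ η δ : ℝ, 0 < η → 0 < δ → ∃ r₀ : ℝ, 0 < r₀ ∧ ∀ r : ℝ, 0 < r → r < r₀ → ∃ N₀ : ℕ, ∀ N : ℕ, N₀ ≤ N → ∀ k l : Fin 3, Literature.MathematicalPhysics.KineticTheory.localGibbsLaw σ (fun _ => a) (fun _ => u) (fun _ => θ) N (Φ N) {z | η < |Literature.MathematicalPhysics.KineticTheory.evenStat σ N (Φ N) τ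 χ g (Literature.MathematicalPhysics.KineticTheory.evenMark k l) r z|} ≤ ENNReal.ofReal δ))
    :
    ∀ θ : ℝ, 0 < θ → ∃ σ₀ : ℝ, 0 < σ₀ ∧ ∀ σ : ℝ, 0 < σ → σ < σ₀ → ∀ (Φ : Flows σ) (t : ℝ), 0 < t →
      ∀ δ ε : ℝ, 0 < δ → 0 < ε → ∃ n : ℕ, 0 < n ∧ ∀ᶠ N : ℕ in atTop,
        Literature.MathematicalPhysics.KineticTheory.localGibbsLaw σ (fun _ => 1) (fun _ => 0) (fun _ => θ) N (Φ N)
          {z | ∃ k : ℕ, k < n ∧ δ < virialW σ Φ N z ((k + 1) * (t / n)) - virialW σ Φ N z (k * (t / n))} ≤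
          ENNReal.ofReal ε := by
  intro θ hθ
  obtain ⟨η₀, hη₀, H79⟩ := h79
  obtain ⟨ηZ, hηZ, K, hK0, hZK⟩ := Holds.stub_hsCompressibility_linear
  set ηc : ℝ := min η₀ ηZ with hηc
  have hηc0 : 0 < ηc := lt_min hη₀ hηZ
  have hηcZ : ηc ≤ ηZ := min_le_right _ _
  have hηc1 : ηc ≤ η₀ := min_le_left _ _
  obtain ⟨σ₁, hσ₁, H1⟩ := H79 1 θ 0 one_pos hθ
  obtain ⟨σ₂, hσ₂, H2⟩ := Holds.stub_mollifiedCeilingConst θ hθ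
  obtain ⟨σ₃, hσ₃, H3⟩ := Holds.stub_virialTailConst θ hθ
  refine ⟨min (min σ₁ σ₂) (min σ₃ (min (ηc / 4) (1 / 2))),
    lt_min (lt_min hσ₁ hσ₂) (lt_min hσ₃ (lt_min (by positivity) (by norm_num))), ?_⟩
  intro σ hσ hlt Φ t ht δ ε hδ hε
  have hlt1 : σ < σ₁ := lt_of_lt_of_le hlt ((min_le_left _ _).trans (min_le_left _ _))
  have hlt2 : σ < σ₂ := lt_of_lt_of_le hlt ((min_le_left _ _).trans (min_le_right _ _))
  have hlt3 : σ < σ₃ := lt_of_lt_of_le hlt ((min_le_right _ _).trans (min_le_left _ _))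
  have hltc : σ < ηc / 4 := lt_of_lt_of_le hlt ((min_le_right _ _).trans ((min_le_right _ _).trans (min_le_left _ _)))
  have hhalf' : σ < 1 / 2 := lt_of_lt_of_le hlt ((min_le_right _ _).trans ((min_le_right _ _).trans (min_le_right _ _)))
  have hhalf : σ ≤ 1 / 2 := hhalf'.le
  have h4σ : 4 * σ ^ 3 ≤ ηc := by
    have hσ1 : σ ≤ 1 := by linarith
    have h3 : σ ^ 3 ≤ σ := by
      have : σ ^ 3 = σ * (σ * σ) := by ring
      rw [this]
      calc σ * (σ * σ) ≤ σ * (1 * 1) := by gcongr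
        _ = σ := by ring
    linarith
  have hP : NiceProfiles (fun _ : T3 => (1 : ℝ)) (fun _ => θ) (fun _ => (0 : V3)) :=
    ⟨continuous_const, continuous_const, continuous_const, fun _ => one_pos, fun _ => hθ⟩
  obtain ⟨E₀, hE₀, HE⟩ := Holds.stub_energyAllTimes _ _ _ hP σ hσ hhalf Φ
  obtain ⟨C, hC0, HEW⟩ := Holds.stub_enskogWindowBound σ hσ hhalf ηZ K ηc hηZ hK0 hZK hηc0 hηcZ
  have HWD := Holds.stub_windowDomination σ hσ hhalf ηc hηc0
  -- tail level `L`
  obtain ⟨L₀, HL⟩ := H3 σ hσ hlt3 Φ t ht (δ / 2) (ε / 4) (by positivity) (by positivity)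
  set L : ℝ := max L₀ 1 with hL
  have hL0 : 0 < L := lt_of_lt_of_le one_pos (le_max_right _ _)
  have hL1 : L₀ ≤ L := le_max_left _ _
  have h2L : 0 < 1 + 2 * L := by positivity
  -- grid size `n`
  obtain ⟨n, hn⟩ := exists_nat_gt (12 * (1 + 2 * L) * C * E₀ * t / δ)
  have hnum0 : 0 ≤ 12 * (1 + 2 * L) * C * E₀ * t / δ := by positivity
  have hnR : (0 : ℝ) < n := hnum0.trans_lt hn
  have hn0 : 0 < n := by exact_mod_cast hnR
  have hwin : (1 + 2 * L) * (3 * (C * E₀ * (t / n))) ≤ δ / 4 := by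
    rw [div_lt_iff₀ hδ] at hn
    rw [show (1 + 2 * L) * (3 * (C * E₀ * (t / n))) = (12 * (1 + 2 * L) * C * E₀ * t) / (4 * n) by
      field_simp; ring]
    rw [div_le_iff₀ (by positivity)]
    nlinarith
  -- accuracy `η'` per grid evaluation
  set η' : ℝ := δ / (24 * (1 + 2 * L)) with hη'
  have hη'0 : 0 < η' := by positivity
  have hη'win : (1 + 2 * L) * (6 * η') = δ / 4 := by
    rw [hη']; field_simp; ring
  -- the cutoff `g` and the test `χ ≡ 1`
  set g : ℝ → ℝ := fun a => max 0 (min 1 (2 - 2 * a / ηc)) with hg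
  have hgc : Continuous g := by
    rw [hg]; fun_prop
  have hg0 : ∀ a, η₀ ≤ a → g a = 0 := by
    intro a ha
    have hle : 2 - 2 * a / ηc ≤ 0 := by
      rw [sub_nonpos, le_div_iff₀ hηc0]
      nlinarith [hηc1.trans ha]
    have hmin : min 1 (2 - 2 * a / ηc) ≤ 0 := (min_le_right _ _).trans hle
    show max 0 (min 1 (2 - 2 * a / ηc)) = 0
    exact max_eq_left hmin
  -- budget per (grid time, trace mark) and the uniform radius
  set δ' : ℝ := ε / (4 * (3 * n)) with hδ'
  have hδ'0 : 0 < δ' := by positivity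
  set P : (N : ℕ) → Measure (Cfg N) := fun N =>
    Literature.MathematicalPhysics.KineticTheory.localGibbsLaw σ (fun _ => 1) (fun _ => 0) (fun _ => θ) N (Φ N) with hPdef
  have hr0 : ∀ m : Fin n, ∃ r₀ : ℝ, 0 < r₀ ∧ ∀ r : ℝ, 0 < r → r < r₀ → ∃ N₀ : ℕ, ∀ N : ℕ, N₀ ≤ N →
      ∀ k l : Fin 3, P N {z | η' < |Literature.MathematicalPhysics.KineticTheory.evenStat σ N (Φ N) ((((m : ℕ) : ℝ) + 1) * (t / n))
        (fun _ : ℝ × T3 => (1 : ℝ)) g (Literature.MathematicalPhysics.KineticTheory.evenMark k l) r z|} ≤ ENNReal.ofReal δ' :=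
    fun m => H1 σ hσ hlt1 Φ ((((m : ℕ) : ℝ) + 1) * (t / n)) (by positivity) (fun _ => (1 : ℝ)) continuous_const
      g hgc hg0 η' δ' hη'0 hδ'0
  obtain ⟨r₀, hr₀, Hr⟩ := exists_uniform_radius hn0 hr0
  set r : ℝ := min (r₀ / 2) (1 / 8) with hr
  have hr0' : 0 < r := lt_min (half_pos hr₀) (by norm_num)
  have hrr₀ : r < r₀ := (min_le_left _ _).trans_lt (half_lt_self hr₀)
  have hr4 : r < 1 / 4 := (min_le_right _ _).trans_lt (by norm_num)
  -- the five families of events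
  set Aev : (N : ℕ) → Fin n × Fin 3 → Set (Cfg N) := fun N p =>
    {z | η' < |Literature.MathematicalPhysics.KineticTheory.evenStat σ N (Φ N) ((((p.1 : ℕ) : ℝ) + 1) * (t / n))
      (fun _ : ℝ × T3 => (1 : ℝ)) g (Literature.MathematicalPhysics.KineticTheory.evenMark p.2 p.2) r z|} with hAev
  set Eev : (N : ℕ) → Set (Cfg N) := fun N =>
    {z | ∃ s ∈ Icc 0 t, E₀ < ((N : ℝ) + 1)⁻¹ * Literature.Analysis.FluidPDE.configEnergy ((Φ N).flow s z)} with hEev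
  set Mev : (N : ℕ) → Set (Cfg N) := fun N =>
    {z | ∃ s ∈ Icc 0 t, ∃ x : T3, 2 < Literature.MathematicalPhysics.KineticTheory.mollDensity r ((Φ N).flow s z) x} with hMev
  set Tev : (N : ℕ) → Set (Cfg N) := fun N =>
    {z | δ / 2 < ((N : ℝ) + 1)⁻¹ * (Φ N).collisionPairSum (Ioc 0 t)
      (fun s w i j => if L < ‖(w i).2‖ ∨ L < ‖(w j).2‖ then virialK σ N s w i j else 0) z} with hTev
  have hA : ∀ p : Fin n × Fin 3, ∀ᶠ N : ℕ in atTop, P N (Aev N p) ≤ ENNReal.ofReal δ' := by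
    rintro ⟨m, k⟩
    obtain ⟨N₀, HN⟩ := Hr m r hr0' hrr₀
    exact Filter.eventually_atTop.2 ⟨N₀, fun N hN => HN N hN k k⟩
  have hA' : ∀ᶠ N : ℕ in atTop, ∀ p : Fin n × Fin 3, P N (Aev N p) ≤ ENNReal.ofReal δ' :=
    Filter.eventually_all.2 hA
  have hε4 : (0 : ℝ≥0∞) < ENNReal.ofReal (ε / 4) := ENNReal.ofReal_pos.2 (by positivity)
  have hE' : ∀ᶠ N : ℕ in atTop, P N (Eev N) ≤ ENNReal.ofReal (ε / 4) :=
    ((tendsto_order.1 (HE t)).2 _ hε4).mono fun N hN => hN.le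
  have hM' : ∀ᶠ N : ℕ in atTop, P N (Mev N) ≤ ENNReal.ofReal (ε / 4) :=
    ((tendsto_order.1 (H2 σ hσ hlt2 Φ t r ht hr0' hr4)).2 _ hε4).mono fun N hN => hN.le
  have hT' : ∀ N : ℕ, P N (Tev N) ≤ ENNReal.ofReal (ε / 4) := fun N => HL L hL1 N
  refine ⟨n, hn0, ?_⟩
  filter_upwards [hA', hE', hM'] with N hNA hNE hNM
  -- the cover at this `N`
  have hcover : {z : Cfg N | ∃ k : ℕ, k < n ∧
      δ < virialW σ Φ N z ((k + 1) * (t / n)) - virialW σ Φ N z (k * (t / n))} ⊆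
      (Φ N).goodᶜ ∪ (Eev N ∪ (Mev N ∪ (Tev N ∪ ⋃ p : Fin n × Fin 3, Aev N p))) := by
    rintro z ⟨k, hk, hzk⟩
    by_cases hz : z ∈ (Φ N).good
    swap
    · exact Or.inl hz
    right
    by_contra hno
    simp only [Set.mem_union, Set.mem_iUnion, hEev, hMev, hTev, hAev, Set.mem_setOf_eq, not_or, not_exists,
      not_and, not_lt] at hno
    obtain ⟨hnE, hnM, hnT, hnA⟩ := hno
    have hnE' : ∀ s ∈ Icc 0 t, ((N : ℝ) + 1)⁻¹ * Literature.Analysis.FluidPDE.configEnergy ((Φ N).flow s z) ≤ E₀ :=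
      fun s hs => hnE s hs
    have hnM' : ∀ s ∈ Icc 0 t, ∀ x : T3, Literature.MathematicalPhysics.KineticTheory.mollDensity r ((Φ N).flow s z) x ≤ 2 :=
      fun s hs x => hnM s hs x
    obtain ⟨hpos, hdom⟩ := HWD r L hr0' hr4 hL0 Φ N z hz t ht hnM' h4σ
    have hens := HEW r E₀ hr0' hr4 hE₀ Φ N z hz t ht hnE' hnM'
    have hkn : (k : ℝ) + 1 ≤ n := by exact_mod_cast Nat.succ_le_of_lt hk
    have hτ0 : (0 : ℝ) ≤ k * (t / n) := by positivity
    have hττ' : (k : ℝ) * (t / n) ≤ (k + 1) * (t / n) := by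
      have : (0 : ℝ) ≤ t / n := by positivity
      nlinarith
    have hτ't : ((k : ℝ) + 1) * (t / n) ≤ t := by
      calc ((k : ℝ) + 1) * (t / n) ≤ n * (t / n) := by gcongr
        _ = t := by field_simp
    have hwidth : ((k : ℝ) + 1) * (t / n) - k * (t / n) = t / n := by ring
    have hD := hdom _ _ hτ0 hττ' hτ't
    -- the three even collision sums over the window
    have hK : ∀ κ : Fin 3,
        Literature.MathematicalPhysics.KineticTheory.collisionSum σ N (Φ N) (((k : ℝ) + 1) * (t / n)) (fun _ : ℝ × T3 => (1 : ℝ)) g (Literature.MathematicalPhysics.KineticTheory.evenMark κ κ) r z -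
          Literature.MathematicalPhysics.KineticTheory.collisionSum σ N (Φ N) ((k : ℝ) * (t / n)) (fun _ : ℝ × T3 => (1 : ℝ)) g (Literature.MathematicalPhysics.KineticTheory.evenMark κ κ) r z ≤
          2 * η' + C * E₀ * (t / n) := by
      intro κ
      have hes := hens κ _ _ hτ0 hττ' hτ't
      rw [hwidth] at hes
      have h1 : |Literature.MathematicalPhysics.KineticTheory.evenStat σ N (Φ N) (((k : ℝ) + 1) * (t / n)) (fun _ : ℝ × T3 => (1 : ℝ)) g (Literature.MathematicalPhysics.KineticTheory.evenMark κ κ) r z|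
          ≤ η' := by
        have := hnA (⟨k, hk⟩, κ)
        simpa using this
      have hdef1 := Literature.MathematicalPhysics.KineticTheory.evenStat_def σ N (Φ N) (((k : ℝ) + 1) * (t / n)) (fun _ : ℝ × T3 => (1 : ℝ)) g
        (Literature.MathematicalPhysics.KineticTheory.evenMark κ κ) r z
      rcases Nat.eq_zero_or_pos k with rfl | hkpos
      · -- first window: the sum at time `0` is nonnegative, the Enskog integral over `[0, 0]` vanishes
        have h0 := hpos κ ((0 : ℕ) * (t / n))
        have hes0 : |σ ^ 3 * ∫ s in Icc 0 ((((0 : ℕ) : ℝ) + 1) * (t / n)), Literature.MathematicalPhysics.KineticTheory.enskogRate σ N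
            (fun _ : ℝ × T3 => (1 : ℝ)) g (Literature.MathematicalPhysics.KineticTheory.evenMark κ κ) r s ((Φ N).flow s z)| ≤ C * E₀ * (t / n) := by
          have h00 : σ ^ 3 * ∫ s in Icc 0 (((0 : ℕ) : ℝ) * (t / n)), Literature.MathematicalPhysics.KineticTheory.enskogRate σ N
              (fun _ : ℝ × T3 => (1 : ℝ)) g (Literature.MathematicalPhysics.KineticTheory.evenMark κ κ) r s ((Φ N).flow s z) = 0 := by
            rw [Nat.cast_zero, zero_mul, setIntegral_Icc_self_eq_zero, mul_zero]
          simpa [h00] using hes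
        push_cast at h1 hdef1 hes0 h0 ⊢
        have e1 := (abs_le.mp h1).2
        have e2 := (abs_le.mp hes0).2
        linarith [hdef1]
      · -- later windows: both ends are grid evaluations
        have h2 : |Literature.MathematicalPhysics.KineticTheory.evenStat σ N (Φ N) ((k : ℝ) * (t / n)) (fun _ : ℝ × T3 => (1 : ℝ)) g (Literature.MathematicalPhysics.KineticTheory.evenMark κ κ) r z|
            ≤ η' := by
          have := hnA (⟨k - 1, by omega⟩, κ)
          have hcast : (((k - 1 : ℕ) : ℝ) + 1) = k := by
            rw [Nat.cast_sub hkpos]; push_cast; ring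
          simpa [hcast] using this
        have hdef2 := Literature.MathematicalPhysics.KineticTheory.evenStat_def σ N (Φ N) ((k : ℝ) * (t / n)) (fun _ : ℝ × T3 => (1 : ℝ)) g
          (Literature.MathematicalPhysics.KineticTheory.evenMark κ κ) r z
        have e1 := (abs_le.mp h1).2
        have e2 := (abs_le.mp h2).1
        have e3 := (abs_le.mp hes).2
        linarith [hdef1, hdef2]
    have hsumK : ∑ κ : Fin 3,
        (Literature.MathematicalPhysics.KineticTheory.collisionSum σ N (Φ N) (((k : ℝ) + 1) * (t / n)) (fun _ : ℝ × T3 => (1 : ℝ)) g (Literature.MathematicalPhysics.KineticTheory.evenMark κ κ) r z -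
          Literature.MathematicalPhysics.KineticTheory.collisionSum σ N (Φ N) ((k : ℝ) * (t / n)) (fun _ : ℝ × T3 => (1 : ℝ)) g (Literature.MathematicalPhysics.KineticTheory.evenMark κ κ) r z) ≤
        3 * (2 * η' + C * E₀ * (t / n)) := by
      calc _ ≤ ∑ _κ : Fin 3, (2 * η' + C * E₀ * (t / n)) := Finset.sum_le_sum fun κ _ => hK κ
        _ = 3 * (2 * η' + C * E₀ * (t / n)) := by
            rw [Finset.sum_const, Finset.card_univ, Fintype.card_fin, nsmul_eq_mul]; push_cast; ring
    have hTz : ((N : ℝ) + 1)⁻¹ * (Φ N).collisionPairSum (Ioc 0 t)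
        (fun s w i j => if L < ‖(w i).2‖ ∨ L < ‖(w j).2‖ then virialK σ N s w i j else 0) z ≤ δ / 2 := hnT
    have hfin : virialW σ Φ N z (((k : ℝ) + 1) * (t / n)) - virialW σ Φ N z ((k : ℝ) * (t / n)) ≤ δ := by
      have hmul : (1 + 2 * L) * ∑ κ : Fin 3,
          (Literature.MathematicalPhysics.KineticTheory.collisionSum σ N (Φ N) (((k : ℝ) + 1) * (t / n)) (fun _ : ℝ × T3 => (1 : ℝ)) g (Literature.MathematicalPhysics.KineticTheory.evenMark κ κ) r z -
            Literature.MathematicalPhysics.KineticTheory.collisionSum σ N (Φ N) ((k : ℝ) * (t / n)) (fun _ : ℝ × T3 => (1 : ℝ)) g (Literature.MathematicalPhysics.KineticTheory.evenMark κ κ) r z) ≤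
          (1 + 2 * L) * (3 * (2 * η' + C * E₀ * (t / n))) := mul_le_mul_of_nonneg_left hsumK h2L.le
      have hsplit : (1 + 2 * L) * (3 * (2 * η' + C * E₀ * (t / n))) =
          (1 + 2 * L) * (6 * η') + (1 + 2 * L) * (3 * (C * E₀ * (t / n))) := by ring
      linarith [hD, hmul, hsplit, hη'win, hwin, hTz]
    exact absurd hzk (not_lt.2 (by exact_mod_cast hfin))
  -- the union bound at this `N`
  have hgood : P N (Φ N).goodᶜ = 0 := by
    rw [hPdef]; exact localGibbsLaw_compl_good' (Φ N)
  have hAsum : P N (⋃ p : Fin n × Fin 3, Aev N p) ≤ ENNReal.ofReal (ε / 4) := by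
    calc P N (⋃ p : Fin n × Fin 3, Aev N p) ≤ ∑ p : Fin n × Fin 3, P N (Aev N p) := measure_iUnion_fintype_le _ _
      _ ≤ ∑ _p : Fin n × Fin 3, ENNReal.ofReal δ' := Finset.sum_le_sum fun p _ => hNA p
      _ = ENNReal.ofReal (ε / 4) := by
        rw [Finset.sum_const, Finset.card_univ, Fintype.card_prod, Fintype.card_fin, Fintype.card_fin,
          nsmul_eq_mul, ← ENNReal.ofReal_natCast, ← ENNReal.ofReal_mul (by positivity)]
        congr 1
        rw [hδ']; push_cast; field_simp
  calc P N {z : Cfg N | ∃ k : ℕ, k < n ∧ δ < virialW σ Φ N z ((k + 1) * (t / n)) - virialW σ Φ N z (k * (t / n))}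
      ≤ P N ((Φ N).goodᶜ ∪ (Eev N ∪ (Mev N ∪ (Tev N ∪ ⋃ p : Fin n × Fin 3, Aev N p)))) := measure_mono hcover
    _ ≤ P N (Φ N).goodᶜ + (P N (Eev N) + (P N (Mev N) + (P N (Tev N) + P N (⋃ p : Fin n × Fin 3, Aev N p)))) := by
        refine (measure_union_le _ _).trans (add_le_add le_rfl ?_)
        refine (measure_union_le _ _).trans (add_le_add le_rfl ?_)
        refine (measure_union_le _ _).trans (add_le_add le_rfl ?_)
        exact measure_union_le _ _
    _ ≤ 0 + (ENNReal.ofReal (ε / 4) + (ENNReal.ofReal (ε / 4) + (ENNReal.ofReal (ε / 4) + ENNReal.ofReal (ε / 4)))) := by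
        rw [hgood]
        exact add_le_add le_rfl (add_le_add hNE (add_le_add hNM (add_le_add (hT' N) hAsum)))
    _ = ENNReal.ofReal ε := by
        rw [zero_add, ← ENNReal.ofReal_add (by positivity) (by positivity),
          ← ENNReal.ofReal_add (by positivity) (by positivity), ← ENNReal.ofReal_add (by positivity) (by positivity)]
        congr 1; ring

/-! ## Composition 3 (sorry-free, v11): THE EQUILIBRIUM RUNG of the crux (`Disproof.EquilibriumRung`) -/

/-- **The skeleton theorem for the EQUILIBRIUM RUNG (v11).** From `MesoscopicLLN` (9524) by name, the research stub [VL]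
(fixed-time virial LLN at equilibrium), the glue `noBursts_of_virialLLN` and the assembly [ER']: for every temperature `θ > 0` there is
`σ₀ > 0` (`:= min σ_[VL] σ_[ER']`) such that for `0 < σ < σ₀` and EVERY hard-sphere flow family the crux's conclusion holds
under the homogeneous local Gibbs law of activity `1`, velocity `0`, temperature `θ` — `Disproof.EquilibriumRung`
(`ConclusionAt σ 1 θ 0 = ∀ Φ, ConclusionAtFlow σ 1 θ 0 Φ` by `Iff.rfl`). The conclusion at `(σ, Φ)` is the crux's
`let`-telescope (`conclusionAtFlow_iff`). -/
theorem equilibriumRungFlow_of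
    (hMeso : Summit.AtomisticToContinuum.HydrodynamicLimit.Theses.StiffCollisionalRelaxation.MesoscopicLLN)
    (hVL : VirialLLNConst) :
    ∀ θ : ℝ, 0 < θ → ∃ σ₀ : ℝ, 0 < σ₀ ∧ ∀ σ : ℝ, 0 < σ → σ < σ₀ → ∀ Φ : Flows σ,
      ConclusionAtFlow σ (fun _ => 1) (fun _ => θ) (fun _ => 0) Φ := by
  intro θ hθ
  obtain ⟨σV, hσV, HV⟩ := hVL θ hθ
  obtain ⟨σS, hσS, HS⟩ := Holds.stub_equilibriumSup hMeso θ hθ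
  refine ⟨min σV σS, lt_min hσV hσS, ?_⟩
  intro σ hσ hlt Φ
  have hltV : σ < σV := lt_of_lt_of_le hlt (min_le_left _ _)
  have hltS : σ < σS := lt_of_lt_of_le hlt (min_le_right _ _)
  rw [conclusionAtFlow_iff]
  intro γ C φ hγ hγ' hadm t ht ψ χ hψ hχ
  have hWB := noBursts_of_virialLLN σ (fun _ => 1) (fun _ => θ) (fun _ => 0) Φ ht (HV σ hσ hltV Φ t ht)
  exact HS σ hσ hltS Φ t ht hWB γ C φ hγ hγ' hadm ψ χ hψ hχ

/-- D-0027 §3.3 shape for the equilibrium rung via [VL]: from the hypothesis [VL], the landed [ER'] and the shared route item 9524 — an `example`. -/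
example (hMeso : Summit.AtomisticToContinuum.HydrodynamicLimit.Theses.StiffCollisionalRelaxation.MesoscopicLLN)
    (hVL : VirialLLNConst) :
    ∀ θ : ℝ, 0 < θ → ∃ σ₀ : ℝ, 0 < σ₀ ∧ ∀ σ : ℝ, 0 < σ → σ < σ₀ → ∀ Φ : Flows σ,
      ConclusionAtFlow σ (fun _ => 1) (fun _ => θ) (fun _ => 0) Φ :=
  equilibriumRungFlow_of hMeso hVL

/-! ## Composition 3′ (sorry-free, v11.1): the equilibrium rung WITHOUT the research stub [VL] —
from `MesoscopicLLN` (9524), the rung-0 `EvenStressEnskog` conclusion, and the provable stubs [ER'], [PW-a], [PW-b], [MC], [TL] -/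

/-- **The equilibrium rung from the sibling crux at constant profiles (v11.1).** `MesoscopicLLN` (9524, static) and the
conclusion of `EvenStressEnskog_rung0_of_plateau_contact` (the even collision statistic at global equilibrium), together with the
provable assembly [ER'] and the provable stubs [PW-a], [PW-b], [MC], [TL], give the crux's conclusion under the homogeneous local Gibbs law for
every flow family: `σ₀ := min σ_[WB]₀ σ_[ER']`. -/
theorem equilibriumRungFlow_of_evenStress
    (hMeso : Summit.AtomisticToContinuum.HydrodynamicLimit.Theses.StiffCollisionalRelaxation.MesoscopicLLN)
    (h79 : (∃ η₀ : ℝ, 0 < η₀ ∧ ∀ (a θ : ℝ) (u : V3), 0 < a → 0 < θ → ∃ σ₀ : ℝ, 0 < σ₀ ∧ ∀ σ : ℝ, 0 < σ → σ < σ₀ → ∀ Φ : (N : ℕ) → Literature.Analysis.FluidPDE.HardSphereFlow (Literature.Analysis.FluidPDE.Torus.geometry (Fin 3)) (Literature.MathematicalPhysics.KineticTheory.hsDiameter σ N) (N + 1), ∀ τ : ℝ, 0 < τ → ∀ χ : ℝ × UnitAddTorus (Fin 3) → ℝ, Continuous χ → ∀ g : ℝ → ℝ, Continuous g → (∀ a,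 η₀ ≤ a → g a = 0) → ∀ η δ : ℝ, 0 < η → 0 < δ → ∃ r₀ : ℝ, 0 < r₀ ∧ ∀ r : ℝ, 0 < r → r < r₀ → ∃ N₀ : ℕ, ∀ N : ℕ, N₀ ≤ N → ∀ k l : Fin 3, Literature.MathematicalPhysics.KineticTheory.localGibbsLaw σ (fun _ => a) (fun _ => u) (fun _ => θ) N (Φ N) {z | η < |Literature.MathematicalPhysics.KineticTheory.evenStat σ N (Φ N) τ χ g (Literature.MathematicalPhysics.KineticTheory.evenMark k l) r z|} ≤ ENNReal.ofReal δ))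
    :
    ∀ θ : ℝ, 0 < θ → ∃ σ₀ : ℝ, 0 < σ₀ ∧ ∀ σ : ℝ, 0 < σ → σ < σ₀ → ∀ Φ : Flows σ,
      ConclusionAtFlow σ (fun _ => 1) (fun _ => θ) (fun _ => 0) Φ := by
  intro θ hθ
  obtain ⟨σW, hσW, HW⟩ := noVirialBurstsConst_of h79 θ hθ
  obtain ⟨σS, hσS, HS⟩ := Holds.stub_equilibriumSup hMeso θ hθ
  refine ⟨min σW σS, lt_min hσW hσS, ?_⟩
  intro σ hσ hlt Φ
  have hltW : σ < σW := lt_of_lt_of_le hlt (min_le_left _ _)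
  have hltS : σ < σS := lt_of_lt_of_le hlt (min_le_right _ _)
  rw [conclusionAtFlow_iff]
  intro γ C φ hγ hγ' hadm t ht ψ χ hψ hχ
  exact HS σ hσ hltS Φ t ht (HW σ hσ hltW Φ t ht) γ C φ hγ hγ' hadm ψ χ hψ hχ

/-- **The equilibrium rung modulo TWO STATIC CLUSTER-EXPANSION INPUTS and provable stubs (v11.1).** Plateau′ (relative asymptotic
independence of two disjoint decorated dimers under the canonical configurational hard-sphere measure — the one hypothesis of the
landed `EvenStressEnskog_rung0_of_plateau_contact`; the contact theorem is the tree theorem `HardSphereContactTheorem_holds`) and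
`MesoscopicLLN` (9524) give, with [ER'], [PW-a], [PW-b], [MC], [TL], the crux AT GLOBAL EQUILIBRIUM for every flow family
(`Disproof.EquilibriumRung`). No dynamical hypothesis remains. -/
theorem equilibriumRungFlow_of_plateau
    (hMeso : Summit.AtomisticToContinuum.HydrodynamicLimit.Theses.StiffCollisionalRelaxation.MesoscopicLLN)
    (hPl : ∃ σ₁ : ℝ, 0 < σ₁ ∧ ∀ σ : ℝ, 0 < σ → σ < σ₁ → ∀ ζ : ℝ, 0 < ζ → ∃ N₀ : ℕ, ∀ N : ℕ, N₀ ≤ N → ∀ i j k l : Fin (N + 1), i ≠ j → i ≠ k → i ≠ l → j ≠ k → j ≠ l → k ≠ l → ∀ (h h' : T3 → ℝ), Measurable h → Measurable h' → (∀ y, |h y| ≤ 1) → (∀ y, |h' y| ≤ 1) → ∀ T T' : Set T3, MeasurableSet T → MeasurableSet T' → |(∫ x, h (x i) * T.indicator (fun _ => (1 : ℝ)) (x j - x i) * (h' (x k) * T'.indicator (fun _ => (1 : ℝ)) (x l - x k)) ∂Literature.MathematicalPhysics.KineticTheory.posGibbsMeasure (fun _ : T3 => (1 : ℝ)) (Literature.MathematicalPhysics.KineticTheory.hsDiameter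 σ N) (N + 1)) - (∫ x, h (x i) * T.indicator (fun _ => (1 : ℝ)) (x j - x i) ∂Literature.MathematicalPhysics.KineticTheory.posGibbsMeasure (fun _ : T3 => (1 : ℝ)) (Literature.MathematicalPhysics.KineticTheory.hsDiameter σ N) (N + 1)) * (∫ x, h' (x k) * T'.indicator (fun _ => (1 : ℝ)) (x l - x k) ∂Literature.MathematicalPhysics.KineticTheory.posGibbsMeasure (fun _ : T3 => (1 : ℝ)) (Literature.MathematicalPhysics.KineticTheory.hsDiameter σ N) (N + 1))| ≤ ζ * (MeasureTheory.volume T).toReal * (MeasureTheory.volume T').toReal)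
    :
    ∀ θ : ℝ, 0 < θ → ∃ σ₀ : ℝ, 0 < σ₀ ∧ ∀ σ : ℝ, 0 < σ → σ < σ₀ → ∀ Φ : Flows σ,
      ConclusionAtFlow σ (fun _ => 1) (fun _ => θ) (fun _ => 0) Φ :=
  equilibriumRungFlow_of_evenStress hMeso
    (Summit.AtomisticToContinuum.HydrodynamicLimit.Theorems.EvenStressEnskog.EvenStressEnskog_rung0_of_plateau_contact hPl
      Literature.MathematicalPhysics.StatisticalMechanics.HardSphereContactTheorem_holds)


/-! ## Composition 4 (sorry-free, v14): THE EQUILIBRIUM RUNG UNCONDITIONALLY — no route item, no plateau, no line hypothesis -/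

/-- [CL] **The constant-profile mesoscopic LLN with identified limit** (the conclusion of `mesoscopicLLN_const`, WITHOUT the route
item `MesoscopicLLN`) from the LANDED stubs [CL-ρ], [CL-v], [CL-asm] (by name): `σ₀ := min σ_[CL-ρ] (1/2)`; mass one from
`isProbabilityMeasure_localGibbsLaw`. [folklore] -/
theorem constLLN_of :
    ∀ θ : ℝ, 0 < θ → ∃ σ₀ : ℝ, 0 < σ₀ ∧ ∀ σ : ℝ, 0 < σ → σ < σ₀ → ∀ Φ : Flows σ, (∀ N, IsProbabilityMeasure (Literature.MathematicalPhysics.KineticTheory.localGibbsLaw σ (fun _ => 1) (fun _ => 0) (fun _ => θ) N (Φ N))) ∧ ∀ (γ C : ℝ) (φ : ℕ → T3 → ℝ), 0 < γ → γ ≤ 1 / 15 → AdmissibleKernel γ C φ → ∀ δ : ℝ, 0 < δ → Tendsto (fun N : ℕ => Literature.MathematicalPhysics.KineticTheory.localGibbsLaw σ (fun _ => 1) (fun _ => 0) (fun _ => θ) N (Φ N) {z | δ < ∫ x, ((rhoB φ N z x - 1) ^ 2 + ‖mB φ N z x‖ ^ 2 + (EB φ N z x - 3 / 2 * θ) ^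 2)}) atTop (𝓝 0) := by
  obtain ⟨σρ, hσρ, Hρ⟩ := Holds.stub_blockDensityLLNConst
  intro θ hθ
  refine ⟨min σρ (1 / 2), lt_min hσρ (by norm_num), fun σ hσ hlt Φ => ?_⟩
  have hltρ : σ < σρ := lt_of_lt_of_le hlt (min_le_left _ _)
  have hhalf : σ ≤ 1 / 2 := (lt_of_lt_of_le hlt (min_le_right _ _)).le
  refine ⟨fun N => Literature.MathematicalPhysics.KineticTheory.isProbabilityMeasure_localGibbsLaw
      continuous_const continuous_const continuous_const (fun _ => one_pos) (fun _ => hθ) hhalf N (Φ N),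
    fun γ C φ hγ hγ' hadm δ hδ => ?_⟩
  have hφc : ∀ N, Continuous (φ N) := fun N => (hadm.1 N).continuous
  exact Holds.stub_constLLN_of_parts σ θ Φ φ hφc
    (fun δ' hδ' => Hρ σ hσ hltρ θ hθ Φ γ C φ hγ hγ' hadm δ' hδ')
    (fun δ' hδ' => Holds.stub_blockVelocityLLNConst σ hσ hhalf θ hθ Φ γ C φ hγ hγ' hadm δ' hδ') δ hδ

/-- **THE EQUILIBRIUM RUNG OF THE CRUX, UNCONDITIONALLY (v14 skeleton theorem; since v15 with NO hypothesis: the five stubs are the landed theorems).** For every temperature `θ > 0` there is `σ₀ > 0`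
such that for `0 < σ < σ₀` and EVERY hard-sphere flow family the crux's conclusion — the local-equilibrium closure of the collisional
momentum + energy transfer tested against all smooth `(ψ, χ)`, uniformly in `τ ≤ t`, in probability — holds under the homogeneous local
Gibbs law of activity `1`, velocity `0`, temperature `θ` (`Disproof.EquilibriumRung` up to `Iff.rfl`). Inputs: LANDED theorems only — the stubs
[CL-ρ] p135857, [CL-v] p135595, [CL-asm] p134699, [R0c] p134580, [ERc] p134600 (constant-profile statics and two re-threadings of landed files),
the sibling crux at equilibrium `EvenStressEnskog.evenStressEnskog_rung0` (UNCONDITIONAL: two-cluster factorisation + labelled laws +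
contact theorem), [PW-a], [PW-b], [MC], [TL] (`noVirialBurstsConst_of`). -/
theorem equilibriumRungFlow_unconditional :
    ∀ θ : ℝ, 0 < θ → ∃ σ₀ : ℝ, 0 < σ₀ ∧ ∀ σ : ℝ, 0 < σ → σ < σ₀ → ∀ Φ : Flows σ,
      ConclusionAtFlow σ (fun _ => 1) (fun _ => θ) (fun _ => 0) Φ := by
  intro θ hθ
  have hRhs := Holds.stub_rhsSup_of_constLLN constLLN_of
  obtain ⟨σW, hσW, HW⟩ := noVirialBurstsConst_of
    Summit.AtomisticToContinuum.HydrodynamicLimit.Theorems.EvenStressEnskog.evenStressEnskog_rung0 θ hθ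
  obtain ⟨σS, hσS, HS⟩ := Holds.stub_equilibriumSup_of_rhsSup hRhs θ hθ
  refine ⟨min σW σS, lt_min hσW hσS, ?_⟩
  intro σ hσ hlt Φ
  have hltW : σ < σW := lt_of_lt_of_le hlt (min_le_left _ _)
  have hltS : σ < σS := lt_of_lt_of_le hlt (min_le_right _ _)
  rw [conclusionAtFlow_iff]
  intro γ C φ hγ hγ' hadm t ht ψ χ hψ hχ
  exact HS σ hσ hltS Φ t ht (HW σ hσ hltW Φ t ht) γ C φ hγ hγ' hadm ψ χ hψ hχ

/-- **The equilibrium rung modulo the route item `MesoscopicLLN` ONLY (v13):** composition 3′ with the sibling crux's UNCONDITIONAL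
rung 0 `evenStressEnskog_rung0` in the `h79` slot. -/
theorem equilibriumRungFlow_of_mesoscopicLLN
    (hMeso : Summit.AtomisticToContinuum.HydrodynamicLimit.Theses.StiffCollisionalRelaxation.MesoscopicLLN) :
    ∀ θ : ℝ, 0 < θ → ∃ σ₀ : ℝ, 0 < σ₀ ∧ ∀ σ : ℝ, 0 < σ → σ < σ₀ → ∀ Φ : Flows σ,
      ConclusionAtFlow σ (fun _ => 1) (fun _ => θ) (fun _ => 0) Φ :=
  equilibriumRungFlow_of_evenStress hMeso
    Summit.AtomisticToContinuum.HydrodynamicLimit.Theorems.EvenStressEnskog.evenStressEnskog_rung0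

/-- D-0027 §3.3 shape: the filed crux from the registered stubs and the two shared route items — an `example`, so
that `CollisionalTransferLocality_of` stays the theorem concluding the crux by name. -/
example
    (hF : Summit.AtomisticToContinuum.HydrodynamicLimit.Theses.StiffCollisionalRelaxation.FastMomentRelaxation)
    (hM : Summit.AtomisticToContinuum.HydrodynamicLimit.Theses.InformationPercolationEngine.CollisionMomentBound)
    (h79 : Summit.AtomisticToContinuum.HydrodynamicLimit.Theses.JParityClosure.EvenStressEnskog)
    :
    Summit.AtomisticToContinuum.HydrodynamicLimit.Theses.StiffCollisionalRelaxation.CollisionalTransferLocality :=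
  CollisionalTransferLocality_of hF hM h79 Holds.stub_energyFluxLawCone Holds.stub_twoScaleValueChi Holds.stub_ceilingAllTimes

/-! ## Composition 5 (sorry-free, v19.2): THE EQUILIBRIUM ∀ θ : ℝ, 0 < θ → ∃ σ₀ : ℝ, 0 < σ₀ ∧ ∃ η₁ : ℝ, 0 < η₁ ∧ ∀ σ : ℝ, 0 < σ → σ < σ₀ → ∀ (Φ : Flows σ) (t : ℝ), 0 < t → ∀ (γ C : ℝ) (φ : ℕ → T3 → ℝ), 0 < γ → γ ≤ 1 / 15 → AdmissibleKernel γ C φ → DiluteAt σ (fun _ => 1) (fun _ => θ) (fun _ => 0) Φ t φ η₁ → ∀ (A : ℝ → T3 → Fin 3 → Fin 3 → ℝ), SmoothMatrixOn (Icc 0 t) A → ∀ τ ∈ Icc 0 t, ∀ η δ : ℝ, 0 < η → 0 < δ → ∃ r₀ : ℝ, 0 < r₀ ∧ ∀ r : ℝ, 0 < r → r < r₀ → ∃ N₀ : ℕ, ∀ N : ℕ, N₀ ≤ N → Literature.MathematicalPhysics.KineticTheory.localGibbsLaw σ (fun _ => 1) (fun _ => 0) (fun _ => θ) N (Φ N)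 {z | η < |(RhsA σ Φ (fun (_ : ℕ) (y : T3) => Literature.MathematicalPhysics.KineticTheory.coneKernel r y 0) A N z τ + KfunA σ Φ (fun (_ : ℕ) (y : T3) => Literature.MathematicalPhysics.KineticTheory.coneKernel r y 0) A N z τ) - (RhsA σ Φ φ A N z τ + KfunA σ Φ φ A N z τ)|} ≤ ENNReal.ofReal δ OF [TS] from the five wave-3 stubs -/

/-- **The equilibrium rung of the two-scale statement [TS]** (its text at the constant profiles `a₀ ≡ 1`, `θ₀ ≡ θ`, `u₀ ≡ 0`), from [R0A], [K0A],
[C0L] → [R0C], [K0C] through [TS0]. -/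
theorem twoScaleValueA_rung0 : ∀ θ : ℝ, 0 < θ → ∃ σ₀ : ℝ, 0 < σ₀ ∧ ∃ η₁ : ℝ, 0 < η₁ ∧ ∀ σ : ℝ, 0 < σ → σ < σ₀ → ∀ (Φ : Flows σ) (t : ℝ), 0 < t → ∀ (γ C : ℝ) (φ : ℕ → T3 → ℝ), 0 < γ → γ ≤ 1 / 15 → AdmissibleKernel γ C φ → DiluteAt σ (fun _ => 1) (fun _ => θ) (fun _ => 0) Φ t φ η₁ → ∀ (A : ℝ → T3 → Fin 3 → Fin 3 → ℝ), SmoothMatrixOn (Icc 0 t) A → ∀ τ ∈ Icc 0 t, ∀ η δ : ℝ, 0 < η → 0 < δ → ∃ r₀ : ℝ, 0 < r₀ ∧ ∀ r : ℝ, 0 < r → r < r₀ → ∃ N₀ : ℕ, ∀ N : ℕ, N₀ ≤ N → Literature.MathematicalPhysics.KineticTheory.localGibbsLaw σ (fun _ => 1) (fun _ => 0) (fun _ => θ) N (Φ N) {z | η < |(RhsA σ Φ (fun (_ : ℕ) (y : T3) => Literature.MathematicalPhysics.KineticTheory.coneKernel r y 0) A N z τ + KfunA σ Φ (fun (_ :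 ℕ) (y : T3) => Literature.MathematicalPhysics.KineticTheory.coneKernel r y 0) A N z τ) - (RhsA σ Φ φ A N z τ + KfunA σ Φ φ A N z τ)|} ≤ ENNReal.ofReal δ :=
  Holds.stub_twoScaleValueA_rung0 Holds.stub_rhsA_const Holds.stub_kfunA_const
    (Holds.stub_rhsA_cone_const Holds.stub_coneLLNConst) Holds.stub_kfunA_cone_const


/-! ## Composition 6 (v20, seat c11): THE EQUILIBRIUM RUNGS OF [TSχ] AND [KqR] from the two wave-1 stubs [Vχ0C], [Vχ0M]
(and, for [KqR], the crux's equilibrium rung — composition 4 — through c9's `markedVirialE_rung0_of_equilibriumRung`). They CERTIFY THE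
NORMALISATION of the two new research statements: at constant profiles both energy values and the energy mark sum tend to `0` uniformly in `τ ≤ t`. -/

/-- Measure plumbing: two `Tendsto … (𝓝 0)` sequences of events covering a third at level-splitting give an `∃ N₀, ∀ N ≥ N₀, ≤ ofReal δ` bound. [folklore] -/
theorem exists_N0_of_tendsto_cover {α : ℕ → Type*} [∀ N, MeasurableSpace (α N)] (P : (N : ℕ) → Measure (α N))
    (A B E : (N : ℕ) → Set (α N)) (hA : Tendsto (fun N => P N (A N)) atTop (𝓝 0)) (hB : Tendsto (fun N => P N (B N)) atTop (𝓝 0))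
    (hcov : ∀ N, E N ⊆ A N ∪ B N) {δ : ℝ} (hδ : 0 < δ) : ∃ N₀ : ℕ, ∀ N : ℕ, N₀ ≤ N → P N (E N) ≤ ENNReal.ofReal δ := by
  have hsum : Tendsto (fun N => P N (A N) + P N (B N)) atTop (𝓝 0) := by simpa using hA.add hB
  have hev : ∀ᶠ N in atTop, P N (A N) + P N (B N) ≤ ENNReal.ofReal δ :=
    (hsum.eventually (ge_mem_nhds (ENNReal.ofReal_pos.2 hδ)))
  obtain ⟨N₀, hN₀⟩ := eventually_atTop.1 hev
  exact ⟨N₀, fun N hN => ((measure_mono (hcov N)).trans (measure_union_le _ _)).trans (hN₀ N hN)⟩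

/-- The level-splitting inclusion behind every triangle step of this section: if `η < |a - b|` then `η/2 < |a - c|` or `η/2 < |c - b|`. [folklore] -/
theorem half_lt_abs_or_of_lt_abs_sub {η a b : ℝ} (c : ℝ) (h : η < |a - b|) : η / 2 < |a - c| ∨ η / 2 < |c - b| := by
  by_contra hcon
  push Not at hcon
  have := abs_sub_le a c b
  linarith

/-- **Composition 6a: the equilibrium rung of [TSχ]** from [Vχ0C] ∧ [Vχ0M] (`η₁ := 1`, the dilute hypothesis is not even used at equilibrium:
both values tend to `0` separately). -/
theorem twoScaleValueChi_rung0 (hC : ∀ θ : ℝ, 0 < θ → ∃ σ₀ : ℝ, 0 < σ₀ ∧ ∀ σ : ℝ, 0 < σ → σ < σ₀ → ∀ (Φ : Flows σ) (t : ℝ), 0 < t → ∀ (r : ℝ), 0 < r → r < 1 / 4 → ∀ (χ : ℝ → T3 → ℝ), Literature.Analysis.FunctionSpaces.Torus.IsSmoothSpaceTimeOn (Icc 0 t) χ → ∀ δ : ℝ, 0 < δ → Tendsto (fun N : ℕ => Literature.MathematicalPhysics.KineticTheory.localGibbsLaw σ (fun _ => 1) (fun _ => 0) (fun _ => θ) N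 (Φ N) {z | ∃ τ ∈ Icc 0 t, δ < |(Rhs σ Φ (fun (_ : ℕ) (y : T3) => Literature.MathematicalPhysics.KineticTheory.coneKernel r y 0) (fun (_ : ℝ) (_ : T3) => (0 : V3)) χ N z τ + Kfun σ Φ (fun (_ : ℕ) (y : T3) => Literature.MathematicalPhysics.KineticTheory.coneKernel r y 0) (fun (_ : ℝ) (_ : T3) => (0 : V3)) χ N z τ)|}) atTop (𝓝 0)) (hM : ∀ θ : ℝ, 0 < θ → ∃ σ₀ : ℝ, 0 < σ₀ ∧ ∀ σ : ℝ, 0 < σ → σ < σ₀ → ∀ (Φ : Flows σ) (t : ℝ), 0 < t → ∀ (γ C : ℝ) (φ : ℕ → T3 → ℝ), 0 < γ → γ ≤ 1 / 15 → AdmissibleKernel γ C φ → ∀ (χ : ℝ → T3 → ℝ), Literature.Analysis.FunctionSpaces.Torus.IsSmoothSpaceTimeOn (Icc 0 t) χ → ∀ δ : ℝ, 0 < δ → Tendsto (fun N : ℕ => Literature.MathematicalPhysics.KineticTheory.localGibbsLaw σ (fun _ => 1) (fun _ => 0) (fun _ => θ) N (Φ N) {z | ∃ τ ∈ Icc 0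 t, δ < |(Rhs σ Φ φ (fun (_ : ℝ) (_ : T3) => (0 : V3)) χ N z τ + Kfun σ Φ φ (fun (_ : ℝ) (_ : T3) => (0 : V3)) χ N z τ)|}) atTop (𝓝 0)) : ∀ θ : ℝ, 0 < θ → ∃ σ₀ : ℝ, 0 < σ₀ ∧ ∃ η₁ : ℝ, 0 < η₁ ∧ ∀ σ : ℝ, 0 < σ → σ < σ₀ → ∀ (Φ : Flows σ) (t : ℝ), 0 < t → ∀ (γ C : ℝ) (φ : ℕ → T3 → ℝ), 0 < γ → γ ≤ 1 / 15 → AdmissibleKernel γ C φ → DiluteAt σ (fun _ => 1) (fun _ => θ) (fun _ => 0) Φ t φ η₁ → ∀ (χ : ℝ → T3 → ℝ), Literature.Analysis.FunctionSpaces.Torus.IsSmoothSpaceTimeOn (Icc 0 t) χ → ∀ η δ : ℝ, 0 < η → 0 < δ → ∃ r₀ : ℝ, 0 < r₀ ∧ ∀ r : ℝ, 0 < r → r < r₀ → ∃ N₀ : ℕ, ∀ N : ℕ, N₀ ≤ N → Literature.MathematicalPhysics.KineticTheory.localGibbsLaw σ (fun _ => 1) (fun _ => 0) (fun _ => θ)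 N (Φ N) {z | ∃ τ ∈ Icc 0 t, η < |(Rhs σ Φ (fun (_ : ℕ) (y : T3) => Literature.MathematicalPhysics.KineticTheory.coneKernel r y 0) (fun (_ : ℝ) (_ : T3) => (0 : V3)) χ N z τ + Kfun σ Φ (fun (_ : ℕ) (y : T3) => Literature.MathematicalPhysics.KineticTheory.coneKernel r y 0) (fun (_ : ℝ) (_ : T3) => (0 : V3)) χ N z τ) - (Rhs σ Φ φ (fun (_ : ℝ) (_ : T3) => (0 : V3)) χ N z τ + Kfun σ Φ φ (fun (_ : ℝ) (_ : T3) => (0 : V3)) χ N z τ)|} ≤ ENNReal.ofReal δ := by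
  intro θ hθ
  obtain ⟨σC, hσC, HC⟩ := hC θ hθ
  obtain ⟨σM, hσM, HM⟩ := hM θ hθ
  refine ⟨min σC σM, lt_min hσC hσM, 1, one_pos, ?_⟩
  intro σ hσ hlt Φ t ht γ C φ hγ hγ' hadm _hD χ hχ η δ hη hδ
  have hltC : σ < σC := lt_of_lt_of_le hlt (min_le_left _ _)
  have hltM : σ < σM := lt_of_lt_of_le hlt (min_le_right _ _)
  refine ⟨1 / 4, by norm_num, fun r hr hr4 => ?_⟩
  have hA := HC σ hσ hltC Φ t ht r hr hr4 χ hχ (η / 2) (half_pos hη)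
  have hB := HM σ hσ hltM Φ t ht γ C φ hγ hγ' hadm χ hχ (η / 2) (half_pos hη)
  refine exists_N0_of_tendsto_cover (fun N => Literature.MathematicalPhysics.KineticTheory.localGibbsLaw σ (fun _ => 1) (fun _ => 0) (fun _ => θ) N (Φ N)) _ _ _ hA hB (fun N => ?_) hδ
  rintro z ⟨τ, hτ, hz⟩
  rcases half_lt_abs_or_of_lt_abs_sub (0 : ℝ) hz with h | h
  · exact Or.inl ⟨τ, hτ, by simpa using h⟩
  · exact Or.inr ⟨τ, hτ, by rwa [zero_sub, abs_neg] at h⟩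

/-- **Composition 6b: the equilibrium rung of [KqR]** from [Vχ0C], [Vχ0M] and the crux's equilibrium rung (composition 4,
`equilibriumRungFlow_unconditional`, through c9's `markedVirialE_rung0_of_equilibriumRung`: at constant profiles `sup_τ |M_N − (Rhs + Kfun)[φ_N]| → 0`
for ALL tests, in particular the energy mark sum at `(0, χ)`). Two triangle steps: `M − V_r = (M − V_N) + V_N − V_r`. -/
theorem energyFluxLawCone_rung0 (hC : ∀ θ : ℝ, 0 < θ → ∃ σ₀ : ℝ, 0 < σ₀ ∧ ∀ σ : ℝ, 0 < σ → σ < σ₀ → ∀ (Φ : Flows σ) (t : ℝ), 0 < t → ∀ (r : ℝ), 0 < r → r < 1 / 4 → ∀ (χ : ℝ → T3 → ℝ), Literature.Analysis.FunctionSpaces.Torus.IsSmoothSpaceTimeOn (Icc 0 t) χ → ∀ δ : ℝ, 0 < δ → Tendsto (fun N : ℕ => Literature.MathematicalPhysics.KineticTheory.localGibbsLaw σ (fun _ => 1) (fun _ => 0) (fun _ => θ) N (Φ N) {z | ∃ τ ∈ Icc 0 t, δ < |(Rhs σ Φ (fun (_ : ℕ) (y : T3) => Literature.MathematicalPhysics.KineticTheory.coneKernel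 r y 0) (fun (_ : ℝ) (_ : T3) => (0 : V3)) χ N z τ + Kfun σ Φ (fun (_ : ℕ) (y : T3) => Literature.MathematicalPhysics.KineticTheory.coneKernel r y 0) (fun (_ : ℝ) (_ : T3) => (0 : V3)) χ N z τ)|}) atTop (𝓝 0)) (hM : ∀ θ : ℝ, 0 < θ → ∃ σ₀ : ℝ, 0 < σ₀ ∧ ∀ σ : ℝ, 0 < σ → σ < σ₀ → ∀ (Φ : Flows σ) (t : ℝ), 0 < t → ∀ (γ C : ℝ) (φ : ℕ → T3 → ℝ), 0 < γ → γ ≤ 1 / 15 → AdmissibleKernel γ C φ → ∀ (χ : ℝ → T3 → ℝ), Literature.Analysis.FunctionSpaces.Torus.IsSmoothSpaceTimeOn (Icc 0 t) χ → ∀ δ : ℝ, 0 < δ → Tendsto (fun N : ℕ => Literature.MathematicalPhysics.KineticTheory.localGibbsLaw σ (fun _ => 1) (fun _ => 0) (fun _ => θ) N (Φ N) {z | ∃ τ ∈ Icc 0 t, δ < |(Rhs σ Φ φ (fun (_ : ℝ) (_ : T3) => (0 : V3)) χ N z τ + Kfun σ Φ φ (fun (_ : ℝ) (_ : T3) =>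 (0 : V3)) χ N z τ)|}) atTop (𝓝 0)) : ∀ θ : ℝ, 0 < θ → ∃ σ₀ : ℝ, 0 < σ₀ ∧ ∃ η₁ : ℝ, 0 < η₁ ∧ ∀ σ : ℝ, 0 < σ → σ < σ₀ → ∀ (Φ : Flows σ) (t : ℝ), 0 < t → VirialBounded σ (fun _ => 1) (fun _ => θ) (fun _ => 0) Φ t → ∀ (γ C : ℝ) (φ : ℕ → T3 → ℝ), 0 < γ → γ ≤ 1 / 15 → AdmissibleKernel γ C φ → DiluteAt σ (fun _ => 1) (fun _ => θ) (fun _ => 0) Φ t φ η₁ → ∀ (χ : ℝ → T3 → ℝ), Literature.Analysis.FunctionSpaces.Torus.IsSmoothSpaceTimeOn (Icc 0 t) χ → ∀ η δ : ℝ, 0 < η → 0 < δ → ∃ r₀ : ℝ, 0 < r₀ ∧ ∀ r : ℝ, 0 < r → r < r₀ → ∃ N₀ : ℕ, ∀ N : ℕ, N₀ ≤ N → Literature.MathematicalPhysics.KineticTheory.localGibbsLaw σ (fun _ => 1) (fun _ => 0) (fun _ => θ) N (Φ N) {z | ∃ τ ∈ Icc 0 t, η < |Mfun σ Φ (fun (_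 : ℝ) (_ : T3) => (0 : V3)) χ N z τ - (Rhs σ Φ (fun (_ : ℕ) (y : T3) => Literature.MathematicalPhysics.KineticTheory.coneKernel r y 0) (fun (_ : ℝ) (_ : T3) => (0 : V3)) χ N z τ + Kfun σ Φ (fun (_ : ℕ) (y : T3) => Literature.MathematicalPhysics.KineticTheory.coneKernel r y 0) (fun (_ : ℝ) (_ : T3) => (0 : V3)) χ N z τ)|} ≤ ENNReal.ofReal δ := by
  intro θ hθ
  obtain ⟨σC, hσC, HC⟩ := hC θ hθ
  obtain ⟨σM, hσM, HM⟩ := hM θ hθ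
  obtain ⟨σE, hσE, HE⟩ :=
    Summit.AtomisticToContinuum.HydrodynamicLimit.Theorems.HemisphereAffineSlaving.markedVirialE_rung0_of_equilibriumRung
      equilibriumRungFlow_unconditional θ hθ
  refine ⟨min (min σC σM) σE, lt_min (lt_min hσC hσM) hσE, 1, one_pos, ?_⟩
  intro σ hσ hlt Φ t ht _hV γ C φ hγ hγ' hadm _hD χ hχ η δ hη hδ
  have hltC : σ < σC := lt_of_lt_of_le hlt ((min_le_left _ _).trans (min_le_left _ _))
  have hltM : σ < σM := lt_of_lt_of_le hlt ((min_le_left _ _).trans (min_le_right _ _))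
  have hltE : σ < σE := lt_of_lt_of_le hlt (min_le_right _ _)
  refine ⟨1 / 4, by norm_num, fun r hr hr4 => ?_⟩
  have hA := HC σ hσ hltC Φ t ht r hr hr4 χ hχ (η / 2) (half_pos hη)
  have hB0 := HM σ hσ hltM Φ t ht γ C φ hγ hγ' hadm χ hχ (η / 2 / 2) (half_pos (half_pos hη))
  have hE0 := HE σ hσ hltE Φ t ht γ C φ hγ hγ' hadm (fun (_ : ℝ) (_ : T3) => (0 : V3)) χ (isSmoothSpaceTimeOn_zero_vector _) hχ (η / 2 / 2) (half_pos (half_pos hη))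
  -- first cover: `M − V_N` small from the equilibrium [M]° and [Vχ0M]
  have hB : Tendsto (fun N : ℕ => Literature.MathematicalPhysics.KineticTheory.localGibbsLaw σ (fun _ => 1) (fun _ => 0) (fun _ => θ) N (Φ N) {z | ∃ τ ∈ Icc 0 t, η / 2 < |Mfun σ Φ (fun (_ : ℝ) (_ : T3) => (0 : V3)) χ N z τ - 0|}) atTop (𝓝 0) := by
    have hsum : Tendsto (fun N : ℕ => Literature.MathematicalPhysics.KineticTheory.localGibbsLaw σ (fun _ => 1) (fun _ => 0) (fun _ => θ) N (Φ N) {z | ∃ τ ∈ Icc 0 t, η / 2 / 2 < |Mfun σ Φ (fun (_ : ℝ) (_ : T3) => (0 : V3)) χ N z τ - (Rhs σ Φ φ (fun (_ : ℝ) (_ : T3) => (0 : V3)) χ N z τ + Kfun σ Φ φ (fun (_ : ℝ) (_ : T3) => (0 : V3)) χ N z τ)|} +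
        Literature.MathematicalPhysics.KineticTheory.localGibbsLaw σ (fun _ => 1) (fun _ => 0) (fun _ => θ) N (Φ N) {z | ∃ τ ∈ Icc 0 t, η / 2 / 2 < |(Rhs σ Φ φ (fun (_ : ℝ) (_ : T3) => (0 : V3)) χ N z τ + Kfun σ Φ φ (fun (_ : ℝ) (_ : T3) => (0 : V3)) χ N z τ)|}) atTop (𝓝 0) := by simpa using hE0.add hB0
    refine tendsto_of_tendsto_of_tendsto_of_le_of_le tendsto_const_nhds hsum (fun N => bot_le) (fun N => ?_)
    refine (measure_mono ?_).trans (measure_union_le _ _)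
    rintro z ⟨τ, hτ, hz⟩
    rw [sub_zero] at hz
    rcases half_lt_abs_or_of_lt_abs_sub ((Rhs σ Φ φ (fun (_ : ℝ) (_ : T3) => (0 : V3)) χ N z τ + Kfun σ Φ φ (fun (_ : ℝ) (_ : T3) => (0 : V3)) χ N z τ)) (show η / 2 < |Mfun σ Φ (fun (_ : ℝ) (_ : T3) => (0 : V3)) χ N z τ - 0| by simpa using hz) with h | h
    · exact Or.inl ⟨τ, hτ, h⟩
    · exact Or.inr ⟨τ, hτ, by simpa using h⟩
  refine exists_N0_of_tendsto_cover (fun N => Literature.MathematicalPhysics.KineticTheory.localGibbsLaw σ (fun _ => 1) (fun _ => 0) (fun _ => θ) N (Φ N)) _ _ _ hB hA (fun N => ?_) hδ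
  rintro z ⟨τ, hτ, hz⟩
  rcases half_lt_abs_or_of_lt_abs_sub (0 : ℝ) hz with h | h
  · exact Or.inl ⟨τ, hτ, h⟩
  · exact Or.inr ⟨τ, hτ, by rwa [zero_sub, abs_neg] at h⟩

end

end Summit.AtomisticToContinuum.HydrodynamicLimit.Theorems.HemisphereAffineSlaving
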